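import Summits.AtomisticToContinuum.HydrodynamicLimit.Theses.JParityClosure
import Literature.Analysis.FluidPDE.HardSphereCollisionRecord
import Literature.Analysis.FluidPDE.HardSphereFreeStretch
import Literature.MathematicalPhysics.KineticTheory.TaggedSphereCarleman
import Summits.AtomisticToContinuum.HydrodynamicLimit.Theorems.JParityClosureRateFloorPerParticleFreeStretch
import Summits.AtomisticToContinuum.HydrodynamicLimit.Theorems.JParityClosureRateFloorWouldBeRealised
import Summits.AtomisticToContinuum.HydrodynamicLimit.Theorems.JParityClosureRateFloorWindowPreemption
import Summits.AtomisticToContinuum.HydrodynamicLimit.Theorems.JParityClosureRateFloorRealisedDatum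
import Summits.AtomisticToContinuum.HydrodynamicLimit.Theorems.JParityClosureRateFloorCountTransfer
import Summits.AtomisticToContinuum.HydrodynamicLimit.Theorems.JParityClosureRateFloorCollisionEquipartition
import Summits.AtomisticToContinuum.HydrodynamicLimit.Theorems.JParityClosureRateFloorMarkedTransfer
import Summits.AtomisticToContinuum.HydrodynamicLimit.Theorems.JParityClosureRateFloorPathwiseTransfer
import Summits.AtomisticToContinuum.HydrodynamicLimit.Theorems.JParityClosureRateFloorRealisedCap
import Summits.AtomisticToContinuum.HydrodynamicLimit.Theorems.JParityClosureRateFloorPreemptionCharge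
import Summits.AtomisticToContinuum.HydrodynamicLimit.Theorems.JParityClosureRateFloorLineDefs
import Summits.AtomisticToContinuum.HydrodynamicLimit.Theorems.JParityClosureRateFloorNoBurstsRung0
import Summits.AtomisticToContinuum.HydrodynamicLimit.Theorems.JParityClosureRateFloorStaticFloorRung0Closed
import Summits.AtomisticToContinuum.HydrodynamicLimit.Theorems.LambertianContactSwapSwapGapGibbsDomination
import Literature.Probability.Divergences.EntropyEventBound
import Literature.Probability.Entropy.EntropyMethodNecessity

/-!
# Line `Sketch` for crux `JParityClosure.RateFloor` (stmt-AtomisticToContinuum-13080) — lead's skeleton, GEN 1, continuation c4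

Leads: gen 0 prover-line-stmt-AtomisticToContinuum-13080-0, gen 1 …-13080-1, continuation seats c1–c4 (2026-08-16).  Origin: crux-ideate r1
ideator 3's `Sketch.lean` (tree copy `Cruxes/RateFloor/IdeatorThreeSketch.lean`).  Full narrative of the gen-1 shape (transfer through the
WOULD-BE functional; sure inequalities `K ≥ S_R`, `S_R` cap, `S_W ≤ S_R + M·Bursts`; leaves S7a NoBursts, S7b StaticOpacityFloor; rung 0 closed by
c3) is in the card `Lines/Sketch.md` and in the crux-dir history of this file (up to commit e55f0dca7ede); the per-stub docstrings below are kept.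

REGISTERED STUBS (c4 v6): S7a `stub_noBursts`, S7b `stub_staticOpacityFloor` (OPEN, general profiles, gen-1 composition `rateFloor_of_noBursts_staticFloor`,
§8); S11 `stub_eqSuperExpDeficit` (§7½ entropy transfer — composition PROVED, tree p125013; the stub is HEURISTICALLY FALSE for the filed crux, §7¾,
kept as record); S12 `stub_measure_le_exp_of_entropyClass` (CLOSED p125051); S13 `stub_klDiv_localGibbsLaw_drift_le` (§7¾′, CLOSED p126421; turns the
shear witness into `ShearDeficitPersistence → ¬EntropyClassRateFloor`); records `stub_rateFloorGAfterR` (p125525), `stub_rateFloorGAfterEta` (p126309);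
restatements with PROVED transfers: (b') `RateFloorFlat` §7¾, (a) `RateFloorKinetic` §7⅞.  All gen-0/1 kinematic stubs S1–S6, S8–S10 and both
rung-0 leaves S7a₀, S7b₀ are landed and imported (p86465 p86380 p88768 p86823 p86780 p89367 p89470 p91691 p92720 p97016 p98025 p98201 p122968
p123314; compositions p123815).

DISPROOF USED (`Cruxes/RateFloor/Disproof.lean` v6; Negative/WithoutEtaPos p73162, Negative/RAfterN p73513): `η > 0` and the order `r` before `N`
are load-bearing in BOTH compositions (the entropy transfer's whole mechanism is `r₀ := r₀(L(δ, profiles))`); c4 adds the orders `g₀` before `r`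
(GAfterR) and `g₀` before `η` (GAfterEta): otherwise junk-true by energy conservation (+ packing).  §6's "nothing provable in either direction about
the N → ∞ collision statistics" is now localised: for the FILED crux the residue is r-scale kinetic-energy control along the flow (not entropy-class,
§7¾); for the restated cruxes it is ONE equilibrium dynamical large-deviation bound.
-/

noncomputable section

open scoped BigOperators Topology ENNReal NNReal InnerProductSpace RealInnerProductSpace Classical
open MeasureTheory Set Filter Function
open Literature.Analysis.FluidPDE Literature.MathematicalPhysics.KineticTheory
open Summit.AtomisticToContinuum.HydrodynamicLimit.Theses.JParityClosure
open Summit.AtomisticToContinuum.HydrodynamicLimit.Theorems.RateFloorLine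

namespace Summit.AtomisticToContinuum.HydrodynamicLimit.Cruxes.RateFloor.SketchLine

/-! ## §1 The line's static functionals — now TREE DEFINITIONS

`firstContact`, `realisedPairs`, `realisedSum`, `lineSR`, `windowLen` (gen 0) and `wouldBePairs`, `wouldBeSum`, `lineSW`,
`multiPairs`, `secondaryCount`, `lineBursts`, `windowLenB` (gen 1) are the reviewed route-posited definitions of
`Theorems/JParityClosureRateFloorLineDefs.lean` (p98025; namespace `…Theorems.RateFloorLine`, opened above), byte-identical to
the local copies earlier versions of this skeleton carried.  One source of truth: the registered stub texts below refer to them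
unqualified, so a `Theorems/` proof file or a promoted statement item imports that module and `open`s the namespace. -/

/-! ## §2 Gen 0's two halves of the transfer — REMOVED from this copy (c4, size cap); texts `KineticTransferRealised`, `OpacityFloorRealised` live in the crux-dir history (Lines/Sketch.lean up to commit e55f0dca7ede) -/

/-! ## §3 Gen 0's composition `rateFloor_of_transferR` — removed in gen 1 (cap obstruction); see crux-dir history -/

/-! ## §4 Registered stubs of gen 0 (all closed) and the proved kinetic transfer -/

/-- **S1 · PER-PARTICLE FREE STRETCH** (`stub_perParticleFreeStretch`; sketch `PerParticleFreeStretch`).  A particle that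
takes part in no collision during `(s, t]` is, at time `t`, on its free flight issued from `γ s`, whatever the other
particles do (field `free` between consecutive collision times of the window, `collidePair_apply_of_ne` at collisions of
other pairs, finitely many by `locFinite`; positions by `pos_continuous`).  Why it might fail: only through a convention
slip (`Ioc` vs `Icc` at `s`: a collision AT time `s` is already incorporated in `γ s`, right-continuity).  Leans on:
`IsHardSphereTrajectory` (fields), `collidePair_apply_of_ne`, `participates_iff`, `freeFlight_add`,
`Torus.continuous_geometry_translate`. [size M] -/
def Stubs.stub_perParticleFreeStretch : Prop :=
  ∀ (N : ℕ) (ε : ℝ) (γ : ℝ → Config N (Fin 3) T3),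
    IsHardSphereTrajectory (Torus.geometry (Fin 3)) ε N γ →
    ∀ (s t : ℝ) (k : Fin N), s ≤ t →
      (∀ u ∈ Set.Ioc s t, u ∉ collisionTimesOf (Torus.geometry (Fin 3)) ε γ k) →
      γ t k = freeFlight (Torus.geometry (Fin 3)) (t - s) (γ s) k

/-- Registered stub S1 (`Stubs.stub_perParticleFreeStretch`, verbatim): CLOSED — landed as `Theorems/JParityClosureRateFloorPerParticleFreeStretch.lean` (p86465). -/
theorem stub_perParticleFreeStretch :
    ∀ (N : ℕ) (ε : ℝ) (γ : ℝ → Config N (Fin 3) T3),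
    IsHardSphereTrajectory (Torus.geometry (Fin 3)) ε N γ →
    ∀ (s t : ℝ) (k : Fin N), s ≤ t →
      (∀ u ∈ Set.Ioc s t, u ∉ collisionTimesOf (Torus.geometry (Fin 3)) ε γ k) →
      γ t k = freeFlight (Torus.geometry (Fin 3)) (t - s) (γ s) k :=
  Summit.AtomisticToContinuum.HydrodynamicLimit.Theorems.RateFloorPerParticleFreeStretch.stub_perParticleFreeStretch

/-- **S2 · WOULD-BE PAIRS ARE REALISED UNLESS PRE-EMPTED** (`stub_wouldBeRealised`; sketch `WouldBeRealised`).  If the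
free flights of `i ≠ j` issued from `γ s` are at distance exactly `ε` at time `t > s` and neither `i` nor `j` takes part in
a collision during `(s, t)`, then `i` and `j` collide at time `t` (`Collide` = ordered contact pair in either order):
positions are continuous and equal to the free-flight positions on `[s, t)` by S1, hence at `t`; contact inside the
hard-sphere domain is membership in `contactPairs`.  Stated GIVEN S1 (its only dynamical input).  Why it might fail:
none known (0 < ε needed? no: `Collide` only asks `‖x_i − x_j‖ = ε` in `D_ε`, and `γ t ∈ D_ε` by the field `mem`).
Leans on: S1, `pos_continuous`, `Set.EqOn.closure`/`closure_Ico`, `mem_contactPairs_iff_of_mem`, `freeFlight_apply`,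
`Torus.continuous_geometry_translate`. [size M] -/
def Stubs.stub_wouldBeRealised : Prop :=
    (∀ (N : ℕ) (ε : ℝ) (γ : ℝ → Config N (Fin 3) T3),
      IsHardSphereTrajectory (Torus.geometry (Fin 3)) ε N γ →
      ∀ (s t : ℝ) (k : Fin N), s ≤ t →
        (∀ u ∈ Set.Ioc s t, u ∉ collisionTimesOf (Torus.geometry (Fin 3)) ε γ k) →
        γ t k = freeFlight (Torus.geometry (Fin 3)) (t - s) (γ s) k) →
    ∀ (N : ℕ) (ε : ℝ) (γ : ℝ → Config N (Fin 3) T3),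
    IsHardSphereTrajectory (Torus.geometry (Fin 3)) ε N γ →
    ∀ (s t : ℝ) (i j : Fin N), s < t → i ≠ j →
      (∀ u ∈ Set.Ioo s t, u ∉ collisionTimesOf (Torus.geometry (Fin 3)) ε γ i) →
      (∀ u ∈ Set.Ioo s t, u ∉ collisionTimesOf (Torus.geometry (Fin 3)) ε γ j) →
      ‖(Torus.geometry (Fin 3)).sepVec (freeFlight (Torus.geometry (Fin 3)) (t - s) (γ s) i).1
          (freeFlight (Torus.geometry (Fin 3)) (t - s) (γ s) j).1‖ = ε →
      Collide (Torus.geometry (Fin 3)) ε (γ t) i j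

/-- Registered stub S2 (`Stubs.stub_wouldBeRealised`, verbatim): CLOSED — landed as `Theorems/JParityClosureRateFloorWouldBeRealised.lean` (p86380). -/
theorem stub_wouldBeRealised :
    (∀ (N : ℕ) (ε : ℝ) (γ : ℝ → Config N (Fin 3) T3),
      IsHardSphereTrajectory (Torus.geometry (Fin 3)) ε N γ →
      ∀ (s t : ℝ) (k : Fin N), s ≤ t →
        (∀ u ∈ Set.Ioc s t, u ∉ collisionTimesOf (Torus.geometry (Fin 3)) ε γ k) →
        γ t k = freeFlight (Torus.geometry (Fin 3)) (t - s) (γ s) k) →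
    ∀ (N : ℕ) (ε : ℝ) (γ : ℝ → Config N (Fin 3) T3),
    IsHardSphereTrajectory (Torus.geometry (Fin 3)) ε N γ →
    ∀ (s t : ℝ) (i j : Fin N), s < t → i ≠ j →
      (∀ u ∈ Set.Ioo s t, u ∉ collisionTimesOf (Torus.geometry (Fin 3)) ε γ i) →
      (∀ u ∈ Set.Ioo s t, u ∉ collisionTimesOf (Torus.geometry (Fin 3)) ε γ j) →
      ‖(Torus.geometry (Fin 3)).sepVec (freeFlight (Torus.geometry (Fin 3)) (t - s) (γ s) i).1
          (freeFlight (Torus.geometry (Fin 3)) (t - s) (γ s) j).1‖ = ε →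
      Collide (Torus.geometry (Fin 3)) ε (γ t) i j :=
  Summit.AtomisticToContinuum.HydrodynamicLimit.Theorems.RateFloorWouldBeRealised.stub_wouldBeRealised

/-- **S3 · WINDOW PRE-EMPTION BOUND** (`stub_windowPreemption`; sketch `preempt_card_le` on a trajectory).  Given S1 and
S2: on a hard-sphere trajectory and a window `(s, t]`, the ordered would-be pairs `W` of `γ s` for the window length
`t − s` (free flights within `ε` at some time of `(0, t − s]`) number at most `2·#A + C₂(W)`, where `A` is the set of
ordered pairs that are in contact at some time of `(s, t]` and `C₂(W)` is the total `W`-degree of particles of `W`-degree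
`≥ 2` — because every would-be pair either is realised (its first free contact time `t₁ ∈ (0, t − s]` exists by
continuity of the free flights from `≥ ε` at `0⁺`; if neither endpoint participates in `(s, s + t₁)` then S2 gives a
collision at `s + t₁`) or has an endpoint deflected in the window, and `preempt_card_le` (sketch, proved) does the
counting.  Why it might fail: the degenerate case where `s` itself is a collision time of the pair (post-collisional at
`s`, free flights separate: then the pair is would-be only after wrapping around the torus — still fine) needs care, not
a new idea.  `W`, `A` enter as universally quantified finsets pinned by equations (no `let`: the registration cuts stub
texts at the first `:=`).  Leans on: sketch `preempt_card_le`/`touched`/`clusterExcess` (to be inlined by the prover),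
`Torus.continuous_geometry_translate`, `IsHardSphereTrajectory.mem`, `mem_contactPairs_iff_of_mem`. [size M] -/
def Stubs.stub_windowPreemption : Prop :=
    (∀ (N : ℕ) (ε : ℝ) (γ : ℝ → Config N (Fin 3) T3),
      IsHardSphereTrajectory (Torus.geometry (Fin 3)) ε N γ →
      ∀ (s t : ℝ) (k : Fin N), s ≤ t →
        (∀ u ∈ Set.Ioc s t, u ∉ collisionTimesOf (Torus.geometry (Fin 3)) ε γ k) →
        γ t k = freeFlight (Torus.geometry (Fin 3)) (t - s) (γ s) k) →
    ((∀ (N : ℕ) (ε : ℝ) (γ : ℝ → Config N (Fin 3) T3),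
      IsHardSphereTrajectory (Torus.geometry (Fin 3)) ε N γ →
      ∀ (s t : ℝ) (k : Fin N), s ≤ t →
        (∀ u ∈ Set.Ioc s t, u ∉ collisionTimesOf (Torus.geometry (Fin 3)) ε γ k) →
        γ t k = freeFlight (Torus.geometry (Fin 3)) (t - s) (γ s) k) →
    ∀ (N : ℕ) (ε : ℝ) (γ : ℝ → Config N (Fin 3) T3),
    IsHardSphereTrajectory (Torus.geometry (Fin 3)) ε N γ →
    ∀ (s t : ℝ) (i j : Fin N), s < t → i ≠ j →
      (∀ u ∈ Set.Ioo s t, u ∉ collisionTimesOf (Torus.geometry (Fin 3)) ε γ i) →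
      (∀ u ∈ Set.Ioo s t, u ∉ collisionTimesOf (Torus.geometry (Fin 3)) ε γ j) →
      ‖(Torus.geometry (Fin 3)).sepVec (freeFlight (Torus.geometry (Fin 3)) (t - s) (γ s) i).1
          (freeFlight (Torus.geometry (Fin 3)) (t - s) (γ s) j).1‖ = ε →
      Collide (Torus.geometry (Fin 3)) ε (γ t) i j) →
  ∀ (N : ℕ) (ε : ℝ) (γ : ℝ → Config N (Fin 3) T3),
    IsHardSphereTrajectory (Torus.geometry (Fin 3)) ε N γ → 0 < ε → ε < 2⁻¹ →
    ∀ (s t : ℝ), s < t →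
      ∀ (W A : Finset (Fin N × Fin N)),
      (W = Finset.univ.filter fun p => p.1 ≠ p.2 ∧
        ∃ u ∈ Set.Ioc 0 (t - s), ‖(Torus.geometry (Fin 3)).sepVec
          (freeFlight (Torus.geometry (Fin 3)) u (γ s) p.1).1 (freeFlight (Torus.geometry (Fin 3)) u (γ s) p.2).1‖ ≤ ε) →
      (A = Finset.univ.filter fun p =>
        ∃ u ∈ Set.Ioc s t, p ∈ contactPairs (Torus.geometry (Fin 3)) ε (γ u)) →
      W.card ≤ 2 * A.card +
        ∑ i ∈ Finset.univ.filter (fun i => 2 ≤ (W.filter fun p => p.1 = i ∨ p.2 = i).card),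
          (W.filter fun p => p.1 = i ∨ p.2 = i).card

/-- Registered stub S3 (`Stubs.stub_windowPreemption`, verbatim): CLOSED — landed as `Theorems/JParityClosureRateFloorWindowPreemption.lean` (p88768). -/
theorem stub_windowPreemption :
    (∀ (N : ℕ) (ε : ℝ) (γ : ℝ → Config N (Fin 3) T3),
      IsHardSphereTrajectory (Torus.geometry (Fin 3)) ε N γ →
      ∀ (s t : ℝ) (k : Fin N), s ≤ t →
        (∀ u ∈ Set.Ioc s t, u ∉ collisionTimesOf (Torus.geometry (Fin 3)) ε γ k) →
        γ t k = freeFlight (Torus.geometry (Fin 3)) (t - s) (γ s) k) →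
    ((∀ (N : ℕ) (ε : ℝ) (γ : ℝ → Config N (Fin 3) T3),
      IsHardSphereTrajectory (Torus.geometry (Fin 3)) ε N γ →
      ∀ (s t : ℝ) (k : Fin N), s ≤ t →
        (∀ u ∈ Set.Ioc s t, u ∉ collisionTimesOf (Torus.geometry (Fin 3)) ε γ k) →
        γ t k = freeFlight (Torus.geometry (Fin 3)) (t - s) (γ s) k) →
    ∀ (N : ℕ) (ε : ℝ) (γ : ℝ → Config N (Fin 3) T3),
    IsHardSphereTrajectory (Torus.geometry (Fin 3)) ε N γ →
    ∀ (s t : ℝ) (i j : Fin N), s < t → i ≠ j →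
      (∀ u ∈ Set.Ioo s t, u ∉ collisionTimesOf (Torus.geometry (Fin 3)) ε γ i) →
      (∀ u ∈ Set.Ioo s t, u ∉ collisionTimesOf (Torus.geometry (Fin 3)) ε γ j) →
      ‖(Torus.geometry (Fin 3)).sepVec (freeFlight (Torus.geometry (Fin 3)) (t - s) (γ s) i).1
          (freeFlight (Torus.geometry (Fin 3)) (t - s) (γ s) j).1‖ = ε →
      Collide (Torus.geometry (Fin 3)) ε (γ t) i j) →
    ∀ (N : ℕ) (ε : ℝ) (γ : ℝ → Config N (Fin 3) T3),
    IsHardSphereTrajectory (Torus.geometry (Fin 3)) ε N γ → 0 < ε → ε < 2⁻¹ →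
    ∀ (s t : ℝ), s < t →
      ∀ (W A : Finset (Fin N × Fin N)),
      (W = Finset.univ.filter fun p => p.1 ≠ p.2 ∧
        ∃ u ∈ Set.Ioc 0 (t - s), ‖(Torus.geometry (Fin 3)).sepVec
          (freeFlight (Torus.geometry (Fin 3)) u (γ s) p.1).1 (freeFlight (Torus.geometry (Fin 3)) u (γ s) p.2).1‖ ≤ ε) →
      (A = Finset.univ.filter fun p =>
        ∃ u ∈ Set.Ioc s t, p ∈ contactPairs (Torus.geometry (Fin 3)) ε (γ u)) →
      W.card ≤ 2 * A.card +
        ∑ i ∈ Finset.univ.filter (fun i => 2 ≤ (W.filter fun p => p.1 = i ∨ p.2 = i).card),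
          (W.filter fun p => p.1 = i ∨ p.2 = i).card :=
  Summit.AtomisticToContinuum.HydrodynamicLimit.Theorems.RateFloorWindowPreemption.stub_windowPreemption

/-- **S4 · COLLISION EQUIPARTITION** (`stub_collisionEquipartition`; sketch `CollisionEquipartition`, card
sonic-ratio-dichotomy's engine).  Averaged over the impact geometry with the hard-sphere rate `((w−v)·ω)₊ dω`, one
collision hands particle 1 exactly half the kinetic-energy gap: `∫(‖v′‖² − ‖v‖²)((w−v)·ω)₊dω = (π/2)‖w−v‖(‖w‖² − ‖v‖²)`
(pointwise `‖v′‖² − ‖v‖² = ((w−v)·ω)((v+w)·ω)`, sketch `norm_sq_reflectVel_fst_sub`, proved; then the odd part of `(v+w)`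
orthogonal to `w − v` integrates to zero by the reflection symmetry of `sphereMeasure`, and `∫_{e·ω>0}(e·ω)³dω = π/2` by
the hemisphere projection law).  Why it might fail: no — an identity between explicit integrals; only the constant could
be mis-typed (`sphereMeasure` = `volume.toSphere`, total mass `4π`, `∫(e·ω)₊ = π`: `lorentzLossRate_eq_norm_mul`).
Leans on: `reflectVel`, `hardSphereKernel`, `sphereMeasure`, `lintegral_sphere_innerPos_mul`
(HardSphereEntranceProofs), `Literature/MeasureTheory/Hausdorff/SphereRotationInvariance`, `sphereMeasure_map_neg`,
`sphereMeasure_map_sphereMap` (KickIsotropyInfo Negative). [size M] -/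
def Stubs.stub_collisionEquipartition : Prop :=
  ∀ v w : V3,
    ∫ ω : Metric.sphere (0 : V3) 1,
        (‖(reflectVel (ω : V3) (v, w)).1‖ ^ 2 - ‖v‖ ^ 2) * hardSphereKernel (w, v) ω ∂sphereMeasure
      = Real.pi / 2 * ‖w - v‖ * (‖w‖ ^ 2 - ‖v‖ ^ 2)

/-- Registered stub S4 (`Stubs.stub_collisionEquipartition`, verbatim): CLOSED — landed as `Theorems/JParityClosureRateFloorCollisionEquipartition.lean` (p86823). -/
theorem stub_collisionEquipartition :
    ∀ v w : V3,
    ∫ ω : Metric.sphere (0 : V3) 1,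
        (‖(reflectVel (ω : V3) (v, w)).1‖ ^ 2 - ‖v‖ ^ 2) * hardSphereKernel (w, v) ω ∂sphereMeasure
      = Real.pi / 2 * ‖w - v‖ * (‖w‖ ^ 2 - ‖v‖ ^ 2) :=
  Summit.AtomisticToContinuum.HydrodynamicLimit.Theorems.RateFloorCollisionEquipartition.stub_collisionEquipartition

/-- **S5 · GAIN SPREADING** (`stub_gainSpreading`; sketch `GainSpreading` RESHAPED by the lead to the thermal-bulk form the
card actually uses and the tree can prove: Maxwellian partner instead of a ball indicator, `lintegral` instead of Bochner).
The image of `1_{B_R}(v) M_β(w) ((w−v)·ω)₊ dω dw dv` under the out-velocity map `(v, w, ω) ↦ v′ = (reflectVel ω (v,w)).1`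
dominates a multiple of Lebesgue measure on `B_R`: `c·vol(S) ≤ ∫_{v∈B_R}∫_w∫_ω 1_S(v′)((w−v)·ω)₊M_β(w)` for measurable
`S ⊆ B_R` — one collision with the thermal bulk repopulates every out-velocity cell of the ball at a rate bounded below
(card regeneration-spreading-uniformity; PulvirentiWennberg1997 Lemma 3.1-type).  Proof route IN THE TREE: `reflectVel ω =
collide ω` (`reflectVel_eq_collide`), `ω ↦ −ω` (`sphereMeasure_map_neg` / `lintegral_sphere_neg`; `collide` is even in
`ω`) turns `((w−v)·ω)₊` into the tree's `hardSphereKernel (v, w) ω`; then the Carleman representation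
`lintegral_gain_eq_carleman` (TaggedSphereCarleman) rewrites the inner two integrals as `∫ k_β(v,u) 1_S(v+u) du`, and
`carlemanKernel_ge` (`k_β(v,u) ≥ C‖u‖^{2−d}M_β(v+u)`, here `d = 3`, `‖u‖ ≤ 2R`, `M_β ≥ min on B_R`) gives the floor
pointwise in `v ∈ B_R`; integrate over `v`.  Why it might fail: no (explicit positive constants); only measurability
bookkeeping.  Leans on: `reflectVel_eq_collide`, `lintegral_gain_eq_carleman`, `carlemanKernel_ge`, `maxwellianBeta_pos`,
`lintegral_sphere_neg`, `EuclideanSpace.volume_ball`/positivity of `volume (ball 0 R)`. [size M] -/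
def Stubs.stub_gainSpreading : Prop :=
  ∀ β R : ℝ, 0 < β → 0 < R → ∃ c : ℝ, 0 < c ∧ ∀ S : Set V3, MeasurableSet S → S ⊆ Metric.ball (0 : V3) R →
    ENNReal.ofReal c * volume S ≤
      ∫⁻ v in Metric.ball (0 : V3) R, ∫⁻ w, ∫⁻ ω : Metric.sphere (0 : V3) 1,
        S.indicator (fun _ => (1 : ℝ≥0∞)) (reflectVel (ω : V3) (v, w)).1 *
          ENNReal.ofReal (hardSphereKernel (w, v) ω * Literature.Analysis.FunctionSpaces.maxwellianBeta β w)
        ∂sphereMeasure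

/- Registered stub S5 (`Stubs.stub_gainSpreading`, verbatim) is CLOSED in the tree as
`Summit.AtomisticToContinuum.HydrodynamicLimit.Theorems.RateFloorGainSpreading.stub_gainSpreading`
(`Theorems/JParityClosureRateFloorGainSpreading.lean`, p86780).  Its theorem is OMITTED from this copy of the skeleton (not
re-sorried) because the check farm reports that module unbuilt (rc 75 stale:unbuilt) so it cannot be imported here, and S5 is
off the composition path (an intended engine of S7b); re-add `theorem stub_gainSpreading : … := <tree name>` with the import
once the module builds. -/

/-- The conclusion of S3 as a named `Prop` (input of S6). [folklore] -/
def WindowPreemptionBound : Prop :=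
  ∀ (N : ℕ) (ε : ℝ) (γ : ℝ → Config N (Fin 3) T3),
    IsHardSphereTrajectory (Torus.geometry (Fin 3)) ε N γ → 0 < ε → ε < 2⁻¹ →
    ∀ (s t : ℝ), s < t →
      ∀ (W A : Finset (Fin N × Fin N)),
      (W = Finset.univ.filter fun p => p.1 ≠ p.2 ∧
        ∃ u ∈ Set.Ioc 0 (t - s), ‖(Torus.geometry (Fin 3)).sepVec
          (freeFlight (Torus.geometry (Fin 3)) u (γ s) p.1).1 (freeFlight (Torus.geometry (Fin 3)) u (γ s) p.2).1‖ ≤ ε) →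
      (A = Finset.univ.filter fun p =>
        ∃ u ∈ Set.Ioc s t, p ∈ contactPairs (Torus.geometry (Fin 3)) ε (γ u)) →
      W.card ≤ 2 * A.card +
        ∑ i ∈ Finset.univ.filter (fun i => 2 ≤ (W.filter fun p => p.1 = i ∨ p.2 = i).card),
          (W.filter fun p => p.1 = i ∨ p.2 = i).card

/-- **S6a · REALISED WOULD-BE PAIRS CARRY THE PREDICTED DATUM** (`stub_realisedDatum`; provable now, M/L).  In the
situation of S2 (free flights of `i ≠ j` issued from `γ s` in contact at `t > s`, neither endpoint participating in
`(s, t)`, torus, `0 < ε < 1/2`): at the collision time `t` the separation vector IS the free-flight one, and the crux's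
`pv` — reflect the CURRENT (post-collisional, right-continuous) velocities across the CURRENT separation vector — returns
EXACTLY the window-start velocities `((γ s i).2, (γ s j).2)`: the pair enters `Kc` with the free-flight-PREDICTED datum
`(n̂, v_i(s), v_j(s))` that the static functional `S` books (Disproof §1 `pv_eq_precollisional`, `collidePair_comm`).
Proof: positions on `[s, t]` are the free-flight ones (S1/S2 helpers `apply_fst_eq_freeFlight_of_forall_Ico`); the left
limit `zl` at `t` has `(zl i).2 = (γ s i).2`, `(zl j).2 = (γ s j).2` (velocities are constant on `[s, t)`); `binary`:
`γ t = collidePair i′ j′ zl` with `{i′, j′} = {i, j}`; `reflectVel` is an involution and even/swap-symmetric.  Why it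
might fail: no.  Leans on: landed S1/S2 files, `IsHardSphereTrajectory.binary`, `tendsto_nhds_unique`,
`collidePair_apply_left/_right/_fst`, `reflectVel_reflectVel`, `Geometry.IsHardSphereRegular.collidePair_comm`
(`Torus.isHardSphereRegular_geometry`). [size M] -/
def Stubs.stub_realisedDatum : Prop :=
  ∀ (N : ℕ) (ε : ℝ) (γ : ℝ → Config N (Fin 3) T3),
    IsHardSphereTrajectory (Torus.geometry (Fin 3)) ε N γ → 0 < ε → ε < 2⁻¹ →
    ∀ (s t : ℝ) (i j : Fin N), s < t → i ≠ j →
      (∀ u ∈ Set.Ioo s t, u ∉ collisionTimesOf (Torus.geometry (Fin 3)) ε γ i) →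
      (∀ u ∈ Set.Ioo s t, u ∉ collisionTimesOf (Torus.geometry (Fin 3)) ε γ j) →
      ‖(Torus.geometry (Fin 3)).sepVec (freeFlight (Torus.geometry (Fin 3)) (t - s) (γ s) i).1
          (freeFlight (Torus.geometry (Fin 3)) (t - s) (γ s) j).1‖ = ε →
      (Torus.geometry (Fin 3)).sepVec (γ t i).1 (γ t j).1 =
          (Torus.geometry (Fin 3)).sepVec (freeFlight (Torus.geometry (Fin 3)) (t - s) (γ s) i).1
            (freeFlight (Torus.geometry (Fin 3)) (t - s) (γ s) j).1 ∧
        reflectVel ((Torus.geometry (Fin 3)).sepVec (γ t i).1 (γ t j).1) ((γ t i).2, (γ t j).2) =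
          ((γ s i).2, (γ s j).2)

/-- Registered stub S6a (`Stubs.stub_realisedDatum`, verbatim): CLOSED — landed as `Theorems/JParityClosureRateFloorRealisedDatum.lean` (p89367). -/
theorem stub_realisedDatum :
    ∀ (N : ℕ) (ε : ℝ) (γ : ℝ → Config N (Fin 3) T3),
    IsHardSphereTrajectory (Torus.geometry (Fin 3)) ε N γ → 0 < ε → ε < 2⁻¹ →
    ∀ (s t : ℝ) (i j : Fin N), s < t → i ≠ j →
      (∀ u ∈ Set.Ioo s t, u ∉ collisionTimesOf (Torus.geometry (Fin 3)) ε γ i) →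
      (∀ u ∈ Set.Ioo s t, u ∉ collisionTimesOf (Torus.geometry (Fin 3)) ε γ j) →
      ‖(Torus.geometry (Fin 3)).sepVec (freeFlight (Torus.geometry (Fin 3)) (t - s) (γ s) i).1
          (freeFlight (Torus.geometry (Fin 3)) (t - s) (γ s) j).1‖ = ε →
      (Torus.geometry (Fin 3)).sepVec (γ t i).1 (γ t j).1 =
          (Torus.geometry (Fin 3)).sepVec (freeFlight (Torus.geometry (Fin 3)) (t - s) (γ s) i).1
            (freeFlight (Torus.geometry (Fin 3)) (t - s) (γ s) j).1 ∧
        reflectVel ((Torus.geometry (Fin 3)).sepVec (γ t i).1 (γ t j).1) ((γ t i).2, (γ t j).2) =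
          ((γ s i).2, (γ s j).2) :=
  Summit.AtomisticToContinuum.HydrodynamicLimit.Theorems.RateFloorRealisedDatum.stub_realisedDatum

/-- **S6c · COUNT TRANSFER OVER WINDOWS** (`stub_countTransfer`; provable now, M/L).  Given the window pre-emption bound
(S3's conclusion, antecedent): along a hard-sphere trajectory on the torus (`0 < ε < 1/2`), for window length `Δ > 0`
and horizon `τ ≥ 0`, with `W k` the ordered would-be pairs of `γ (kΔ)` for the window `(kΔ, (k+1)Δ]`,
`Σ_{k < ⌊τ/Δ⌋} (#W k − C₂(W k)) ≤ 2 ×` the crux's UNIT-MARK collision functional over `[0, τ]` (ordered contact pairs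
summed over the collision times; `finsum`, finite on a trajectory).  Per window S3 gives `#W k − C₂ ≤ 2 #A_k`, and
`#A_k ≤ Σ_{u ∈ collisionTimes ∩ (kΔ,(k+1)Δ]} #contactPairs (γ u)` (a pair in contact at several times of the window is
counted once in `A_k`); the windows are disjoint and inside `[0, τ]` (`(k+1)Δ ≤ ⌊τ/Δ⌋Δ ≤ τ`), the summands are `≥ 0`,
and `sum_contactPairs_eq` (`h.mem u`) turns `#contactPairs (γ u)` into the inline double sum.  This is the PATHWISE
kinetic transfer for constant marks (`χ ≡ 1`, `Ξ ≡ 1`): `K_N[1] ≥ (ε/(N+1)) · ½ Σ_k (#W_k − C₂)`.  Why it might fail: no;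
finsum bookkeeping only (`finsum_mem_eq_sum` with `h.locFinite`).  Leans on: S3 (antecedent), `sum_contactPairs_eq`,
`IsHardSphereTrajectory.mem/locFinite`, `finite_collisionTimes_inter_of_subset_Icc`, Mathlib finsum/Finset API. [size M] -/
def Stubs.stub_countTransfer : Prop :=
    (∀ (N : ℕ) (ε : ℝ) (γ : ℝ → Config N (Fin 3) T3),
      IsHardSphereTrajectory (Torus.geometry (Fin 3)) ε N γ → 0 < ε → ε < 2⁻¹ →
      ∀ (s t : ℝ), s < t →
        ∀ (W A : Finset (Fin N × Fin N)),
        (W = Finset.univ.filter fun p => p.1 ≠ p.2 ∧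
          ∃ u ∈ Set.Ioc 0 (t - s), ‖(Torus.geometry (Fin 3)).sepVec
            (freeFlight (Torus.geometry (Fin 3)) u (γ s) p.1).1 (freeFlight (Torus.geometry (Fin 3)) u (γ s) p.2).1‖ ≤ ε) →
        (A = Finset.univ.filter fun p =>
          ∃ u ∈ Set.Ioc s t, p ∈ contactPairs (Torus.geometry (Fin 3)) ε (γ u)) →
        W.card ≤ 2 * A.card +
          ∑ i ∈ Finset.univ.filter (fun i => 2 ≤ (W.filter fun p => p.1 = i ∨ p.2 = i).card),
            (W.filter fun p => p.1 = i ∨ p.2 = i).card) →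
  ∀ (N : ℕ) (ε : ℝ) (γ : ℝ → Config N (Fin 3) T3),
    IsHardSphereTrajectory (Torus.geometry (Fin 3)) ε N γ → 0 < ε → ε < 2⁻¹ →
    ∀ (Δ τ : ℝ), 0 < Δ → 0 ≤ τ →
      ∀ (W : ℕ → Finset (Fin N × Fin N)),
      (∀ k : ℕ, W k = Finset.univ.filter fun p => p.1 ≠ p.2 ∧
        ∃ u ∈ Set.Ioc 0 Δ, ‖(Torus.geometry (Fin 3)).sepVec
          (freeFlight (Torus.geometry (Fin 3)) u (γ (k * Δ)) p.1).1
          (freeFlight (Torus.geometry (Fin 3)) u (γ (k * Δ)) p.2).1‖ ≤ ε) →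
      ∑ k ∈ Finset.range ⌊τ / Δ⌋₊, (((W k).card : ℝ) -
          ((∑ i ∈ Finset.univ.filter (fun i => 2 ≤ ((W k).filter fun p => p.1 = i ∨ p.2 = i).card),
            ((W k).filter fun p => p.1 = i ∨ p.2 = i).card : ℕ) : ℝ)) ≤
        2 * ∑ᶠ (u : ℝ) (_ : u ∈ collisionTimes (Torus.geometry (Fin 3)) ε γ ∩ Set.Icc 0 τ),
          ∑ i : Fin N, ∑ j : Fin N,
            (if i ≠ j ∧ ‖(Torus.geometry (Fin 3)).sepVec (γ u i).1 (γ u j).1‖ = ε then (1 : ℝ) else 0)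

/-- Registered stub S6c (`Stubs.stub_countTransfer`, verbatim): CLOSED — landed as `Theorems/JParityClosureRateFloorCountTransfer.lean` (p89470). -/
theorem stub_countTransfer :
    (∀ (N : ℕ) (ε : ℝ) (γ : ℝ → Config N (Fin 3) T3),
      IsHardSphereTrajectory (Torus.geometry (Fin 3)) ε N γ → 0 < ε → ε < 2⁻¹ →
      ∀ (s t : ℝ), s < t →
        ∀ (W A : Finset (Fin N × Fin N)),
        (W = Finset.univ.filter fun p => p.1 ≠ p.2 ∧
          ∃ u ∈ Set.Ioc 0 (t - s), ‖(Torus.geometry (Fin 3)).sepVec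
            (freeFlight (Torus.geometry (Fin 3)) u (γ s) p.1).1 (freeFlight (Torus.geometry (Fin 3)) u (γ s) p.2).1‖ ≤ ε) →
        (A = Finset.univ.filter fun p =>
          ∃ u ∈ Set.Ioc s t, p ∈ contactPairs (Torus.geometry (Fin 3)) ε (γ u)) →
        W.card ≤ 2 * A.card +
          ∑ i ∈ Finset.univ.filter (fun i => 2 ≤ (W.filter fun p => p.1 = i ∨ p.2 = i).card),
            (W.filter fun p => p.1 = i ∨ p.2 = i).card) →
    ∀ (N : ℕ) (ε : ℝ) (γ : ℝ → Config N (Fin 3) T3),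
    IsHardSphereTrajectory (Torus.geometry (Fin 3)) ε N γ → 0 < ε → ε < 2⁻¹ →
    ∀ (Δ τ : ℝ), 0 < Δ → 0 ≤ τ →
      ∀ (W : ℕ → Finset (Fin N × Fin N)),
      (∀ k : ℕ, W k = Finset.univ.filter fun p => p.1 ≠ p.2 ∧
        ∃ u ∈ Set.Ioc 0 Δ, ‖(Torus.geometry (Fin 3)).sepVec
          (freeFlight (Torus.geometry (Fin 3)) u (γ (k * Δ)) p.1).1
          (freeFlight (Torus.geometry (Fin 3)) u (γ (k * Δ)) p.2).1‖ ≤ ε) →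
      ∑ k ∈ Finset.range ⌊τ / Δ⌋₊, (((W k).card : ℝ) -
          ((∑ i ∈ Finset.univ.filter (fun i => 2 ≤ ((W k).filter fun p => p.1 = i ∨ p.2 = i).card),
            ((W k).filter fun p => p.1 = i ∨ p.2 = i).card : ℕ) : ℝ)) ≤
        2 * ∑ᶠ (u : ℝ) (_ : u ∈ collisionTimes (Torus.geometry (Fin 3)) ε γ ∩ Set.Icc 0 τ),
          ∑ i : Fin N, ∑ j : Fin N,
            (if i ≠ j ∧ ‖(Torus.geometry (Fin 3)).sepVec (γ u i).1 (γ u j).1‖ = ε then (1 : ℝ) else 0) :=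
  Summit.AtomisticToContinuum.HydrodynamicLimit.Theorems.RateFloorCountTransfer.stub_countTransfer

/-- **S6d · MARKED REALISED TRANSFER** (`stub_markedTransfer`; provable now, M/L).  The exact pathwise content of the
kinetic transfer for GENERAL nonnegative marks: on a hard-sphere trajectory (torus, `0 < ε < 1/2`) and a window `(s, t]`,
let `t₁ p` be the first free contact time of the ordered pair `p` (`sInf`, pinned by an equation) and `R` the REALISED
would-be pairs — would-be pairs of `γ s` none of whose endpoints participates in a collision during `(s, s + t₁ p)`.
Then the marks of `R`, read at the PREDICTED datum (time `s + t₁ p`, free-flight positions, window-start velocities), sum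
to at most the window's collision functional with the SAME mark `F(u, x_i, x_j, v⁻, w⁻)` (pre-collisional velocities via
`reflectVel` of the current ones, exactly as the crux's `Kc` reads them): each `p ∈ R` collides at `s + t₁ p ∈ (s, t]`
(S3's `exists_pos_contact`/`exists_sep_window` give `t₁ p ∈ (0, t − s]` with contact, S2 the collision) and contributes
there exactly its predicted term (antecedent S6a), distinct pairs give distinct (time, pair) indices, and the other terms
are `≥ 0`.  What remains OPEN after this (S6b) is purely probabilistic: the pre-empted mass `Σ_(W∖R) m` and the freezing
errors are small in probability (no targeting).  Why it might fail: no.  Leans on: S6a (antecedent), landed S1/S2/S3 files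
(`RateFloorWindowPreemption.exists_pos_contact`, `.exists_sep_window`, `RateFloorWouldBeRealised.stub_wouldBeRealised`),
`IsHardSphereTrajectory.locFinite`, Mathlib `finsum_mem_eq_finite_toFinset_sum`, `Finset.sum_comm`,
`Finset.single_le_sum`. [size M] -/
def Stubs.stub_markedTransfer : Prop :=
    (∀ (N : ℕ) (ε : ℝ) (γ : ℝ → Config N (Fin 3) T3),
    IsHardSphereTrajectory (Torus.geometry (Fin 3)) ε N γ → 0 < ε → ε < 2⁻¹ →
    ∀ (s t : ℝ) (i j : Fin N), s < t → i ≠ j →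
      (∀ u ∈ Set.Ioo s t, u ∉ collisionTimesOf (Torus.geometry (Fin 3)) ε γ i) →
      (∀ u ∈ Set.Ioo s t, u ∉ collisionTimesOf (Torus.geometry (Fin 3)) ε γ j) →
      ‖(Torus.geometry (Fin 3)).sepVec (freeFlight (Torus.geometry (Fin 3)) (t - s) (γ s) i).1
          (freeFlight (Torus.geometry (Fin 3)) (t - s) (γ s) j).1‖ = ε →
      (Torus.geometry (Fin 3)).sepVec (γ t i).1 (γ t j).1 =
          (Torus.geometry (Fin 3)).sepVec (freeFlight (Torus.geometry (Fin 3)) (t - s) (γ s) i).1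
            (freeFlight (Torus.geometry (Fin 3)) (t - s) (γ s) j).1 ∧
        reflectVel ((Torus.geometry (Fin 3)).sepVec (γ t i).1 (γ t j).1) ((γ t i).2, (γ t j).2) =
          ((γ s i).2, (γ s j).2)) →
  ∀ (N : ℕ) (ε : ℝ) (γ : ℝ → Config N (Fin 3) T3),
    IsHardSphereTrajectory (Torus.geometry (Fin 3)) ε N γ → 0 < ε → ε < 2⁻¹ →
    ∀ (s t : ℝ), s < t →
      ∀ (F : ℝ → T3 → T3 → V3 → V3 → ℝ), (∀ u x y v w, 0 ≤ F u x y v w) →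
      ∀ (t₁ : Fin N × Fin N → ℝ),
      (∀ p, t₁ p = sInf {u : ℝ | u ∈ Set.Ioc 0 (t - s) ∧ ‖(Torus.geometry (Fin 3)).sepVec
          (freeFlight (Torus.geometry (Fin 3)) u (γ s) p.1).1 (freeFlight (Torus.geometry (Fin 3)) u (γ s) p.2).1‖ ≤ ε}) →
      ∀ (R : Finset (Fin N × Fin N)),
      (R = Finset.univ.filter fun p => p.1 ≠ p.2 ∧
        (∃ u ∈ Set.Ioc 0 (t - s), ‖(Torus.geometry (Fin 3)).sepVec
          (freeFlight (Torus.geometry (Fin 3)) u (γ s) p.1).1 (freeFlight (Torus.geometry (Fin 3)) u (γ s) p.2).1‖ ≤ ε) ∧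
        (∀ u ∈ Set.Ioo s (s + t₁ p), ¬ Participates (Torus.geometry (Fin 3)) ε (γ u) p.1) ∧
        (∀ u ∈ Set.Ioo s (s + t₁ p), ¬ Participates (Torus.geometry (Fin 3)) ε (γ u) p.2)) →
      ∑ p ∈ R, F (s + t₁ p) (freeFlight (Torus.geometry (Fin 3)) (t₁ p) (γ s) p.1).1 (freeFlight (Torus.geometry (Fin 3)) (t₁ p) (γ s) p.2).1
          ((γ s p.1).2) ((γ s p.2).2) ≤
        ∑ᶠ (u : ℝ) (_ : u ∈ collisionTimes (Torus.geometry (Fin 3)) ε γ ∩ Set.Ioc s t),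
          ∑ i : Fin N, ∑ j : Fin N,
            (if i ≠ j ∧ ‖(Torus.geometry (Fin 3)).sepVec (γ u i).1 (γ u j).1‖ = ε then
              F u (γ u i).1 (γ u j).1
                (reflectVel ((Torus.geometry (Fin 3)).sepVec (γ u i).1 (γ u j).1) ((γ u i).2, (γ u j).2)).1
                (reflectVel ((Torus.geometry (Fin 3)).sepVec (γ u i).1 (γ u j).1) ((γ u i).2, (γ u j).2)).2
            else 0)

/-- Registered stub S6d (`Stubs.stub_markedTransfer`, verbatim): CLOSED — landed as `Theorems/JParityClosureRateFloorMarkedTransfer.lean` (p91691). -/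
theorem stub_markedTransfer :
    (∀ (N : ℕ) (ε : ℝ) (γ : ℝ → Config N (Fin 3) T3),
    IsHardSphereTrajectory (Torus.geometry (Fin 3)) ε N γ → 0 < ε → ε < 2⁻¹ →
    ∀ (s t : ℝ) (i j : Fin N), s < t → i ≠ j →
      (∀ u ∈ Set.Ioo s t, u ∉ collisionTimesOf (Torus.geometry (Fin 3)) ε γ i) →
      (∀ u ∈ Set.Ioo s t, u ∉ collisionTimesOf (Torus.geometry (Fin 3)) ε γ j) →
      ‖(Torus.geometry (Fin 3)).sepVec (freeFlight (Torus.geometry (Fin 3)) (t - s) (γ s) i).1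
          (freeFlight (Torus.geometry (Fin 3)) (t - s) (γ s) j).1‖ = ε →
      (Torus.geometry (Fin 3)).sepVec (γ t i).1 (γ t j).1 =
          (Torus.geometry (Fin 3)).sepVec (freeFlight (Torus.geometry (Fin 3)) (t - s) (γ s) i).1
            (freeFlight (Torus.geometry (Fin 3)) (t - s) (γ s) j).1 ∧
        reflectVel ((Torus.geometry (Fin 3)).sepVec (γ t i).1 (γ t j).1) ((γ t i).2, (γ t j).2) =
          ((γ s i).2, (γ s j).2)) →
    ∀ (N : ℕ) (ε : ℝ) (γ : ℝ → Config N (Fin 3) T3),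
    IsHardSphereTrajectory (Torus.geometry (Fin 3)) ε N γ → 0 < ε → ε < 2⁻¹ →
    ∀ (s t : ℝ), s < t →
      ∀ (F : ℝ → T3 → T3 → V3 → V3 → ℝ), (∀ u x y v w, 0 ≤ F u x y v w) →
      ∀ (t₁ : Fin N × Fin N → ℝ),
      (∀ p, t₁ p = sInf {u : ℝ | u ∈ Set.Ioc 0 (t - s) ∧ ‖(Torus.geometry (Fin 3)).sepVec
          (freeFlight (Torus.geometry (Fin 3)) u (γ s) p.1).1 (freeFlight (Torus.geometry (Fin 3)) u (γ s) p.2).1‖ ≤ ε}) →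
      ∀ (R : Finset (Fin N × Fin N)),
      (R = Finset.univ.filter fun p => p.1 ≠ p.2 ∧
        (∃ u ∈ Set.Ioc 0 (t - s), ‖(Torus.geometry (Fin 3)).sepVec
          (freeFlight (Torus.geometry (Fin 3)) u (γ s) p.1).1 (freeFlight (Torus.geometry (Fin 3)) u (γ s) p.2).1‖ ≤ ε) ∧
        (∀ u ∈ Set.Ioo s (s + t₁ p), ¬ Participates (Torus.geometry (Fin 3)) ε (γ u) p.1) ∧
        (∀ u ∈ Set.Ioo s (s + t₁ p), ¬ Participates (Torus.geometry (Fin 3)) ε (γ u) p.2)) →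
      ∑ p ∈ R, F (s + t₁ p) (freeFlight (Torus.geometry (Fin 3)) (t₁ p) (γ s) p.1).1 (freeFlight (Torus.geometry (Fin 3)) (t₁ p) (γ s) p.2).1
          ((γ s p.1).2) ((γ s p.2).2) ≤
        ∑ᶠ (u : ℝ) (_ : u ∈ collisionTimes (Torus.geometry (Fin 3)) ε γ ∩ Set.Ioc s t),
          ∑ i : Fin N, ∑ j : Fin N,
            (if i ≠ j ∧ ‖(Torus.geometry (Fin 3)).sepVec (γ u i).1 (γ u j).1‖ = ε then
              F u (γ u i).1 (γ u j).1
                (reflectVel ((Torus.geometry (Fin 3)).sepVec (γ u i).1 (γ u j).1) ((γ u i).2, (γ u j).2)).1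
                (reflectVel ((Torus.geometry (Fin 3)).sepVec (γ u i).1 (γ u j).1) ((γ u i).2, (γ u j).2)).2
            else 0) :=
  Summit.AtomisticToContinuum.HydrodynamicLimit.Theorems.RateFloorMarkedTransfer.stub_markedTransfer

/-- The conclusion of S6d as a named `Prop` (antecedent of S8). [folklore] -/
def MarkedRealisedTransfer : Prop :=
  ∀ (N : ℕ) (ε : ℝ) (γ : ℝ → Config N (Fin 3) T3),
    IsHardSphereTrajectory (Torus.geometry (Fin 3)) ε N γ → 0 < ε → ε < 2⁻¹ →
    ∀ (s t : ℝ), s < t →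
      ∀ (F : ℝ → T3 → T3 → V3 → V3 → ℝ), (∀ u x y v w, 0 ≤ F u x y v w) →
      ∀ (t₁ : Fin N × Fin N → ℝ),
      (∀ p, t₁ p = sInf {u : ℝ | u ∈ Set.Ioc 0 (t - s) ∧ ‖(Torus.geometry (Fin 3)).sepVec
          (freeFlight (Torus.geometry (Fin 3)) u (γ s) p.1).1 (freeFlight (Torus.geometry (Fin 3)) u (γ s) p.2).1‖ ≤ ε}) →
      ∀ (R : Finset (Fin N × Fin N)),
      (R = Finset.univ.filter fun p => p.1 ≠ p.2 ∧
        (∃ u ∈ Set.Ioc 0 (t - s), ‖(Torus.geometry (Fin 3)).sepVec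
          (freeFlight (Torus.geometry (Fin 3)) u (γ s) p.1).1 (freeFlight (Torus.geometry (Fin 3)) u (γ s) p.2).1‖ ≤ ε) ∧
        (∀ u ∈ Set.Ioo s (s + t₁ p), ¬ Participates (Torus.geometry (Fin 3)) ε (γ u) p.1) ∧
        (∀ u ∈ Set.Ioo s (s + t₁ p), ¬ Participates (Torus.geometry (Fin 3)) ε (γ u) p.2)) →
      ∑ p ∈ R, F (s + t₁ p) (freeFlight (Torus.geometry (Fin 3)) (t₁ p) (γ s) p.1).1 (freeFlight (Torus.geometry (Fin 3)) (t₁ p) (γ s) p.2).1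
          ((γ s p.1).2) ((γ s p.2).2) ≤
        ∑ᶠ (u : ℝ) (_ : u ∈ collisionTimes (Torus.geometry (Fin 3)) ε γ ∩ Set.Ioc s t),
          ∑ i : Fin N, ∑ j : Fin N,
            (if i ≠ j ∧ ‖(Torus.geometry (Fin 3)).sepVec (γ u i).1 (γ u j).1‖ = ε then
              F u (γ u i).1 (γ u j).1
                (reflectVel ((Torus.geometry (Fin 3)).sepVec (γ u i).1 (γ u j).1) ((γ u i).2, (γ u j).2)).1
                (reflectVel ((Torus.geometry (Fin 3)).sepVec (γ u i).1 (γ u j).1) ((γ u i).2, (γ u j).2)).2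
            else 0)

/-- **S8 · PATHWISE TRANSFER OVER WINDOWS** (`stub_pathwiseTransfer`; provable now, M).  Given the marked realised transfer
per window (S6d's conclusion, antecedent): along a hard-sphere trajectory on the torus (`0 < ε < 1/2`), for a window length
`Δ > 0` and a horizon `τ ≥ 0`, summing over the windows `(kΔ, (k+1)Δ]`, `k < ⌊τ/Δ⌋`, the marks of the REALISED would-be
pairs read at their predicted data total at most the crux's collision functional over `[0, τ]` with the same mark:
per window S6d (with `s = kΔ`, `t = kΔ + Δ`), then the windows are disjoint and inside `[0, τ]` and the summands are
`≥ 0` (`RateFloorCountTransfer.sum_range_sum_filter_window_le`, `finsum_mem_eq_finite_toFinset_sum` with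
`h.locFinite`).  This makes the kinetic transfer a THEOREM for the realised functional (`kineticTransferRealised_of_pathwise`).
Why it might fail: no.  Leans on: S6d (antecedent), landed CountTransfer helpers, `IsHardSphereTrajectory.locFinite`. [size M] -/
def Stubs.stub_pathwiseTransfer : Prop :=
    (∀ (N : ℕ) (ε : ℝ) (γ : ℝ → Config N (Fin 3) T3),
    IsHardSphereTrajectory (Torus.geometry (Fin 3)) ε N γ → 0 < ε → ε < 2⁻¹ →
    ∀ (s t : ℝ), s < t →
      ∀ (F : ℝ → T3 → T3 → V3 → V3 → ℝ), (∀ u x y v w, 0 ≤ F u x y v w) →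
      ∀ (t₁ : Fin N × Fin N → ℝ),
      (∀ p, t₁ p = sInf {u : ℝ | u ∈ Set.Ioc 0 (t - s) ∧ ‖(Torus.geometry (Fin 3)).sepVec
          (freeFlight (Torus.geometry (Fin 3)) u (γ s) p.1).1 (freeFlight (Torus.geometry (Fin 3)) u (γ s) p.2).1‖ ≤ ε}) →
      ∀ (R : Finset (Fin N × Fin N)),
      (R = Finset.univ.filter fun p => p.1 ≠ p.2 ∧
        (∃ u ∈ Set.Ioc 0 (t - s), ‖(Torus.geometry (Fin 3)).sepVec
          (freeFlight (Torus.geometry (Fin 3)) u (γ s) p.1).1 (freeFlight (Torus.geometry (Fin 3)) u (γ s) p.2).1‖ ≤ ε) ∧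
        (∀ u ∈ Set.Ioo s (s + t₁ p), ¬ Participates (Torus.geometry (Fin 3)) ε (γ u) p.1) ∧
        (∀ u ∈ Set.Ioo s (s + t₁ p), ¬ Participates (Torus.geometry (Fin 3)) ε (γ u) p.2)) →
      ∑ p ∈ R, F (s + t₁ p) (freeFlight (Torus.geometry (Fin 3)) (t₁ p) (γ s) p.1).1 (freeFlight (Torus.geometry (Fin 3)) (t₁ p) (γ s) p.2).1
          ((γ s p.1).2) ((γ s p.2).2) ≤
        ∑ᶠ (u : ℝ) (_ : u ∈ collisionTimes (Torus.geometry (Fin 3)) ε γ ∩ Set.Ioc s t),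
          ∑ i : Fin N, ∑ j : Fin N,
            (if i ≠ j ∧ ‖(Torus.geometry (Fin 3)).sepVec (γ u i).1 (γ u j).1‖ = ε then
              F u (γ u i).1 (γ u j).1
                (reflectVel ((Torus.geometry (Fin 3)).sepVec (γ u i).1 (γ u j).1) ((γ u i).2, (γ u j).2)).1
                (reflectVel ((Torus.geometry (Fin 3)).sepVec (γ u i).1 (γ u j).1) ((γ u i).2, (γ u j).2)).2
            else 0)) →
  ∀ (N : ℕ) (ε : ℝ) (γ : ℝ → Config N (Fin 3) T3),
    IsHardSphereTrajectory (Torus.geometry (Fin 3)) ε N γ → 0 < ε → ε < 2⁻¹ →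
    ∀ (Δ τ : ℝ), 0 < Δ → 0 ≤ τ →
      ∀ (F : ℝ → T3 → T3 → V3 → V3 → ℝ), (∀ u x y v w, 0 ≤ F u x y v w) →
      ∀ (t₁ : ℕ → Fin N × Fin N → ℝ),
      (∀ (k : ℕ) (p : Fin N × Fin N), t₁ k p = sInf {u : ℝ | u ∈ Set.Ioc 0 Δ ∧ ‖(Torus.geometry (Fin 3)).sepVec
          (freeFlight (Torus.geometry (Fin 3)) u (γ (k * Δ)) p.1).1 (freeFlight (Torus.geometry (Fin 3)) u (γ (k * Δ)) p.2).1‖ ≤ ε}) →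
      ∀ (R : ℕ → Finset (Fin N × Fin N)),
      (∀ k : ℕ, R k = Finset.univ.filter fun p => p.1 ≠ p.2 ∧
        (∃ u ∈ Set.Ioc 0 Δ, ‖(Torus.geometry (Fin 3)).sepVec
          (freeFlight (Torus.geometry (Fin 3)) u (γ (k * Δ)) p.1).1 (freeFlight (Torus.geometry (Fin 3)) u (γ (k * Δ)) p.2).1‖ ≤ ε) ∧
        (∀ u ∈ Set.Ioo (k * Δ) (k * Δ + t₁ k p), ¬ Participates (Torus.geometry (Fin 3)) ε (γ u) p.1) ∧
        (∀ u ∈ Set.Ioo (k * Δ) (k * Δ + t₁ k p), ¬ Participates (Torus.geometry (Fin 3)) ε (γ u) p.2)) →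
      ∑ k ∈ Finset.range ⌊τ / Δ⌋₊, ∑ p ∈ R k,
          F (k * Δ + t₁ k p) (freeFlight (Torus.geometry (Fin 3)) (t₁ k p) (γ (k * Δ)) p.1).1
            (freeFlight (Torus.geometry (Fin 3)) (t₁ k p) (γ (k * Δ)) p.2).1 ((γ (k * Δ) p.1).2) ((γ (k * Δ) p.2).2) ≤
        ∑ᶠ (u : ℝ) (_ : u ∈ collisionTimes (Torus.geometry (Fin 3)) ε γ ∩ Set.Icc 0 τ),
          ∑ i : Fin N, ∑ j : Fin N,
            (if i ≠ j ∧ ‖(Torus.geometry (Fin 3)).sepVec (γ u i).1 (γ u j).1‖ = ε then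
              F u (γ u i).1 (γ u j).1
                (reflectVel ((Torus.geometry (Fin 3)).sepVec (γ u i).1 (γ u j).1) ((γ u i).2, (γ u j).2)).1
                (reflectVel ((Torus.geometry (Fin 3)).sepVec (γ u i).1 (γ u j).1) ((γ u i).2, (γ u j).2)).2
            else 0)

/-- Registered stub S8 (`Stubs.stub_pathwiseTransfer`, verbatim): CLOSED — landed as `Theorems/JParityClosureRateFloorPathwiseTransfer.lean` (p92720). -/
theorem stub_pathwiseTransfer :
    (∀ (N : ℕ) (ε : ℝ) (γ : ℝ → Config N (Fin 3) T3),
    IsHardSphereTrajectory (Torus.geometry (Fin 3)) ε N γ → 0 < ε → ε < 2⁻¹ →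
    ∀ (s t : ℝ), s < t →
      ∀ (F : ℝ → T3 → T3 → V3 → V3 → ℝ), (∀ u x y v w, 0 ≤ F u x y v w) →
      ∀ (t₁ : Fin N × Fin N → ℝ),
      (∀ p, t₁ p = sInf {u : ℝ | u ∈ Set.Ioc 0 (t - s) ∧ ‖(Torus.geometry (Fin 3)).sepVec
          (freeFlight (Torus.geometry (Fin 3)) u (γ s) p.1).1 (freeFlight (Torus.geometry (Fin 3)) u (γ s) p.2).1‖ ≤ ε}) →
      ∀ (R : Finset (Fin N × Fin N)),
      (R = Finset.univ.filter fun p => p.1 ≠ p.2 ∧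
        (∃ u ∈ Set.Ioc 0 (t - s), ‖(Torus.geometry (Fin 3)).sepVec
          (freeFlight (Torus.geometry (Fin 3)) u (γ s) p.1).1 (freeFlight (Torus.geometry (Fin 3)) u (γ s) p.2).1‖ ≤ ε) ∧
        (∀ u ∈ Set.Ioo s (s + t₁ p), ¬ Participates (Torus.geometry (Fin 3)) ε (γ u) p.1) ∧
        (∀ u ∈ Set.Ioo s (s + t₁ p), ¬ Participates (Torus.geometry (Fin 3)) ε (γ u) p.2)) →
      ∑ p ∈ R, F (s + t₁ p) (freeFlight (Torus.geometry (Fin 3)) (t₁ p) (γ s) p.1).1 (freeFlight (Torus.geometry (Fin 3)) (t₁ p) (γ s) p.2).1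
          ((γ s p.1).2) ((γ s p.2).2) ≤
        ∑ᶠ (u : ℝ) (_ : u ∈ collisionTimes (Torus.geometry (Fin 3)) ε γ ∩ Set.Ioc s t),
          ∑ i : Fin N, ∑ j : Fin N,
            (if i ≠ j ∧ ‖(Torus.geometry (Fin 3)).sepVec (γ u i).1 (γ u j).1‖ = ε then
              F u (γ u i).1 (γ u j).1
                (reflectVel ((Torus.geometry (Fin 3)).sepVec (γ u i).1 (γ u j).1) ((γ u i).2, (γ u j).2)).1
                (reflectVel ((Torus.geometry (Fin 3)).sepVec (γ u i).1 (γ u j).1) ((γ u i).2, (γ u j).2)).2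
            else 0)) →
    ∀ (N : ℕ) (ε : ℝ) (γ : ℝ → Config N (Fin 3) T3),
    IsHardSphereTrajectory (Torus.geometry (Fin 3)) ε N γ → 0 < ε → ε < 2⁻¹ →
    ∀ (Δ τ : ℝ), 0 < Δ → 0 ≤ τ →
      ∀ (F : ℝ → T3 → T3 → V3 → V3 → ℝ), (∀ u x y v w, 0 ≤ F u x y v w) →
      ∀ (t₁ : ℕ → Fin N × Fin N → ℝ),
      (∀ (k : ℕ) (p : Fin N × Fin N), t₁ k p = sInf {u : ℝ | u ∈ Set.Ioc 0 Δ ∧ ‖(Torus.geometry (Fin 3)).sepVec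
          (freeFlight (Torus.geometry (Fin 3)) u (γ (k * Δ)) p.1).1 (freeFlight (Torus.geometry (Fin 3)) u (γ (k * Δ)) p.2).1‖ ≤ ε}) →
      ∀ (R : ℕ → Finset (Fin N × Fin N)),
      (∀ k : ℕ, R k = Finset.univ.filter fun p => p.1 ≠ p.2 ∧
        (∃ u ∈ Set.Ioc 0 Δ, ‖(Torus.geometry (Fin 3)).sepVec
          (freeFlight (Torus.geometry (Fin 3)) u (γ (k * Δ)) p.1).1 (freeFlight (Torus.geometry (Fin 3)) u (γ (k * Δ)) p.2).1‖ ≤ ε) ∧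
        (∀ u ∈ Set.Ioo (k * Δ) (k * Δ + t₁ k p), ¬ Participates (Torus.geometry (Fin 3)) ε (γ u) p.1) ∧
        (∀ u ∈ Set.Ioo (k * Δ) (k * Δ + t₁ k p), ¬ Participates (Torus.geometry (Fin 3)) ε (γ u) p.2)) →
      ∑ k ∈ Finset.range ⌊τ / Δ⌋₊, ∑ p ∈ R k,
          F (k * Δ + t₁ k p) (freeFlight (Torus.geometry (Fin 3)) (t₁ k p) (γ (k * Δ)) p.1).1
            (freeFlight (Torus.geometry (Fin 3)) (t₁ k p) (γ (k * Δ)) p.2).1 ((γ (k * Δ) p.1).2) ((γ (k * Δ) p.2).2) ≤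
        ∑ᶠ (u : ℝ) (_ : u ∈ collisionTimes (Torus.geometry (Fin 3)) ε γ ∩ Set.Icc 0 τ),
          ∑ i : Fin N, ∑ j : Fin N,
            (if i ≠ j ∧ ‖(Torus.geometry (Fin 3)).sepVec (γ u i).1 (γ u j).1‖ = ε then
              F u (γ u i).1 (γ u j).1
                (reflectVel ((Torus.geometry (Fin 3)).sepVec (γ u i).1 (γ u j).1) ((γ u i).2, (γ u j).2)).1
                (reflectVel ((Torus.geometry (Fin 3)).sepVec (γ u i).1 (γ u j).1) ((γ u i).2, (γ u j).2)).2
            else 0) :=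
  Summit.AtomisticToContinuum.HydrodynamicLimit.Theorems.RateFloorPathwiseTransfer.stub_pathwiseTransfer

/- gen-0 `kineticTransferRealised_of_pathwise : MarkedRealisedTransfer → stub_pathwiseTransfer → KineticTransferRealised` (PROVED, orphan since gen 1) — removed from this copy (c4, size cap); see crux-dir history. -/

/-! ## §6 Gen-1 reshape, part 1: the realised cap (S9, landed) and why `∃ A` must move inside -/

/-- **S9 · REALISED-PAIR CAP** (`stub_realisedCap`; CLOSED by the gen-1 lead, `Theorems/JParityClosureRateFloorRealisedCap.lean`, p97016).
On a hard-sphere trajectory on `𝕋³` (`0 < ε < 1/2`) and a window `(s, t]`, each particle is the first endpoint of at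
most one realised pair (two realised pairs `(i,j)`, `(i,k)`: the earlier collision of `i` pre-empts the later pair, and
simultaneous ones coincide by the binary-collision field), so `#R ≤ N` and the realised marked sum of a mark bounded by
`M ≥ 0` on the window is `≤ N·M`.  Why it might fail: no.  Leans on: S6d's `first_contact`,
`apply_fst_eq_freeFlight_of_not_participates`, `IsHardSphereTrajectory.eq_or_eq_of_mem_contactPairs`. [size S] -/
def Stubs.stub_realisedCap : Prop :=
    ∀ (N : ℕ) (ε : ℝ) (γ : ℝ → Config N (Fin 3) T3),
    IsHardSphereTrajectory (Torus.geometry (Fin 3)) ε N γ → 0 < ε → ε < 2⁻¹ →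
    ∀ (s t : ℝ), s < t →
      ∀ (F : ℝ → T3 → T3 → V3 → V3 → ℝ) (M : ℝ), 0 ≤ M →
      (∀ u ∈ Set.Ioc s t, ∀ x y v w, F u x y v w ≤ M) →
      ∀ (t₁ : Fin N × Fin N → ℝ),
      (∀ p, t₁ p = sInf {u : ℝ | u ∈ Set.Ioc 0 (t - s) ∧ ‖(Torus.geometry (Fin 3)).sepVec
          (freeFlight (Torus.geometry (Fin 3)) u (γ s) p.1).1 (freeFlight (Torus.geometry (Fin 3)) u (γ s) p.2).1‖ ≤ ε}) →
      ∀ (R : Finset (Fin N × Fin N)),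
      (R = Finset.univ.filter fun p => p.1 ≠ p.2 ∧
        (∃ u ∈ Set.Ioc 0 (t - s), ‖(Torus.geometry (Fin 3)).sepVec
          (freeFlight (Torus.geometry (Fin 3)) u (γ s) p.1).1 (freeFlight (Torus.geometry (Fin 3)) u (γ s) p.2).1‖ ≤ ε) ∧
        (∀ u ∈ Set.Ioo s (s + t₁ p), ¬ Participates (Torus.geometry (Fin 3)) ε (γ u) p.1) ∧
        (∀ u ∈ Set.Ioo s (s + t₁ p), ¬ Participates (Torus.geometry (Fin 3)) ε (γ u) p.2)) →
      R.card ≤ N ∧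
      ∑ p ∈ R, F (s + t₁ p) (freeFlight (Torus.geometry (Fin 3)) (t₁ p) (γ s) p.1).1
          (freeFlight (Torus.geometry (Fin 3)) (t₁ p) (γ s) p.2).1 ((γ s p.1).2) ((γ s p.2).2) ≤ N * M

/-- Registered stub S9 (`Stubs.stub_realisedCap`, verbatim): CLOSED — `Theorems/JParityClosureRateFloorRealisedCap.lean` (p97016). -/
theorem stub_realisedCap :
    ∀ (N : ℕ) (ε : ℝ) (γ : ℝ → Config N (Fin 3) T3),
    IsHardSphereTrajectory (Torus.geometry (Fin 3)) ε N γ → 0 < ε → ε < 2⁻¹ →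
    ∀ (s t : ℝ), s < t →
      ∀ (F : ℝ → T3 → T3 → V3 → V3 → ℝ) (M : ℝ), 0 ≤ M →
      (∀ u ∈ Set.Ioc s t, ∀ x y v w, F u x y v w ≤ M) →
      ∀ (t₁ : Fin N × Fin N → ℝ),
      (∀ p, t₁ p = sInf {u : ℝ | u ∈ Set.Ioc 0 (t - s) ∧ ‖(Torus.geometry (Fin 3)).sepVec
          (freeFlight (Torus.geometry (Fin 3)) u (γ s) p.1).1 (freeFlight (Torus.geometry (Fin 3)) u (γ s) p.2).1‖ ≤ ε}) →
      ∀ (R : Finset (Fin N × Fin N)),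
      (R = Finset.univ.filter fun p => p.1 ≠ p.2 ∧
        (∃ u ∈ Set.Ioc 0 (t - s), ‖(Torus.geometry (Fin 3)).sepVec
          (freeFlight (Torus.geometry (Fin 3)) u (γ s) p.1).1 (freeFlight (Torus.geometry (Fin 3)) u (γ s) p.2).1‖ ≤ ε) ∧
        (∀ u ∈ Set.Ioo s (s + t₁ p), ¬ Participates (Torus.geometry (Fin 3)) ε (γ u) p.1) ∧
        (∀ u ∈ Set.Ioo s (s + t₁ p), ¬ Participates (Torus.geometry (Fin 3)) ε (γ u) p.2)) →
      R.card ≤ N ∧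
      ∑ p ∈ R, F (s + t₁ p) (freeFlight (Torus.geometry (Fin 3)) (t₁ p) (γ s) p.1).1
          (freeFlight (Torus.geometry (Fin 3)) (t₁ p) (γ s) p.2).1 ((γ s p.1).2) ((γ s p.2).2) ≤ N * M :=
  Summit.AtomisticToContinuum.HydrodynamicLimit.Theorems.RateFloorRealisedCap.stub_realisedCap

/-- **The cap on the realised functional** (from S9, summed over the windows): on a hard-sphere trajectory of `N + 1`
spheres, for a mark with `F ≤ M` on `[0, τ]` (`M ≥ 0`) and any window length `Δ > 0`,
`S_R = lineSR ε Δ τ γ F ≤ ε · ⌊τ/Δ⌋ · M` — realised pairs saturate at one per particle per window.  With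
`ε = σ(N+1)^{-1/3}`, `Δ = A(N+1)^{-1/3}` this is `≤ M σ τ / A`, independent of `N` and of everything the B-side
carries; this is the obstruction that retires ex-S7 (`Stubs.exStub_opacityFloorRealised`). [folklore] -/
theorem lineSR_le_cap (hS9 : Stubs.stub_realisedCap) {N : ℕ} {ε : ℝ} {γ : ℝ → Config (N + 1) (Fin 3) T3}
    (htraj : IsHardSphereTrajectory (Torus.geometry (Fin 3)) ε (N + 1) γ) (hε : 0 < ε) (hεlt : ε < 2⁻¹)
    {Δ τ : ℝ} (hΔ : 0 < Δ) (hτ : 0 ≤ τ) (F : ℝ → T3 → T3 → V3 → V3 → ℝ) {M : ℝ} (hM : 0 ≤ M)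
    (hFM : ∀ u ∈ Set.Icc 0 τ, ∀ x y v w, F u x y v w ≤ M) :
    lineSR ε Δ τ γ F ≤ ε * ⌊τ / Δ⌋₊ * M := by
  have hwin : ∀ k ∈ Finset.range ⌊τ / Δ⌋₊, realisedSum ε Δ γ (k * Δ) F ≤ (N + 1 : ℕ) * M := by
    intro k hk
    have hk' : ((k : ℝ) + 1) * Δ ≤ τ := by
      have h1 : (k : ℝ) + 1 ≤ ⌊τ / Δ⌋₊ := by exact_mod_cast Nat.succ_le_of_lt (Finset.mem_range.1 hk)
      have h2 : ((⌊τ / Δ⌋₊ : ℕ) : ℝ) ≤ τ / Δ := Nat.floor_le (div_nonneg hτ hΔ.le)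
      calc ((k : ℝ) + 1) * Δ ≤ (τ / Δ) * Δ := mul_le_mul_of_nonneg_right (h1.trans h2) hΔ.le
        _ = τ := div_mul_cancel₀ τ hΔ.ne'
    have hk0 : 0 ≤ (k : ℝ) * Δ := mul_nonneg k.cast_nonneg hΔ.le
    have hsub : ∀ u ∈ Set.Ioc ((k : ℝ) * Δ) (k * Δ + Δ), u ∈ Set.Icc 0 τ := fun u hu =>
      ⟨hk0.trans hu.1.le, hu.2.trans (by linarith)⟩
    have key := (hS9 (N + 1) ε γ htraj hε hεlt (k * Δ) (k * Δ + Δ) (by linarith) F M hM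
      (fun u hu x y v w => hFM u (hsub u hu) x y v w)
      (fun p => firstContact ε Δ (γ (k * Δ)) p) (fun p => by rw [add_sub_cancel_left]; rfl)
      (realisedPairs ε Δ γ (k * Δ)) (by rw [add_sub_cancel_left]; rfl)).2
    simpa only [realisedSum] using key
  have hsum : ∑ k ∈ Finset.range ⌊τ / Δ⌋₊, realisedSum ε Δ γ (k * Δ) F ≤ ⌊τ / Δ⌋₊ * ((N + 1 : ℕ) * M) := by
    calc ∑ k ∈ Finset.range ⌊τ / Δ⌋₊, realisedSum ε Δ γ (k * Δ) F
        ≤ ∑ _k ∈ Finset.range ⌊τ / Δ⌋₊, ((N + 1 : ℕ) : ℝ) * M := Finset.sum_le_sum hwin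
      _ = ⌊τ / Δ⌋₊ * ((N + 1 : ℕ) * M) := by rw [Finset.sum_const, Finset.card_range, nsmul_eq_mul]
  have hn : (0 : ℝ) < ((N + 1 : ℕ) : ℝ) := by positivity
  calc lineSR ε Δ τ γ F = ε / ((N + 1 : ℕ) : ℝ) * ∑ k ∈ Finset.range ⌊τ / Δ⌋₊, realisedSum ε Δ γ (k * Δ) F := rfl
    _ ≤ ε / ((N + 1 : ℕ) : ℝ) * (⌊τ / Δ⌋₊ * ((N + 1 : ℕ) * M)) :=
        mul_le_mul_of_nonneg_left hsum (div_nonneg hε.le hn.le)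
    _ = ε * ⌊τ / Δ⌋₊ * M := by field_simp

/-! ## §7 Gen-1 reshape, part 2: transfer through the WOULD-BE functional; bursts; the two open leaves

THE LINE, GEN-1 SHAPE.  `K_N[χΞ] ≥ S_R` surely (gen 0, proved) and `S_R ≥ S_W − M·(ε/n)·Bursts` surely (S10, kinematic:
every pre-empted would-be pair touches a particle of would-be degree `≥ 2` or is charged injectively to a SECONDARY
collision — one whose partner was already deflected in the window), where `S_W` is the WOULD-BE functional (all ordered
would-be pairs of the window-start configurations, marks at the predicted datum; STATIC in each window) and `Bursts`
counts, per window, the would-be pairs at a multi-degree particle plus the secondary contact incidences.  Hence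
`RateFloor ⇐ NoBursts ∧ StaticOpacityFloor` (`rateFloor_of_noBursts_staticFloor`, proved): the mark, the profiles' frame
and `r` enter ONLY the static leaf; the dynamics beyond one window enters ONLY through the law `P_s` of the window-start
configurations (both leaves) and the mark-free burst statistics (S7a).  Window length `Δ_N = A (N+1)^{-b}`,
`b ∈ [1/3, 1]`, `A > 0` chosen after everything but `N` (S7a picks, S7b serves every choice).  The objects (`wouldBePairs`,
`wouldBeSum`, `lineSW`, `multiPairs`, `secondaryCount`, `lineBursts`, `windowLenB`) are the tree definitions of
`Theorems/JParityClosureRateFloorLineDefs.lean`. -/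

/-- Registered BRIDGE stub `realisedPairs_subset_wouldBePairs` (the `R ⊆ W` step of S10): CLOSED — it rides with the line's
definitions file `Theorems/JParityClosureRateFloorLineDefs.lean` (p98025). [folklore] -/
theorem realisedPairs_subset_wouldBePairs :
    ∀ (n : ℕ) (ε Δ : ℝ) (γ : ℝ → Config n (Fin 3) T3) (s : ℝ), realisedPairs ε Δ γ s ⊆ wouldBePairs ε Δ (γ s) :=
  Summit.AtomisticToContinuum.HydrodynamicLimit.Theorems.RateFloorLine.realisedPairs_subset_wouldBePairs


/-- **S10 · PRE-EMPTION CHARGE** (`stub_preemptionCharge`; kinematic — CLOSED, `Theorems/JParityClosureRateFloorPreemptionCharge.lean`, p98201).  On a hard-sphere trajectory on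
`𝕋³` (`0 < ε < 1/2`) and a window `(s, t]`, for a mark `F ≤ M` on the window (`M ≥ 0`): the would-be marked sum exceeds
the realised marked sum by at most `M · (#C + S)`, where `C` = would-be pairs at a particle of would-be out-degree `≥ 2`
and `S` = number of secondary ordered contact incidences of the window (contact pairs at a collision time `u ∈ (s,t]`
with a member that already participated in a collision during `(s, u)`).  Proof: `R ⊆ W`, so the excess is the sum over
the PRE-EMPTED pairs `W \ R`, each term `≤ M`; a pre-empted `p = (i,j) ∉ C` (both endpoints of out-degree 1) has a first
instant `u* ∈ (s, s + t₁ p)` at which an endpoint `e` participates, with partner `k`; if `k` were fresh on `(s, u*)`,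
`(e, k)` would be a would-be pair realised at `u*` (S1 + positions), forcing `k` = the other endpoint by degree 1 and
contradicting the minimality of `t₁ p` (`first_contact`); so `k` is stale and `p ↦ (u*, (e,k))` if `e = p.1`,
`(u*, (k,e))` if `e = p.2`, is an injection of the degree-1 pre-empted pairs into the secondary incidences.  Why it
might fail: bookkeeping only (symmetry `(i,j) ∈ W ↔ (j,i) ∈ W` from `norm_sepVec_comm_of_le`; the minimum over the
finitely many participation times in `(s, s + t₁ p)`).  Leans on: S1, S9's `realised_mem_contactPairs`-type facts
(`RateFloorMarkedTransfer.first_contact`, `apply_fst_eq_freeFlight_of_not_participates`),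
`IsHardSphereTrajectory.participates_iff`/`eq_or_eq_of_mem_contactPairs`, `finite_collisionTimes_inter_of_subset_Icc`.
[size M] -/
def Stubs.stub_preemptionCharge : Prop :=
    ∀ (N : ℕ) (ε : ℝ) (γ : ℝ → Config N (Fin 3) T3),
    IsHardSphereTrajectory (Torus.geometry (Fin 3)) ε N γ → 0 < ε → ε < 2⁻¹ →
    ∀ (s t : ℝ), s < t →
      ∀ (F : ℝ → T3 → T3 → V3 → V3 → ℝ) (M : ℝ), 0 ≤ M →
      (∀ u ∈ Set.Ioc s t, ∀ x y v w, F u x y v w ≤ M) →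
      ∀ (t₁ : Fin N × Fin N → ℝ),
      (∀ p, t₁ p = sInf {u : ℝ | u ∈ Set.Ioc 0 (t - s) ∧ ‖(Torus.geometry (Fin 3)).sepVec
          (freeFlight (Torus.geometry (Fin 3)) u (γ s) p.1).1 (freeFlight (Torus.geometry (Fin 3)) u (γ s) p.2).1‖ ≤ ε}) →
      ∀ (W : Finset (Fin N × Fin N)),
      (W = Finset.univ.filter fun p => p.1 ≠ p.2 ∧
        ∃ u ∈ Set.Ioc 0 (t - s), ‖(Torus.geometry (Fin 3)).sepVec
          (freeFlight (Torus.geometry (Fin 3)) u (γ s) p.1).1 (freeFlight (Torus.geometry (Fin 3)) u (γ s) p.2).1‖ ≤ ε) →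
      ∀ (R : Finset (Fin N × Fin N)),
      (R = Finset.univ.filter fun p => p.1 ≠ p.2 ∧
        (∃ u ∈ Set.Ioc 0 (t - s), ‖(Torus.geometry (Fin 3)).sepVec
          (freeFlight (Torus.geometry (Fin 3)) u (γ s) p.1).1 (freeFlight (Torus.geometry (Fin 3)) u (γ s) p.2).1‖ ≤ ε) ∧
        (∀ u ∈ Set.Ioo s (s + t₁ p), ¬ Participates (Torus.geometry (Fin 3)) ε (γ u) p.1) ∧
        (∀ u ∈ Set.Ioo s (s + t₁ p), ¬ Participates (Torus.geometry (Fin 3)) ε (γ u) p.2)) →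
      ∀ (C : Finset (Fin N × Fin N)),
      (C = W.filter fun p => 2 ≤ (W.filter fun q => q.1 = p.1).card ∨ 2 ≤ (W.filter fun q => q.1 = p.2).card) →
      ∀ (S : ℕ),
      (S = ∑ᶠ (u : ℝ) (_ : u ∈ collisionTimes (Torus.geometry (Fin 3)) ε γ ∩ Set.Ioc s t),
        ((contactPairs (Torus.geometry (Fin 3)) ε (γ u)).filter fun q =>
          ∃ u' ∈ Set.Ioo s u, Participates (Torus.geometry (Fin 3)) ε (γ u') q.1 ∨
            Participates (Torus.geometry (Fin 3)) ε (γ u') q.2).card) →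
      ∑ p ∈ W, F (s + t₁ p) (freeFlight (Torus.geometry (Fin 3)) (t₁ p) (γ s) p.1).1
          (freeFlight (Torus.geometry (Fin 3)) (t₁ p) (γ s) p.2).1 ((γ s p.1).2) ((γ s p.2).2) ≤
        ∑ p ∈ R, F (s + t₁ p) (freeFlight (Torus.geometry (Fin 3)) (t₁ p) (γ s) p.1).1
          (freeFlight (Torus.geometry (Fin 3)) (t₁ p) (γ s) p.2).1 ((γ s p.1).2) ((γ s p.2).2) +
        M * ((C.card : ℝ) + (S : ℝ))

/-- Registered stub S10 (`Stubs.stub_preemptionCharge`, verbatim): CLOSED — `Theorems/JParityClosureRateFloorPreemptionCharge.lean` (p98201, wave-1 worker). -/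
theorem stub_preemptionCharge :
    ∀ (N : ℕ) (ε : ℝ) (γ : ℝ → Config N (Fin 3) T3),
    IsHardSphereTrajectory (Torus.geometry (Fin 3)) ε N γ → 0 < ε → ε < 2⁻¹ →
    ∀ (s t : ℝ), s < t →
      ∀ (F : ℝ → T3 → T3 → V3 → V3 → ℝ) (M : ℝ), 0 ≤ M →
      (∀ u ∈ Set.Ioc s t, ∀ x y v w, F u x y v w ≤ M) →
      ∀ (t₁ : Fin N × Fin N → ℝ),
      (∀ p, t₁ p = sInf {u : ℝ | u ∈ Set.Ioc 0 (t - s) ∧ ‖(Torus.geometry (Fin 3)).sepVec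
          (freeFlight (Torus.geometry (Fin 3)) u (γ s) p.1).1 (freeFlight (Torus.geometry (Fin 3)) u (γ s) p.2).1‖ ≤ ε}) →
      ∀ (W : Finset (Fin N × Fin N)),
      (W = Finset.univ.filter fun p => p.1 ≠ p.2 ∧
        ∃ u ∈ Set.Ioc 0 (t - s), ‖(Torus.geometry (Fin 3)).sepVec
          (freeFlight (Torus.geometry (Fin 3)) u (γ s) p.1).1 (freeFlight (Torus.geometry (Fin 3)) u (γ s) p.2).1‖ ≤ ε) →
      ∀ (R : Finset (Fin N × Fin N)),
      (R = Finset.univ.filter fun p => p.1 ≠ p.2 ∧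
        (∃ u ∈ Set.Ioc 0 (t - s), ‖(Torus.geometry (Fin 3)).sepVec
          (freeFlight (Torus.geometry (Fin 3)) u (γ s) p.1).1 (freeFlight (Torus.geometry (Fin 3)) u (γ s) p.2).1‖ ≤ ε) ∧
        (∀ u ∈ Set.Ioo s (s + t₁ p), ¬ Participates (Torus.geometry (Fin 3)) ε (γ u) p.1) ∧
        (∀ u ∈ Set.Ioo s (s + t₁ p), ¬ Participates (Torus.geometry (Fin 3)) ε (γ u) p.2)) →
      ∀ (C : Finset (Fin N × Fin N)),
      (C = W.filter fun p => 2 ≤ (W.filter fun q => q.1 = p.1).card ∨ 2 ≤ (W.filter fun q => q.1 = p.2).card) →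
      ∀ (S : ℕ),
      (S = ∑ᶠ (u : ℝ) (_ : u ∈ collisionTimes (Torus.geometry (Fin 3)) ε γ ∩ Set.Ioc s t),
        ((contactPairs (Torus.geometry (Fin 3)) ε (γ u)).filter fun q =>
          ∃ u' ∈ Set.Ioo s u, Participates (Torus.geometry (Fin 3)) ε (γ u') q.1 ∨
            Participates (Torus.geometry (Fin 3)) ε (γ u') q.2).card) →
      ∑ p ∈ W, F (s + t₁ p) (freeFlight (Torus.geometry (Fin 3)) (t₁ p) (γ s) p.1).1
          (freeFlight (Torus.geometry (Fin 3)) (t₁ p) (γ s) p.2).1 ((γ s p.1).2) ((γ s p.2).2) ≤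
        ∑ p ∈ R, F (s + t₁ p) (freeFlight (Torus.geometry (Fin 3)) (t₁ p) (γ s) p.1).1
          (freeFlight (Torus.geometry (Fin 3)) (t₁ p) (γ s) p.2).1 ((γ s p.1).2) ((γ s p.2).2) +
        M * ((C.card : ℝ) + (S : ℝ)) :=
  Summit.AtomisticToContinuum.HydrodynamicLimit.Theorems.RateFloorPreemptionCharge.stub_preemptionCharge

/-- **The would-be transfer, window-summed** (from S10): for a mark `F ≤ M` on `[0, τ]` (`M ≥ 0`) and any `Δ > 0`,
`S_W ≤ S_R + (ε/n)·M·Bursts` along a hard-sphere trajectory of `N + 1` spheres. [folklore] -/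
theorem lineSW_le_lineSR_add (hS10 : Stubs.stub_preemptionCharge) {N : ℕ} {ε : ℝ}
    {γ : ℝ → Config (N + 1) (Fin 3) T3} (htraj : IsHardSphereTrajectory (Torus.geometry (Fin 3)) ε (N + 1) γ)
    (hε : 0 < ε) (hεlt : ε < 2⁻¹) {Δ τ : ℝ} (hΔ : 0 < Δ) (hτ : 0 ≤ τ) (F : ℝ → T3 → T3 → V3 → V3 → ℝ) {M : ℝ}
    (hM : 0 ≤ M) (hFM : ∀ u ∈ Set.Icc 0 τ, ∀ x y v w, F u x y v w ≤ M) :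
    lineSW ε Δ τ γ F ≤ lineSR ε Δ τ γ F + ε / (N + 1 : ℝ) * M * lineBursts ε Δ τ γ := by
  have hwin : ∀ k ∈ Finset.range ⌊τ / Δ⌋₊, wouldBeSum ε Δ (γ (k * Δ)) (k * Δ) F ≤
      realisedSum ε Δ γ (k * Δ) F +
        M * (((multiPairs ε Δ (γ (k * Δ))).card : ℝ) + (secondaryCount ε γ (k * Δ) (k * Δ + Δ) : ℝ)) := by
    intro k hk
    have hk' : ((k : ℝ) + 1) * Δ ≤ τ := by
      have h1 : (k : ℝ) + 1 ≤ ⌊τ / Δ⌋₊ := by exact_mod_cast Nat.succ_le_of_lt (Finset.mem_range.1 hk)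
      have h2 : ((⌊τ / Δ⌋₊ : ℕ) : ℝ) ≤ τ / Δ := Nat.floor_le (div_nonneg hτ hΔ.le)
      calc ((k : ℝ) + 1) * Δ ≤ (τ / Δ) * Δ := mul_le_mul_of_nonneg_right (h1.trans h2) hΔ.le
        _ = τ := div_mul_cancel₀ τ hΔ.ne'
    have hk0 : 0 ≤ (k : ℝ) * Δ := mul_nonneg k.cast_nonneg hΔ.le
    have hsub : ∀ u ∈ Set.Ioc ((k : ℝ) * Δ) (k * Δ + Δ), u ∈ Set.Icc 0 τ := fun u hu =>
      ⟨hk0.trans hu.1.le, hu.2.trans (by linarith)⟩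
    have key := hS10 (N + 1) ε γ htraj hε hεlt (k * Δ) (k * Δ + Δ) (by linarith) F M hM
      (fun u hu x y v w => hFM u (hsub u hu) x y v w)
      (fun p => firstContact ε Δ (γ (k * Δ)) p) (fun p => by rw [add_sub_cancel_left]; rfl)
      (wouldBePairs ε Δ (γ (k * Δ))) (by rw [add_sub_cancel_left]; rfl)
      (realisedPairs ε Δ γ (k * Δ)) (by rw [add_sub_cancel_left]; rfl)
      (multiPairs ε Δ (γ (k * Δ))) rfl
      (secondaryCount ε γ (k * Δ) (k * Δ + Δ)) rfl
    simpa only [wouldBeSum, realisedSum] using key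
  have hn : (0 : ℝ) < ((N + 1 : ℕ) : ℝ) := by positivity
  have hn1 : ((N + 1 : ℕ) : ℝ) = (N + 1 : ℝ) := by push_cast; ring
  have hsum := Finset.sum_le_sum hwin
  rw [Finset.sum_add_distrib, ← Finset.mul_sum] at hsum
  have hSW : lineSW ε Δ τ γ F =
      ε / ((N + 1 : ℕ) : ℝ) * ∑ k ∈ Finset.range ⌊τ / Δ⌋₊, wouldBeSum ε Δ (γ (k * Δ)) (k * Δ) F := rfl
  have hSR : lineSR ε Δ τ γ F =
      ε / ((N + 1 : ℕ) : ℝ) * ∑ k ∈ Finset.range ⌊τ / Δ⌋₊, realisedSum ε Δ γ (k * Δ) F := rfl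
  have hBu : lineBursts ε Δ τ γ = ∑ k ∈ Finset.range ⌊τ / Δ⌋₊,
      (((multiPairs ε Δ (γ (k * Δ))).card : ℝ) + (secondaryCount ε γ (k * Δ) (k * Δ + Δ) : ℝ)) := rfl
  rw [hSW, hSR, hBu, ← hn1]
  calc ε / ((N + 1 : ℕ) : ℝ) * ∑ k ∈ Finset.range ⌊τ / Δ⌋₊, wouldBeSum ε Δ (γ (k * Δ)) (k * Δ) F
      ≤ ε / ((N + 1 : ℕ) : ℝ) * (∑ k ∈ Finset.range ⌊τ / Δ⌋₊, realisedSum ε Δ γ (k * Δ) F +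
          M * ∑ k ∈ Finset.range ⌊τ / Δ⌋₊,
            (((multiPairs ε Δ (γ (k * Δ))).card : ℝ) + (secondaryCount ε γ (k * Δ) (k * Δ + Δ) : ℝ))) :=
        mul_le_mul_of_nonneg_left hsum (div_nonneg hε.le hn.le)
    _ = _ := by ring

/-- **The kinetic transfer as a SURE inequality** (gen 0's `kineticTransferRealised_of_pathwise`, unbundled from the
crux's `let`-chain): on a hard-sphere trajectory of `N + 1` spheres with `0 < ε < 1/2`, for every `Δ > 0`, `τ ≥ 0` and
nonnegative mark `F`, `S_R ≤` the collision functional of `[0, τ]` with the same mark read at the reflected current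
velocities (S8 fed with S6d). [folklore] -/
theorem lineSR_le_collisionFunctional (hS6d : MarkedRealisedTransfer) (hS8 : Stubs.stub_pathwiseTransfer) {N : ℕ}
    {ε : ℝ} {γ : ℝ → Config (N + 1) (Fin 3) T3} (htraj : IsHardSphereTrajectory (Torus.geometry (Fin 3)) ε (N + 1) γ)
    (hε : 0 < ε) (hεlt : ε < 2⁻¹) {Δ τ : ℝ} (hΔ : 0 < Δ) (hτ : 0 ≤ τ) (F : ℝ → T3 → T3 → V3 → V3 → ℝ)
    (hF : ∀ u x y v w, 0 ≤ F u x y v w) :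
    lineSR ε Δ τ γ F ≤ ε / (N + 1 : ℝ) *
      ∑ᶠ (u : ℝ) (_ : u ∈ collisionTimes (Torus.geometry (Fin 3)) ε γ ∩ Set.Icc 0 τ),
        ∑ i : Fin (N + 1), ∑ j : Fin (N + 1),
          (if i ≠ j ∧ ‖(Torus.geometry (Fin 3)).sepVec (γ u i).1 (γ u j).1‖ = ε then
            F u (γ u i).1 (γ u j).1
              (reflectVel ((Torus.geometry (Fin 3)).sepVec (γ u i).1 (γ u j).1) ((γ u i).2, (γ u j).2)).1
              (reflectVel ((Torus.geometry (Fin 3)).sepVec (γ u i).1 (γ u j).1) ((γ u i).2, (γ u j).2)).2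
          else 0) := by
  have key := hS8 hS6d (N + 1) ε γ htraj hε hεlt Δ τ hΔ hτ F hF
    (fun k p => firstContact ε Δ (γ (k * Δ)) p) (fun k p => rfl)
    (fun k => realisedPairs ε Δ γ (k * Δ)) (fun k => rfl)
  have hn : (0 : ℝ) ≤ (N + 1 : ℝ) := by positivity
  have hn1 : ((N + 1 : ℕ) : ℝ) = (N + 1 : ℝ) := by push_cast; ring
  have hSR : lineSR ε Δ τ γ F = ε / ((N + 1 : ℕ) : ℝ) * ∑ k ∈ Finset.range ⌊τ / Δ⌋₊,
      ∑ p ∈ realisedPairs ε Δ γ (k * Δ),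
        F (k * Δ + firstContact ε Δ (γ (k * Δ)) p)
          (freeFlight (Torus.geometry (Fin 3)) (firstContact ε Δ (γ (k * Δ)) p) (γ (k * Δ)) p.1).1
          (freeFlight (Torus.geometry (Fin 3)) (firstContact ε Δ (γ (k * Δ)) p) (γ (k * Δ)) p.2).1
          ((γ (k * Δ) p.1).2) ((γ (k * Δ) p.2).2) := rfl
  rw [hSR, hn1]
  exact mul_le_mul_of_nonneg_left key (div_nonneg hε.le hn)

/-- **S7a · NO BURSTS** (`stub_noBursts`; OPEN — in probability, MARK-FREE, `r`-FREE).  Along the local-Gibbs hard-sphere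
flow at small reduced density, for some window exponent `b ∈ [1/3, 1]` and scale `A > 0` (chosen after the profiles,
`σ`, the flow, `τ`, `η`, `δ`), the normalised burst count `(ε_N/(N+1)) · Bursts` — would-be pairs at particles of
would-be degree `≥ 2` plus secondary contact incidences, over the windows of length `Δ_N = A(N+1)^{-b}` in `[0, τ]` —
exceeds `η` with probability `≤ δ` for `N ≥ N₀`.  Heuristics: per window a particle is would-be with probability
`p ≍ Δ_N/t_mfp ≍ A σ²ρv̄Y (N+1)^{1/3−b}`, bursts are `O(p²)` per particle against `O(p)` would-be pairs, so for
`b > 1/3` the normalised count is `o(1)` in any local-equilibrium-like statistics and for `b = 1/3` it is `O(A)`; what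
is NOT controlled is the law `P_s` of the flow at macroscopic times (positive-mass near-jammed pockets with diverging
local collision rates would produce bursts) and, for the secondary part, the one-window dynamics (3-body recollision
statistics at kinetic times — EDMD-flat, Disproof §5).  In GLOBAL equilibrium (constant profiles) the static part is a
canonical-Gibbs computation and the secondary part a Kac/Santaló flux-measure computation (Palm expectation at collision
instants) — known mathematics not in the tree.  Why it might fail: only through the uncontrolled `P_s` (jamming of a
positive mass fraction at some time ≤ τ with probability > δ).  Leans on: nothing landed; route item CollisionTightness
(13085) is the nearest typed neighbour; OllaVaradhanYau1993 §4 (entropy/LD transfer does NOT suffice: BN1). [size XL] -/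
def Stubs.stub_noBursts : Prop :=
  ∀ (a₀ θ₀ : Literature.MathematicalPhysics.KineticTheory.T3 → ℝ) (u₀ : Literature.MathematicalPhysics.KineticTheory.T3 → Literature.MathematicalPhysics.KineticTheory.V3), Continuous a₀ → Continuous θ₀ → Continuous u₀ → (∀ x, 0 < a₀ x) → (∀ x, 0 < θ₀ x) → ∃ σ₀ : ℝ, 0 < σ₀ ∧ ∀ σ : ℝ, 0 < σ → σ < σ₀ → ∀ Φ : (N : ℕ) → Literature.Analysis.FluidPDE.HardSphereFlow (Literature.Analysis.FluidPDE.Torus.geometry (Fin 3)) (Literature.MathematicalPhysics.KineticTheory.hsDiameter σ N) (N + 1), ∀ τ : ℝ, 0 < τ → ∀ η δ : ℝ, 0 < η → 0 < δ → ∃ A : ℝ, 0 < A ∧ ∃ b : ℝ, 1 / 3 ≤ b ∧ b ≤ 1 ∧ ∃ N₀ : ℕ, ∀ N : ℕ, N₀ ≤ N → let ε := Literature.MathematicalPhysics.KineticTheory.hsDiameter σ N; let γ := fun z (s : ℝ) => (Φ N).flow s z; Literature.MathematicalPhysics.KineticTheory.localGibbsLaw σ a₀ u₀ θ₀ N (Φ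 N) {z | η < ε / (N + 1 : ℝ) * lineBursts ε (windowLenB A b N) τ (γ z)} ≤ ENNReal.ofReal δ

/-- Registered stub S7a (`Stubs.stub_noBursts`, verbatim): the `sorry` to be discharged. -/
theorem stub_noBursts :
    ∀ (a₀ θ₀ : Literature.MathematicalPhysics.KineticTheory.T3 → ℝ) (u₀ : Literature.MathematicalPhysics.KineticTheory.T3 → Literature.MathematicalPhysics.KineticTheory.V3), Continuous a₀ → Continuous θ₀ → Continuous u₀ → (∀ x, 0 < a₀ x) → (∀ x, 0 < θ₀ x) → ∃ σ₀ : ℝ, 0 < σ₀ ∧ ∀ σ : ℝ, 0 < σ → σ < σ₀ → ∀ Φ : (N : ℕ) → Literature.Analysis.FluidPDE.HardSphereFlow (Literature.Analysis.FluidPDE.Torus.geometry (Fin 3)) (Literature.MathematicalPhysics.KineticTheory.hsDiameter σ N) (N + 1), ∀ τ : ℝ, 0 < τ → ∀ η δ : ℝ, 0 < η → 0 < δ → ∃ A : ℝ, 0 < A ∧ ∃ b : ℝ, 1 / 3 ≤ b ∧ b ≤ 1 ∧ ∃ N₀ : ℕ, ∀ N : ℕ, N₀ ≤ N → let ε :=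 Literature.MathematicalPhysics.KineticTheory.hsDiameter σ N; let γ := fun z (s : ℝ) => (Φ N).flow s z; Literature.MathematicalPhysics.KineticTheory.localGibbsLaw σ a₀ u₀ θ₀ N (Φ N) {z | η < ε / (N + 1 : ℝ) * lineBursts ε (windowLenB A b N) τ (γ z)} ≤ ENNReal.ofReal δ := by
  sorry

/-- **S7b · STATIC OPACITY FLOOR along the flow** (`stub_staticOpacityFloor`; OPEN — HARDEST, the lead's).  For a universal
`g₃ > 0`: along the local-Gibbs hard-sphere flow at small reduced density, for every `τ`, weight `χ ≥ 0`, bounded mark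
`Ξ ≥ 0`, every `η, δ`, small `r` (chosen after all of these) and EVERY window choice `A > 0`, `b ∈ [1/3, 1]`, the
WOULD-BE static functional `S_W` of the window-start configurations is at least `g₃ σ³ ∫₀^τ∫ χ B^Ξ_r − η` with
probability `≥ 1 − δ` for `N ≥ N₀`.  `S_W` is a sum over the windows of STATIC functionals of `γ(kΔ)` (collision
cylinders of length `Δ|g|` read on the actual configuration, marks at the predicted impact datum); no dynamics inside a
window, no saturation (the dense-pocket obstruction of ex-S7 is gone: `S_W` grows with the local rate exactly as the
B-side does).  What it contains (everything research-open in the crux, now in static form at each window start):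
(i) S_seg — no volume-filling sub-`r` segregation of the velocity law at the times `kΔ ≤ τ` incl. post-shock (the crux
attack's hidden compactness content; NOTES (A3): false for a two-scale state, codimension-one structures harmless);
(ii) the equilibrium-statistical core — at TIME ZERO it is a law of large numbers for a kinetic-scale pair functional
under the canonical hard-sphere Gibbs measure at small `σ` with continuous profiles (cluster expansion; provable in
principle, L/XL, the natural first support item: `StaticOpacityFloorAtZero` below); (iii) the transport of (ii) to the
window starts `kΔ > 0`, i.e. to the unknown laws `P_{kΔ}` — by entropy alone impossible at scale `r` (BN1), so this IS
local-equilibrium propagation in a weak, one-sided (floor) form.  Why it might fail: a forward evolution sustaining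
mutually supersonic interpenetrating streams below scale `r` on positive space-time measure with probability `> δ`
(none known); conforming restatements of the crux (kinetic-scale mollification `R_N`, `τ < T`, density cut) act
exactly here.  Leans on: S4 (equipartition), S5 (gain spreading) as intended engines; route items DensityCap (13082),
KineticEnergyTails (13087); OllaVaradhanYau1993 §4; Spohn1991 I.2.4. [size XL] -/
def Stubs.stub_staticOpacityFloor : Prop :=
  ∃ g₃ : ℝ, 0 < g₃ ∧ ∀ (a₀ θ₀ : Literature.MathematicalPhysics.KineticTheory.T3 → ℝ) (u₀ : Literature.MathematicalPhysics.KineticTheory.T3 → Literature.MathematicalPhysics.KineticTheory.V3), Continuous a₀ → Continuous θ₀ → Continuous u₀ → (∀ x, 0 < a₀ x) → (∀ x, 0 < θ₀ x) → ∃ σ₀ : ℝ, 0 < σ₀ ∧ ∀ σ : ℝ, 0 < σ → σ < σ₀ → ∀ Φ : (N : ℕ) → Literature.Analysis.FluidPDE.HardSphereFlow (Literature.Analysis.FluidPDE.Torus.geometry (Fin 3)) (Literature.MathematicalPhysics.KineticTheory.hsDiameter σ N) (N + 1), ∀ τ : ℝ, 0 < τ → ∀ χ : ℝ × UnitAddTorus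 (Fin 3) → ℝ, Continuous χ → (∀ p, 0 ≤ χ p) → ∀ Ξ : EuclideanSpace ℝ (Fin 3) × EuclideanSpace ℝ (Fin 3) × EuclideanSpace ℝ (Fin 3) → ℝ, Continuous Ξ → (∀ q, 0 ≤ Ξ q) → (∃ C : ℝ, ∀ q, Ξ q ≤ C) → ∀ η δ : ℝ, 0 < η → 0 < δ → ∃ r₀ : ℝ, 0 < r₀ ∧ ∀ r : ℝ, 0 < r → r < r₀ → ∀ A : ℝ, 0 < A → ∀ b : ℝ, 1 / 3 ≤ b → b ≤ 1 → ∃ N₀ : ℕ, ∀ N : ℕ, N₀ ≤ N → let ε := Literature.MathematicalPhysics.KineticTheory.hsDiameter σ N; let G := Literature.Analysis.FluidPDE.Torus.geometry (Fin 3); let γ := fun z (s : ℝ) => (Φ N).flow s z; let bx : UnitAddTorus (Fin 3) → UnitAddTorus (Fin 3) → ℝ := fun x y => 3 / (Real.pi * r ^ 3) * max (1 - Literature.Analysis.FluidPDE.Torus.euclidDist x y / r) 0; let Θ := fun (Ξ : EuclideanSpace ℝ (Fin 3) × EuclideanSpace ℝ (Fin 3) × EuclideanSpace ℝ (Fin 3)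 → ℝ) (v w : EuclideanSpace ℝ (Fin 3)) => ∫ ω : Metric.sphere (0 : EuclideanSpace ℝ (Fin 3)) 1, Ξ ((ω : EuclideanSpace ℝ (Fin 3)), v, w) * Literature.MathematicalPhysics.KineticTheory.hardSphereKernel (w, v) ω ∂Literature.MathematicalPhysics.KineticTheory.sphereMeasure; let B := fun Ξ z s (x₀ : UnitAddTorus (Fin 3)) => ∫ p, bx p.1.1 x₀ * bx p.2.1 x₀ * Θ Ξ p.1.2 p.2.2 ∂((Literature.Analysis.FluidPDE.empiricalMeasure (γ z s)).prod (Literature.Analysis.FluidPDE.empiricalMeasure (γ z s))); let SW := fun (z : Literature.Analysis.FluidPDE.Config (N + 1) (Fin 3) Literature.MathematicalPhysics.KineticTheory.T3) => lineSW ε (windowLenB A b N) τ (γ z) (fun u x y v w => χ (u, x) * Ξ (ε⁻¹ • G.sepVec x y, v, w)); Literature.MathematicalPhysics.KineticTheory.localGibbsLaw σ a₀ u₀ θ₀ N (Φ N) {z | SW z < g₃ * σ ^ 3 * (∫ s in Set.Icc (0 : ℝ) τ, ∫ x : UnitAddTorus (Fin 3), χ (s, x) * B Ξ z s x) - η} ≤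 ENNReal.ofReal δ

/-- Registered stub S7b (`Stubs.stub_staticOpacityFloor`, verbatim): the `sorry` to be discharged. -/
theorem stub_staticOpacityFloor :
    ∃ g₃ : ℝ, 0 < g₃ ∧ ∀ (a₀ θ₀ : Literature.MathematicalPhysics.KineticTheory.T3 → ℝ) (u₀ : Literature.MathematicalPhysics.KineticTheory.T3 → Literature.MathematicalPhysics.KineticTheory.V3), Continuous a₀ → Continuous θ₀ → Continuous u₀ → (∀ x, 0 < a₀ x) → (∀ x, 0 < θ₀ x) → ∃ σ₀ : ℝ, 0 < σ₀ ∧ ∀ σ : ℝ, 0 < σ → σ < σ₀ → ∀ Φ : (N : ℕ) → Literature.Analysis.FluidPDE.HardSphereFlow (Literature.Analysis.FluidPDE.Torus.geometry (Fin 3)) (Literature.MathematicalPhysics.KineticTheory.hsDiameter σ N) (N + 1), ∀ τ : ℝ, 0 < τ → ∀ χ : ℝ × UnitAddTorus (Fin 3) → ℝ, Continuous χ → (∀ p, 0 ≤ χ p) → ∀ Ξ : EuclideanSpace ℝ (Fin 3) × EuclideanSpace ℝ (Fin 3) × EuclideanSpace ℝ (Fin 3) → ℝ, Continuous Ξ →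 (∀ q, 0 ≤ Ξ q) → (∃ C : ℝ, ∀ q, Ξ q ≤ C) → ∀ η δ : ℝ, 0 < η → 0 < δ → ∃ r₀ : ℝ, 0 < r₀ ∧ ∀ r : ℝ, 0 < r → r < r₀ → ∀ A : ℝ, 0 < A → ∀ b : ℝ, 1 / 3 ≤ b → b ≤ 1 → ∃ N₀ : ℕ, ∀ N : ℕ, N₀ ≤ N → let ε := Literature.MathematicalPhysics.KineticTheory.hsDiameter σ N; let G := Literature.Analysis.FluidPDE.Torus.geometry (Fin 3); let γ := fun z (s : ℝ) => (Φ N).flow s z; let bx : UnitAddTorus (Fin 3) → UnitAddTorus (Fin 3) → ℝ := fun x y => 3 / (Real.pi * r ^ 3) * max (1 - Literature.Analysis.FluidPDE.Torus.euclidDist x y / r) 0; let Θ := fun (Ξ : EuclideanSpace ℝ (Fin 3) × EuclideanSpace ℝ (Fin 3) × EuclideanSpace ℝ (Fin 3) → ℝ) (v w : EuclideanSpace ℝ (Fin 3)) => ∫ ω : Metric.sphere (0 : EuclideanSpace ℝ (Fin 3)) 1, Ξ ((ω : EuclideanSpace ℝ (Fin 3)), v, w) * Literature.MathematicalPhysics.KineticTheory.hardSphereKernel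 (w, v) ω ∂Literature.MathematicalPhysics.KineticTheory.sphereMeasure; let B := fun Ξ z s (x₀ : UnitAddTorus (Fin 3)) => ∫ p, bx p.1.1 x₀ * bx p.2.1 x₀ * Θ Ξ p.1.2 p.2.2 ∂((Literature.Analysis.FluidPDE.empiricalMeasure (γ z s)).prod (Literature.Analysis.FluidPDE.empiricalMeasure (γ z s))); let SW := fun (z : Literature.Analysis.FluidPDE.Config (N + 1) (Fin 3) Literature.MathematicalPhysics.KineticTheory.T3) => lineSW ε (windowLenB A b N) τ (γ z) (fun u x y v w => χ (u, x) * Ξ (ε⁻¹ • G.sepVec x y, v, w)); Literature.MathematicalPhysics.KineticTheory.localGibbsLaw σ a₀ u₀ θ₀ N (Φ N) {z | SW z < g₃ * σ ^ 3 * (∫ s in Set.Icc (0 : ℝ) τ, ∫ x : UnitAddTorus (Fin 3), χ (s, x) * B Ξ z s x) - η} ≤ ENNReal.ofReal δ := by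
  sorry


/-! ## §7½ THE ENTROPY TRANSFER (lead c4): a second composition — the crux modulo ONE statement about GLOBAL EQUILIBRIUM dynamics

RESHAPE (continuation lead c4, prover-line-stmt-AtomisticToContinuum-13080-c4-0, 2026-08-16).  The two open leaves S7a, S7b
above are statements about the LAW OF THE NON-EQUILIBRIUM FLOW at macroscopic times `kΔ ≤ τ` (one-sided local-equilibrium
propagation; crux-sized — gens 0–1, c1–c3, Disproof §6).  The relative-entropy method cannot reach them ONE TIME AT A TIME
(BN1: at a single time the static deficit event costs only `e^{-cN}` under the invariant law with `c` INDEPENDENT of `r` —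
velocity-sorted sub-`r` lamellae, Sanov cost), but it CAN be aimed at the crux's own TIME-INTEGRATED event, because the crux
files `∀ η δ ∃ r₀`: a deficit of marked collisions that persists over the support of `χ` needs sub-`r` velocity segregation
MAINTAINED against thermal dispersion for a macroscopic time, i.e. streams that are cold (`√θ ≲ r/τ`, Gibbs cost
`≍ N log(τ/r)`) or fast (`|v| ≳ ℓ_χ/r`, cost `≍ N/r²`) — a cost per particle that DIVERGES as `r → 0` (honest chaotic
under-counting of the `≍ N^{4/3}σ²τ` collision events costs `≍ N^{4/3}`; dense pockets raise `K/B` to `Y(φ) ≥ 1`;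
codimension-one structures (shocks) carry B-mass `O(r)`, absorbed by `η`).  Hence — went the cycle-1 heuristic, CORRECTED in §7¾ (hydrodynamic r-scale shear is a persistent deficit witness of `r`-INDEPENDENT linear
cost, so for the FILED crux the bound below is believed FALSE; it survives for the restatements of §7¾/§7⅞) — the conjectured EQUILIBRIUM
large-deviation bound is super-exponential at the speed `N` of the entropy budget `H(LG_N ‖ G_N) ≤ A(profiles)·(N+1)` (TREE theorem:
`LambertianContactSwapSwapGapGibbsDomination.exists_localGibbsLaw_dominated`, `G_N = localGibbsLaw σ 1 0 1` the standard
homogeneous Gibbs law, invariant under every hard-sphere flow), and the entropy inequality for events (TREE theorem: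
`Literature.Probability.Divergences.toReal_measure_le_of_klDiv_le`, Kipnis–Landim App. 1 Prop. 8.2) transfers it to EVERY
continuous local Gibbs datum: `LG_N(E) ≤ (log 2 + A(N+1))/(L(N+1)) ≤ δ` once `L := (log 2 + A + 1)/δ` and `r < r₀(L)`.

* NEW REGISTERED STUB `stub_eqSuperExpDeficit` (the lead's; OPEN): `∃ g₀ ∃ σ₀ ∀ σ<σ₀ ∀ Φ τ χ Ξ η ∀ L ∃ r₀ ∀ r<r₀ ∃ N₀ ∀ N≥N₀:
  G_N(E_N) ≤ exp(−L(N+1))`, `E_N` = the crux's event VERBATIM (same `let`-chain) under the invariant law.  A statement about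
  global equilibrium dynamics only; it sharpens rung 0 (`G_N(E_N) → 0`, c3, `rateFloorRung0_holds`) from "in probability" to
  "super-exponentially in `N`, at a rate unbounded as `r → 0`".  Heuristic rate: `N · min{c log(τ/r), c′N^{1/3}}`.
* `EntropyClassRateFloor` (def): the crux's conclusion for EVERY initial probability law `μ_N` with `KL(μ_N ‖ G_N) ≤ K(N+1)`.
  `entropyClassRateFloor_of_eqSuperExpDeficit` (PROVED, entropy inequality + measurable hull) and
  `rateFloor_of_entropyClassRateFloor` (PROVED, the tree's entropy budget of local Gibbs data) give the NEW FIRST COMPOSITION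
  `rateFloor_of_eqSuperExpDeficit : stub_eqSuperExpDeficit → RateFloor`.
* NEW REGISTERED STUB S12 `stub_measure_le_exp_of_entropyClass` (delegated; provable now, Donsker–Varadhan duality by
  conditioning on a measurable hull, tree pattern `Literature.Probability.Entropy.EntropyMethodNecessity`), from which
  `eqSuperExpDeficit_of_entropyClass : EntropyClassRateFloor → stub_eqSuperExpDeficit` is PROVED — the new stub S11 is EXACTLY
  what any entropy-class proof of the crux must establish, no more.
The gen-1 composition through S7a, S7b (§8) is kept as the second composition; S7a, S7b stay registered (promotable targets).
-/

/-- **S11 · SUPER-EXPONENTIAL EQUILIBRIUM DEFICIT BOUND** (`stub_eqSuperExpDeficit`; the lead's — HEURISTICALLY REFUTED in the same cycle,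
see §7¾: the r-scale laminar shear witness gives the `r`-UNIFORM rate bound `≲ 5N/g₀²`; kept registered as the record, the live
statements are the repairs `EqSuperExpDeficitFlat` / kinetic-scale mollification of §7¾).  Under the standard homogeneous canonical Gibbs law `G_N = localGibbsLaw σ 1 0 1 N (Φ N)` (invariant
under the hard-sphere flow), the crux's deficit event `E_N = {K_N[χΞ] < g₀σ³∫₀^τ∫χB^Ξ_r − η}` has probability at most
`exp(−L(N+1))` for EVERY `L`, once `r < r₀(L)` and `N ≥ N₀`: the equilibrium large-deviation cost of a time-integrated
collision deficit relative to the `r`-mollified ideal rate grows without bound per particle as `r → 0` (persistent sub-`r`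
segregation must be cold or fast; see the §7½ header).  Why it might fail: an `e^{-O(N)}`-probable family of equilibrium
initial data whose DETERMINISTIC evolution keeps two velocity classes interleaved below scale `r` without mutual collisions
for a macroscopic time at a cost per particle bounded INDEPENDENTLY of `r` (none found: lamellae/columns need
`θ_⊥ ≲ (r/τ)²`, circulating jets need `|v| ≳ ℓ/r`, clusters need internal coldness `≲ N^{-2/3}`, shock foams decay in time
`O(spacing)`); or a failure of concentration BELOW speed `N·ω(1)` of the honest collision count (ruled out heuristically:
`≍ N^{4/3}` nearly independent collision events).  Leans on (as tools, all landed): the sure transfer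
`K ≥ S_W − (ε/n)M·Bursts` (S6a/S6d/S8/S10), flow invariance of `G_N` (`map_flow_localGibbsLaw_const`), the rung-0 statics
(c2/c3 chain); what is missing is a DYNAMICAL decorrelation input for the deterministic equilibrium flow at super-exponential
precision (persistence penalty) — research-level, but a statement about ONE explicit invariant measure. [size XL] -/
def Stubs.stub_eqSuperExpDeficit : Prop :=
  ∃ g₀ : ℝ, 0 < g₀ ∧ ∃ σ₀ : ℝ, 0 < σ₀ ∧ ∀ σ : ℝ, 0 < σ → σ < σ₀ → ∀ Φ : (N : ℕ) → Literature.Analysis.FluidPDE.HardSphereFlow (Literature.Analysis.FluidPDE.Torus.geometry (Fin 3)) (Literature.MathematicalPhysics.KineticTheory.hsDiameter σ N) (N + 1), ∀ τ : ℝ, 0 < τ → ∀ χ : ℝ × UnitAddTorus (Fin 3) → ℝ, Continuous χ → (∀ p, 0 ≤ χ p) → ∀ Ξ : EuclideanSpace ℝ (Fin 3) × EuclideanSpace ℝ (Fin 3) × EuclideanSpace ℝ (Fin 3) → ℝ, Continuous Ξ → (∀ q, 0 ≤ Ξ q) → (∃ C : ℝ, ∀ q, Ξ q ≤ C) → ∀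 η : ℝ, 0 < η → ∀ L : ℝ, ∃ r₀ : ℝ, 0 < r₀ ∧ ∀ r : ℝ, 0 < r → r < r₀ → ∃ N₀ : ℕ, ∀ N : ℕ, N₀ ≤ N → let ε := Literature.MathematicalPhysics.KineticTheory.hsDiameter σ N; let G := Literature.Analysis.FluidPDE.Torus.geometry (Fin 3); let γ := fun z (s : ℝ) => (Φ N).flow s z; let bx : UnitAddTorus (Fin 3) → UnitAddTorus (Fin 3) → ℝ := fun x y => 3 / (Real.pi * r ^ 3) * max (1 - Literature.Analysis.FluidPDE.Torus.euclidDist x y / r) 0; let Θ := fun (Ξ : EuclideanSpace ℝ (Fin 3) × EuclideanSpace ℝ (Fin 3) × EuclideanSpace ℝ (Fin 3) → ℝ) (v w : EuclideanSpace ℝ (Fin 3)) => ∫ ω : Metric.sphere (0 : EuclideanSpace ℝ (Fin 3)) 1, Ξ ((ω : EuclideanSpace ℝ (Fin 3)), v, w) * Literature.MathematicalPhysics.KineticTheory.hardSphereKernel (w, v) ω ∂Literature.MathematicalPhysics.KineticTheory.sphereMeasure; let B := fun Ξ z s (x₀ : UnitAddTorus (Fin 3)) => ∫ p, bx p.1.1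 x₀ * bx p.2.1 x₀ * Θ Ξ p.1.2 p.2.2 ∂((Literature.Analysis.FluidPDE.empiricalMeasure (γ z s)).prod (Literature.Analysis.FluidPDE.empiricalMeasure (γ z s))); let pv := fun z s (i j : Fin (N + 1)) => Literature.Analysis.FluidPDE.reflectVel (G.sepVec (γ z s i).1 (γ z s j).1) ((γ z s i).2, (γ z s j).2); let Kc := fun (Fn : Literature.Analysis.FluidPDE.Config (N + 1) (Fin 3) Literature.MathematicalPhysics.KineticTheory.T3 → ℝ → Fin (N + 1) → Fin (N + 1) → ℝ) z => ε / (N + 1 : ℝ) * ∑ᶠ (s : ℝ) (_ : s ∈ Literature.Analysis.FluidPDE.collisionTimes G ε (γ z) ∩ Set.Icc 0 τ), ∑ i : Fin (N + 1), ∑ j : Fin (N + 1), (if i ≠ j ∧ ‖G.sepVec (γ z s i).1 (γ z s j).1‖ = ε then Fn z s i j else 0); Literature.MathematicalPhysics.KineticTheory.localGibbsLaw σ (fun _ => (1 : ℝ)) (fun _ => (0 : EuclideanSpace ℝ (Fin 3))) (fun _ => (1 : ℝ)) N (Φ N) {z | Kc (fun z s i j => χ (s, (γ z s i).1) * Ξ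 (ε⁻¹ • G.sepVec (γ z s i).1 (γ z s j).1, (pv z s i j).1, (pv z s i j).2)) z < g₀ * σ ^ 3 * (∫ s in Set.Icc (0 : ℝ) τ, ∫ x : UnitAddTorus (Fin 3), χ (s, x) * B Ξ z s x) - η} ≤ ENNReal.ofReal (Real.exp (-(L * ((N : ℝ) + 1))))

/-- Registered stub S11 (`Stubs.stub_eqSuperExpDeficit`, verbatim): the `sorry` to be discharged. -/
theorem stub_eqSuperExpDeficit :
    ∃ g₀ : ℝ, 0 < g₀ ∧ ∃ σ₀ : ℝ, 0 < σ₀ ∧ ∀ σ : ℝ, 0 < σ → σ < σ₀ → ∀ Φ : (N : ℕ) → Literature.Analysis.FluidPDE.HardSphereFlow (Literature.Analysis.FluidPDE.Torus.geometry (Fin 3)) (Literature.MathematicalPhysics.KineticTheory.hsDiameter σ N) (N + 1), ∀ τ : ℝ, 0 < τ → ∀ χ : ℝ × UnitAddTorus (Fin 3) → ℝ, Continuous χ → (∀ p, 0 ≤ χ p) → ∀ Ξ : EuclideanSpace ℝ (Fin 3) × EuclideanSpace ℝ (Fin 3) × EuclideanSpace ℝ (Fin 3) → ℝ, Continuous Ξ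 → (∀ q, 0 ≤ Ξ q) → (∃ C : ℝ, ∀ q, Ξ q ≤ C) → ∀ η : ℝ, 0 < η → ∀ L : ℝ, ∃ r₀ : ℝ, 0 < r₀ ∧ ∀ r : ℝ, 0 < r → r < r₀ → ∃ N₀ : ℕ, ∀ N : ℕ, N₀ ≤ N → let ε := Literature.MathematicalPhysics.KineticTheory.hsDiameter σ N; let G := Literature.Analysis.FluidPDE.Torus.geometry (Fin 3); let γ := fun z (s : ℝ) => (Φ N).flow s z; let bx : UnitAddTorus (Fin 3) → UnitAddTorus (Fin 3) → ℝ := fun x y => 3 / (Real.pi * r ^ 3) * max (1 - Literature.Analysis.FluidPDE.Torus.euclidDist x y / r) 0; let Θ := fun (Ξ : EuclideanSpace ℝ (Fin 3) × EuclideanSpace ℝ (Fin 3) × EuclideanSpace ℝ (Fin 3) → ℝ) (v w : EuclideanSpace ℝ (Fin 3)) => ∫ ω : Metric.sphere (0 : EuclideanSpace ℝ (Fin 3)) 1, Ξ ((ω : EuclideanSpace ℝ (Fin 3)), v, w) * Literature.MathematicalPhysics.KineticTheory.hardSphereKernel (w, v) ω ∂Literature.MathematicalPhysics.KineticTheory.sphereMeasure;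 let B := fun Ξ z s (x₀ : UnitAddTorus (Fin 3)) => ∫ p, bx p.1.1 x₀ * bx p.2.1 x₀ * Θ Ξ p.1.2 p.2.2 ∂((Literature.Analysis.FluidPDE.empiricalMeasure (γ z s)).prod (Literature.Analysis.FluidPDE.empiricalMeasure (γ z s))); let pv := fun z s (i j : Fin (N + 1)) => Literature.Analysis.FluidPDE.reflectVel (G.sepVec (γ z s i).1 (γ z s j).1) ((γ z s i).2, (γ z s j).2); let Kc := fun (Fn : Literature.Analysis.FluidPDE.Config (N + 1) (Fin 3) Literature.MathematicalPhysics.KineticTheory.T3 → ℝ → Fin (N + 1) → Fin (N + 1) → ℝ) z => ε / (N + 1 : ℝ) * ∑ᶠ (s : ℝ) (_ : s ∈ Literature.Analysis.FluidPDE.collisionTimes G ε (γ z) ∩ Set.Icc 0 τ), ∑ i : Fin (N + 1), ∑ j : Fin (N + 1), (if i ≠ j ∧ ‖G.sepVec (γ z s i).1 (γ z s j).1‖ = ε then Fn z s i j else 0); Literature.MathematicalPhysics.KineticTheory.localGibbsLaw σ (fun _ => (1 : ℝ)) (fun _ => (0 : EuclideanSpace ℝ (Fin 3))) (fun _ =>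 (1 : ℝ)) N (Φ N) {z | Kc (fun z s i j => χ (s, (γ z s i).1) * Ξ (ε⁻¹ • G.sepVec (γ z s i).1 (γ z s j).1, (pv z s i j).1, (pv z s i j).2)) z < g₀ * σ ^ 3 * (∫ s in Set.Icc (0 : ℝ) τ, ∫ x : UnitAddTorus (Fin 3), χ (s, x) * B Ξ z s x) - η} ≤ ENNReal.ofReal (Real.exp (-(L * ((N : ℝ) + 1)))) := by
  sorry

/-- **The crux for the ENTROPY CLASS of initial laws** (`EntropyClassRateFloor`): the crux's conclusion holds, with
`r₀ = r₀(K, η, δ, …)`, for EVERY initial probability law `μ_N` on the `(N+1)`-particle phase space whose relative entropy with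
respect to the standard homogeneous Gibbs law is at most `K(N+1)` — in particular (tree: `exists_localGibbsLaw_dominated`)
for every continuous local Gibbs datum, which is how it implies `RateFloor` (`rateFloor_of_entropyClassRateFloor`). [folklore] -/
def EntropyClassRateFloor : Prop :=
  ∃ g₀ : ℝ, 0 < g₀ ∧ ∃ σ₀ : ℝ, 0 < σ₀ ∧ ∀ σ : ℝ, 0 < σ → σ < σ₀ → ∀ Φ : (N : ℕ) → Literature.Analysis.FluidPDE.HardSphereFlow (Literature.Analysis.FluidPDE.Torus.geometry (Fin 3)) (Literature.MathematicalPhysics.KineticTheory.hsDiameter σ N) (N + 1), ∀ τ : ℝ, 0 < τ → ∀ χ : ℝ × UnitAddTorus (Fin 3) → ℝ, Continuous χ → (∀ p, 0 ≤ χ p) → ∀ Ξ : EuclideanSpace ℝ (Fin 3) × EuclideanSpace ℝ (Fin 3) × EuclideanSpace ℝ (Fin 3) → ℝ, Continuous Ξ → (∀ q, 0 ≤ Ξ q) → (∃ C : ℝ, ∀ q, Ξ q ≤ C) → ∀ K η δ : ℝ, 0 < η → 0 < δ → ∃ r₀ : ℝ, 0 < r₀ ∧ ∀ r : ℝ, 0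 < r → r < r₀ → ∃ N₀ : ℕ, ∀ N : ℕ, N₀ ≤ N → ∀ μ : MeasureTheory.Measure (Literature.Analysis.FluidPDE.Config (N + 1) (Fin 3) Literature.MathematicalPhysics.KineticTheory.T3), MeasureTheory.IsProbabilityMeasure μ → InformationTheory.klDiv μ (Literature.MathematicalPhysics.KineticTheory.localGibbsLaw σ (fun _ => (1 : ℝ)) (fun _ => (0 : EuclideanSpace ℝ (Fin 3))) (fun _ => (1 : ℝ)) N (Φ N)) ≤ ENNReal.ofReal (K * ((N : ℝ) + 1)) → let ε := Literature.MathematicalPhysics.KineticTheory.hsDiameter σ N; let G := Literature.Analysis.FluidPDE.Torus.geometry (Fin 3); let γ := fun z (s : ℝ) => (Φ N).flow s z; let bx : UnitAddTorus (Fin 3) → UnitAddTorus (Fin 3) → ℝ := fun x y => 3 / (Real.pi * r ^ 3) * max (1 - Literature.Analysis.FluidPDE.Torus.euclidDist x y / r) 0; let Θ := fun (Ξ : EuclideanSpace ℝ (Fin 3) × EuclideanSpace ℝ (Fin 3) × EuclideanSpace ℝ (Fin 3) → ℝ) (v w : EuclideanSpace ℝ (Fin 3)) => ∫ ω : Metric.sphere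 (0 : EuclideanSpace ℝ (Fin 3)) 1, Ξ ((ω : EuclideanSpace ℝ (Fin 3)), v, w) * Literature.MathematicalPhysics.KineticTheory.hardSphereKernel (w, v) ω ∂Literature.MathematicalPhysics.KineticTheory.sphereMeasure; let B := fun Ξ z s (x₀ : UnitAddTorus (Fin 3)) => ∫ p, bx p.1.1 x₀ * bx p.2.1 x₀ * Θ Ξ p.1.2 p.2.2 ∂((Literature.Analysis.FluidPDE.empiricalMeasure (γ z s)).prod (Literature.Analysis.FluidPDE.empiricalMeasure (γ z s))); let pv := fun z s (i j : Fin (N + 1)) => Literature.Analysis.FluidPDE.reflectVel (G.sepVec (γ z s i).1 (γ z s j).1) ((γ z s i).2, (γ z s j).2); let Kc := fun (Fn : Literature.Analysis.FluidPDE.Config (N + 1) (Fin 3) Literature.MathematicalPhysics.KineticTheory.T3 → ℝ → Fin (N + 1) → Fin (N + 1) → ℝ) z => ε / (N + 1 : ℝ) * ∑ᶠ (s : ℝ) (_ : s ∈ Literature.Analysis.FluidPDE.collisionTimes G ε (γ z) ∩ Set.Icc 0 τ), ∑ i : Fin (N + 1), ∑ j : Fin (N + 1), (if i ≠ j ∧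 ‖G.sepVec (γ z s i).1 (γ z s j).1‖ = ε then Fn z s i j else 0); μ {z | Kc (fun z s i j => χ (s, (γ z s i).1) * Ξ (ε⁻¹ • G.sepVec (γ z s i).1 (γ z s j).1, (pv z s i j).1, (pv z s i j).2)) z < g₀ * σ ^ 3 * (∫ s in Set.Icc (0 : ℝ) τ, ∫ x : UnitAddTorus (Fin 3), χ (s, x) * B Ξ z s x) - η} ≤ ENNReal.ofReal δ

/-- Arithmetic of the entropy transfer: with `L = (log 2 + K + 1)/δ`, `(log 2 + K(N+1))/(L(N+1)) ≤ δ`. [folklore] -/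
theorem entropy_transfer_arith {K δ n : ℝ} (hK : 0 ≤ K) (hδ : 0 < δ) (hn : 1 ≤ n) :
    (Real.log 2 + K * n) / ((Real.log 2 + K + 1) / δ * n) ≤ δ := by
  have hlog : 0 < Real.log 2 := Real.log_pos (by norm_num)
  have hL : 0 < (Real.log 2 + K + 1) / δ := by positivity
  rw [div_le_iff₀ (by positivity)]
  have h1 : δ * ((Real.log 2 + K + 1) / δ * n) = (Real.log 2 + K + 1) * n := by
    field_simp
  rw [h1]
  nlinarith

/-- **Entropy inequality for events, transferred through a measurable hull** (no measurability of the event is needed):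
if `P(E) ≤ e^{-G}` for the reference probability law `P` and `KL(Q ‖ P) ≤ H`, then `Q(E) ≤ (log 2 + H)/G` — apply the
tree's `toReal_measure_le_of_klDiv_le` (Kipnis–Landim App. 1 Prop. 8.2) to `toMeasurable P E ⊇ E`, which has the same
`P`-measure. [cite: KipnisLandim1999, Appendix 1 Prop. 8.2] -/
theorem measure_le_of_klDiv_le_hull {α : Type*} [MeasurableSpace α] (Q P : MeasureTheory.Measure α)
    [MeasureTheory.IsProbabilityMeasure Q] [MeasureTheory.IsProbabilityMeasure P] (E : Set α) {G H : ℝ}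
    (hG : 0 < G) (hH : 0 ≤ H) (hP : P E ≤ ENNReal.ofReal (Real.exp (-G)))
    (hKL : InformationTheory.klDiv Q P ≤ ENNReal.ofReal H) :
    Q E ≤ ENNReal.ofReal ((Real.log 2 + H) / G) := by
  set E' := MeasureTheory.toMeasurable P E with hE'
  have hPE' : P E' ≤ ENNReal.ofReal (Real.exp (-G)) := by
    rw [hE', MeasureTheory.measure_toMeasurable]; exact hP
  have h := Literature.Probability.Divergences.toReal_measure_le_of_klDiv_le Q P
    (MeasureTheory.measurableSet_toMeasurable P E) hG hH hPE' hKL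
  calc Q E ≤ Q E' := MeasureTheory.measure_mono (MeasureTheory.subset_toMeasurable P E)
    _ = ENNReal.ofReal (Q E').toReal := (ENNReal.ofReal_toReal (MeasureTheory.measure_ne_top Q E')).symm
    _ ≤ ENNReal.ofReal ((Real.log 2 + H) / G) := ENNReal.ofReal_le_ofReal h

/-- **`EntropyClassRateFloor` from the super-exponential equilibrium bound** (PROVED): given the budget `K` and `δ`, take
`L := (log 2 + K + 1)/δ` in `stub_eqSuperExpDeficit` and apply the entropy inequality for events through a measurable hull
(`measure_le_of_klDiv_le_hull`). [folklore] -/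
theorem entropyClassRateFloor_of_eqSuperExpDeficit (h : Stubs.stub_eqSuperExpDeficit) : EntropyClassRateFloor := by
  obtain ⟨g₀, hg₀, σ₀, hσ₀, h⟩ := h
  refine ⟨g₀, hg₀, min σ₀ 2⁻¹, lt_min hσ₀ (by norm_num), ?_⟩
  intro σ hσ hσlt' Φ τ hτ χ hχc hχ0 Ξ hΞc hΞ0 hΞC K η δ hη hδ
  have hσlt : σ < σ₀ := hσlt'.trans_le (min_le_left _ _)
  have hσ2 : σ ≤ 1 / 2 := by
    have := hσlt'.trans_le (min_le_right σ₀ 2⁻¹)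
    rw [one_div]; exact this.le
  set K' : ℝ := max K 0 with hK'
  have hK'0 : 0 ≤ K' := le_max_right _ _
  set L : ℝ := (Real.log 2 + K' + 1) / δ with hL
  have hlog : 0 < Real.log 2 := Real.log_pos (by norm_num)
  have hLpos : 0 < L := by positivity
  obtain ⟨r₀, hr₀, h⟩ := h σ hσ hσlt Φ τ hτ χ hχc hχ0 Ξ hΞc hΞ0 hΞC η hη L
  refine ⟨r₀, hr₀, fun r hr hrlt => ?_⟩
  obtain ⟨N₀, hN⟩ := h r hr hrlt
  refine ⟨N₀, fun N hNN μ hμ hKL => ?_⟩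
  have h1 := hN N hNN
  intro ε G γ bx Θ B pv Kc
  haveI : MeasureTheory.IsProbabilityMeasure μ := hμ
  haveI : MeasureTheory.IsProbabilityMeasure (Literature.MathematicalPhysics.KineticTheory.localGibbsLaw σ
      (fun _ => (1 : ℝ)) (fun _ => (0 : EuclideanSpace ℝ (Fin 3))) (fun _ => (1 : ℝ)) N (Φ N)) :=
    isProbabilityMeasure_localGibbsLaw (a₀ := fun _ => (1 : ℝ)) (θ₀ := fun _ => (1 : ℝ))
      (u₀ := fun _ => (0 : EuclideanSpace ℝ (Fin 3))) continuous_const continuous_const continuous_const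
      (fun _ => one_pos) (fun _ => one_pos) hσ2 N (Φ N)
  have hn1 : (1 : ℝ) ≤ (N : ℝ) + 1 := by
    have : (0 : ℝ) ≤ (N : ℝ) := Nat.cast_nonneg N
    linarith
  have hGpos : 0 < L * ((N : ℝ) + 1) := by positivity
  have hKL' : InformationTheory.klDiv μ (Literature.MathematicalPhysics.KineticTheory.localGibbsLaw σ
      (fun _ => (1 : ℝ)) (fun _ => (0 : EuclideanSpace ℝ (Fin 3))) (fun _ => (1 : ℝ)) N (Φ N)) ≤
      ENNReal.ofReal (K' * ((N : ℝ) + 1)) :=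
    hKL.trans (ENNReal.ofReal_le_ofReal (mul_le_mul_of_nonneg_right (le_max_left _ _) (by positivity)))
  have e1 : Literature.MathematicalPhysics.KineticTheory.localGibbsLaw σ (fun _ => (1 : ℝ))
      (fun _ => (0 : EuclideanSpace ℝ (Fin 3))) (fun _ => (1 : ℝ)) N (Φ N)
      {z | Kc (fun z s i j => χ (s, (γ z s i).1) *
        Ξ (ε⁻¹ • G.sepVec (γ z s i).1 (γ z s j).1, (pv z s i j).1, (pv z s i j).2)) z <
        g₀ * σ ^ 3 * (∫ s in Set.Icc (0 : ℝ) τ, ∫ x : UnitAddTorus (Fin 3), χ (s, x) * B Ξ z s x) - η} ≤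
      ENNReal.ofReal (Real.exp (-(L * ((N : ℝ) + 1)))) := h1
  have h2 := measure_le_of_klDiv_le_hull μ _ _ hGpos (by positivity : (0 : ℝ) ≤ K' * ((N : ℝ) + 1)) e1 hKL'
  refine h2.trans (ENNReal.ofReal_le_ofReal ?_)
  rw [hL]
  exact entropy_transfer_arith hK'0 hδ hn1

/-- **`RateFloor` from `EntropyClassRateFloor`** (PROVED): a continuous local Gibbs datum has relative entropy
`≤ A(profiles, σ)·(N+1)` with respect to the standard homogeneous Gibbs law (tree: `exists_localGibbsLaw_dominated`, the
pinned entropy budget `KL(P_N ‖ G_N) ≤ A(N+1)`), so it belongs to the entropy class with `K := A`; `σ₀ := min σ₀ ½`.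
[cite: KipnisLandim1999, Ch. 6 §1] -/
theorem rateFloor_of_entropyClassRateFloor (h : EntropyClassRateFloor) : RateFloor := by
  obtain ⟨g₀, hg₀, σ₁, hσ₁, h⟩ := h
  refine ⟨g₀, hg₀, fun a₀ θ₀ u₀ ha hθ hu ha0 hθ0 => ?_⟩
  refine ⟨min σ₁ 2⁻¹, lt_min hσ₁ (by norm_num), ?_⟩
  intro σ hσ hσlt Φ τ hτ χ hχc hχ0 Ξ hΞc hΞ0 hΞC η δ hη hδ
  have hσ₁' : σ < σ₁ := hσlt.trans_le (min_le_left _ _)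
  have hσ2 : σ ≤ 1 / 2 := by
    have := hσlt.trans_le (min_le_right σ₁ 2⁻¹)
    rw [one_div]; exact this.le
  obtain ⟨A, b, hA, hb, hdom⟩ :=
    Summit.AtomisticToContinuum.HydrodynamicLimit.Theorems.LambertianContactSwapSwapGapGibbsDomination.exists_localGibbsLaw_dominated
      ha hθ hu ha0 hθ0 hσ2
  obtain ⟨r₀, hr₀, h⟩ := h σ hσ hσ₁' Φ τ hτ χ hχc hχ0 Ξ hΞc hΞ0 hΞC A η δ hη hδ
  refine ⟨r₀, hr₀, fun r hr hrlt => ?_⟩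
  obtain ⟨N₀, hN⟩ := h r hr hrlt
  refine ⟨N₀, fun N hNN => ?_⟩
  have hP : MeasureTheory.IsProbabilityMeasure (Literature.MathematicalPhysics.KineticTheory.localGibbsLaw σ a₀ u₀ θ₀ N (Φ N)) :=
    isProbabilityMeasure_localGibbsLaw ha hθ hu ha0 hθ0 hσ2 N (Φ N)
  obtain ⟨-, -, hKL, -, -⟩ := hdom N (Φ N)
  exact hN N hNN (Literature.MathematicalPhysics.KineticTheory.localGibbsLaw σ a₀ u₀ θ₀ N (Φ N)) hP hKL

/-- **`RateFloor` from the super-exponential equilibrium bound — THE SKELETON THEOREM of the entropy transfer** (c4; the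
first theorem of the file concluding the crux; hypothesis = the ONE open registered stub `stub_eqSuperExpDeficit` by name):
`rateFloor_of_entropyClassRateFloor ∘ entropyClassRateFloor_of_eqSuperExpDeficit`. [folklore] -/
theorem rateFloor_of_eqSuperExpDeficit (h : Stubs.stub_eqSuperExpDeficit) : RateFloor :=
  rateFloor_of_entropyClassRateFloor (entropyClassRateFloor_of_eqSuperExpDeficit h)

/-- **S12 · THE ENTROPY METHOD NEEDS A LARGE-DEVIATION BOUND AT THE SPEED OF ITS BUDGET — hull form**
(`stub_measure_le_exp_of_entropyClass`; delegated, provable now).  For a probability law `ν`, ANY set `E` (no measurability)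
and reals `K`, `δ < 1`: if every probability law `μ` with `KL(μ ‖ ν) ≤ K` gives `E` mass `≤ δ`, then `ν(E) ≤ e^{-K}`.
Donsker–Varadhan duality by conditioning: `ν` conditioned on the measurable hull `E' = toMeasurable ν E` is a probability law
of entropy `−log ν(E') = −log ν(E)` giving `E` full (outer) mass (`cond_apply` needs only `E'` measurable, and
`ν(E' ∩ E) = ν(E) = ν(E')`).  Tree pattern: `Literature.Probability.Entropy.exists_klDiv_le_and_apply_eq_one`,
`measureReal_lt_exp_neg_of_forall_klDiv_le`, `toReal_klDiv_cond`, `klDiv_cond_ne_top` (EntropyMethodNecessity.lean).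
Why it might fail: no. [size S–M] -/
def Stubs.stub_measure_le_exp_of_entropyClass : Prop :=
  ∀ (α : Type) [MeasurableSpace α] (ν : MeasureTheory.Measure α) [MeasureTheory.IsProbabilityMeasure ν] (E : Set α) (K δ : ℝ), δ < 1 → (∀ μ : MeasureTheory.Measure α, MeasureTheory.IsProbabilityMeasure μ → InformationTheory.klDiv μ ν ≤ ENNReal.ofReal K → μ E ≤ ENNReal.ofReal δ) → ν E ≤ ENNReal.ofReal (Real.exp (-K))

/-- Entropy of the law conditioned on a measurable event of reference mass at least `e^{−K}` is at most `K`: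
`KL(ν(· | A) ‖ ν) = −log ν(A) ≤ K` (copy of the landed `Theorems.RateFloorEntropyNecessity.klDiv_cond_le_ofReal`, p125051; inlined while the
farm has not built that module). [cite: KipnisLandim1999, Appendix 1 §8] -/
theorem klDiv_cond_le_ofReal {α : Type*} [MeasurableSpace α] (ν : MeasureTheory.Measure α) [MeasureTheory.IsProbabilityMeasure ν]
    {A : Set α} (hA : MeasurableSet A) {K : ℝ} (hK : Real.exp (-K) ≤ ν.real A) :
    InformationTheory.klDiv (ProbabilityTheory.cond ν A) ν ≤ ENNReal.ofReal K := by
  have hq : 0 < ν.real A := lt_of_lt_of_le (Real.exp_pos _) hK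
  have hA0 : ν A ≠ 0 := by
    intro h; simp [MeasureTheory.measureReal_def, h] at hq
  have hlog := Real.log_le_log (Real.exp_pos _) hK
  rw [Real.log_exp] at hlog
  have hle : Real.log (ν.real A) ≤ 0 := Real.log_nonpos hq.le MeasureTheory.measureReal_le_one
  rw [ENNReal.le_ofReal_iff_toReal_le (Literature.Probability.Entropy.klDiv_cond_ne_top ν hA hA0) (by linarith),
    Literature.Probability.Entropy.toReal_klDiv_cond ν hA hA0]
  linarith

/-- The law conditioned on the measurable hull of a set `E` of nonzero (outer) mass gives `E` full mass (copy of the landed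
`Theorems.RateFloorEntropyNecessity.cond_toMeasurable_apply_self`, p125051). [folklore] -/
theorem cond_toMeasurable_apply_self {α : Type*} [MeasurableSpace α] (ν : MeasureTheory.Measure α) [MeasureTheory.IsFiniteMeasure ν]
    {E : Set α} (hE0 : ν E ≠ 0) : ProbabilityTheory.cond ν (MeasureTheory.toMeasurable ν E) E = 1 := by
  rw [ProbabilityTheory.cond_apply (MeasureTheory.measurableSet_toMeasurable ν E) ν E,
    Set.inter_eq_right.2 (MeasureTheory.subset_toMeasurable ν E), MeasureTheory.measure_toMeasurable E]
  exact ENNReal.inv_mul_cancel hE0 (MeasureTheory.measure_ne_top ν E)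

/-- Registered stub S12 (`Stubs.stub_measure_le_exp_of_entropyClass`, verbatim): CLOSED — landed by the c4 wave-1 worker as
`Theorems.RateFloorEntropyNecessity.stub_measure_le_exp_of_entropyClass` (file `Theorems/JParityClosureRateFloorEntropyNecessity.lean`,
p125051); proof inlined here (the check farm had not built the new module when this skeleton was published). -/
theorem stub_measure_le_exp_of_entropyClass :
    ∀ (α : Type) [MeasurableSpace α] (ν : MeasureTheory.Measure α) [MeasureTheory.IsProbabilityMeasure ν] (E : Set α) (K δ : ℝ), δ < 1 → (∀ μ : MeasureTheory.Measure α, MeasureTheory.IsProbabilityMeasure μ → InformationTheory.klDiv μ ν ≤ ENNReal.ofReal K → μ E ≤ ENNReal.ofReal δ) → ν E ≤ ENNReal.ofReal (Real.exp (-K)) := by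
  intro α _ ν _ E K δ hδ h
  by_contra hlt
  have hlt : ENNReal.ofReal (Real.exp (-K)) < ν E := not_le.mp hlt
  have hE0 : ν E ≠ 0 := (lt_of_le_of_lt bot_le hlt).ne'
  have hE'0 : ν (MeasureTheory.toMeasurable ν E) ≠ 0 := by rwa [MeasureTheory.measure_toMeasurable]
  have hK : Real.exp (-K) ≤ ν.real (MeasureTheory.toMeasurable ν E) := by
    rw [MeasureTheory.measureReal_def, MeasureTheory.measure_toMeasurable]
    exact ((ENNReal.ofReal_lt_iff_lt_toReal (Real.exp_pos _).le (MeasureTheory.measure_ne_top ν E)).1 hlt).le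
  haveI : MeasureTheory.IsProbabilityMeasure (ProbabilityTheory.cond ν (MeasureTheory.toMeasurable ν E)) :=
    ProbabilityTheory.cond_isProbabilityMeasure hE'0
  have h1 := h (ProbabilityTheory.cond ν (MeasureTheory.toMeasurable ν E)) inferInstance
    (klDiv_cond_le_ofReal ν (MeasureTheory.measurableSet_toMeasurable ν E) hK)
  rw [cond_toMeasurable_apply_self ν hE0] at h1
  exact absurd (lt_of_le_of_lt h1 (ENNReal.ofReal_lt_one.2 hδ)) (lt_irrefl 1)

/-- **NECESSITY OF S11 WITHIN THE ENTROPY CLASS** (PROVED from S12): `EntropyClassRateFloor → stub_eqSuperExpDeficit` — if the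
crux's event is rare (`≤ ½`) under EVERY initial law of relative entropy `≤ K(N+1)` w.r.t. the standard homogeneous Gibbs law,
then it has `G_N`-probability `≤ e^{-K(N+1)}`; bookkeeping `K := max L 0`, `δ := ½`.  So the new stub S11 is EXACTLY what
any entropy-class proof of the crux must establish, no more. [folklore] -/
theorem eqSuperExpDeficit_of_entropyClass (h12 : Stubs.stub_measure_le_exp_of_entropyClass)
    (h : EntropyClassRateFloor) : Stubs.stub_eqSuperExpDeficit := by
  obtain ⟨g₀, hg₀, σ₀, hσ₀, h⟩ := h
  refine ⟨g₀, hg₀, min σ₀ 2⁻¹, lt_min hσ₀ (by norm_num), ?_⟩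
  intro σ hσ hσlt' Φ τ hτ χ hχc hχ0 Ξ hΞc hΞ0 hΞC η hη L
  have hσlt : σ < σ₀ := hσlt'.trans_le (min_le_left _ _)
  have hσ2 : σ ≤ 1 / 2 := by
    have := hσlt'.trans_le (min_le_right σ₀ 2⁻¹)
    rw [one_div]; exact this.le
  set K : ℝ := max L 0 with hK
  obtain ⟨r₀, hr₀, h⟩ := h σ hσ hσlt Φ τ hτ χ hχc hχ0 Ξ hΞc hΞ0 hΞC K η (1 / 2) hη (by norm_num)
  refine ⟨r₀, hr₀, fun r hr hrlt => ?_⟩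
  obtain ⟨N₀, hN⟩ := h r hr hrlt
  refine ⟨N₀, fun N hNN => ?_⟩
  have h1 := hN N hNN
  intro ε G γ bx Θ B pv Kc
  haveI : MeasureTheory.IsProbabilityMeasure (Literature.MathematicalPhysics.KineticTheory.localGibbsLaw σ
      (fun _ => (1 : ℝ)) (fun _ => (0 : EuclideanSpace ℝ (Fin 3))) (fun _ => (1 : ℝ)) N (Φ N)) :=
    isProbabilityMeasure_localGibbsLaw (a₀ := fun _ => (1 : ℝ)) (θ₀ := fun _ => (1 : ℝ))
      (u₀ := fun _ => (0 : EuclideanSpace ℝ (Fin 3))) continuous_const continuous_const continuous_const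
      (fun _ => one_pos) (fun _ => one_pos) hσ2 N (Φ N)
  have e1 : ∀ μ : MeasureTheory.Measure (Literature.Analysis.FluidPDE.Config (N + 1) (Fin 3)
      Literature.MathematicalPhysics.KineticTheory.T3), MeasureTheory.IsProbabilityMeasure μ →
      InformationTheory.klDiv μ (Literature.MathematicalPhysics.KineticTheory.localGibbsLaw σ (fun _ => (1 : ℝ))
        (fun _ => (0 : EuclideanSpace ℝ (Fin 3))) (fun _ => (1 : ℝ)) N (Φ N)) ≤ ENNReal.ofReal (K * ((N : ℝ) + 1)) →
      μ {z | Kc (fun z s i j => χ (s, (γ z s i).1) *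
        Ξ (ε⁻¹ • G.sepVec (γ z s i).1 (γ z s j).1, (pv z s i j).1, (pv z s i j).2)) z <
        g₀ * σ ^ 3 * (∫ s in Set.Icc (0 : ℝ) τ, ∫ x : UnitAddTorus (Fin 3), χ (s, x) * B Ξ z s x) - η} ≤
      ENNReal.ofReal (1 / 2) := h1
  have h2 := h12 _ (Literature.MathematicalPhysics.KineticTheory.localGibbsLaw σ (fun _ => (1 : ℝ))
    (fun _ => (0 : EuclideanSpace ℝ (Fin 3))) (fun _ => (1 : ℝ)) N (Φ N)) _ (K * ((N : ℝ) + 1)) (1 / 2)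
    (by norm_num) e1
  refine h2.trans (ENNReal.ofReal_le_ofReal (Real.exp_le_exp.2 ?_))
  have hn : (0 : ℝ) ≤ (N : ℝ) + 1 := by positivity
  nlinarith [le_max_left L 0, mul_le_mul_of_nonneg_right (le_max_left L 0) hn]

/-! ## §7¾ (c4, same cycle) STATUS OF S11: HEURISTICALLY REFUTED for the filed crux — the entropy class is too large; the FLAT repair

THE r-SCALE LAMINAR SHEAR WITNESS (evidence `S11-entropy-class-analysis.md` on the item).  For the floor constant `g₀` and ANY `r` below
the offered `r₀`, the local Gibbs law `μ_N = localGibbsLaw σ 1 u_r 1` with the Kolmogorov shear `u_r(x) = U sin(πx₂/r)e₁`,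
`U ≍ 4Y/(√π c₁ g₀)` (Mach `≍ 1/g₀`), has (i) LINEAR entropy `KL(μ_N ‖ G_N) ≤ A(U)(N+1)`, `A(U) ≈ U²/4`, INDEPENDENT of `r`
(`exists_localGibbsLaw_dominated` depends on sup-norms only); (ii) a deficit at every time while laminar — at fixed `r`, `N → ∞` the gas is
in LOCAL equilibrium at the collision scale (`ℓ_mfp/r → 0`), so collisions are thermal (`K ≈ σ³Y∫χρ²·4√(θ/π)`) while `B_r` pairs particles
ACROSS the layers (`B_r ≈ ρ²πc₁U`): `K/(σ³∫χB_r) ≈ g₀`; (iii) persistence — a parallel shear is Euler-stationary, viscosity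
`≍ ℓ_mfp√θ → 0`, instabilities grow from thermal seeds `(ρr³N)^{-1/2}` and saturate only after `(2γ)⁻¹ln(ρr³N) → ∞`.  Hence
`μ_N(E_N) → 1`: `EntropyClassRateFloor` is FALSE, and by `entropyClassRateFloor_of_eqSuperExpDeficit` so is S11, with the explicit
`r`-UNIFORM rate bound `−(N+1)⁻¹log G_N(E_N(g₀,r)) ≲ 5/g₀²`.  (My §7½ heuristic "persistence costs log(τ/r)" priced COLLISIONLESS cold
lamellae; HYDRODYNAMIC warm shear is free of any `r`-dependence.)  CONSEQUENCE (line-independent): the filed crux is NOT an entropy-class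
statement — every proof must use, of smooth-profile evolutions, that NO O(1) KINETIC ENERGY sits in velocity variation at scale `r` on a
set of positive B-measure along the flow (energy-spectrum control = S7b's compactness content, now shown entropy-inaccessible).
S11 stays registered only as the record of this; the live entropy statements are the REPAIRS below (planner's call to restate):
(a) kinetic-scale mollification `R_N = λ(N+1)^{-1/3}` (shear at scale `R_N` has viscous lifetime `≍ λ²σ²(N+1)^{-1/3} → 0`; the
kinetic analogue of S11 is genuinely super-exponential, rate `≍ N^{4/3} ∧ N log N`); (b) the FLAT crux `RateFloorFlat` (floor constant
AFTER the confidence `δ`, BEFORE the slack `η` and the scale `r`; with `g₀` after `η` or after `r` the statement is junk-true by energy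
conservation + packing), whose entropy transfer from `EqSuperExpDeficitFlat` (every witness of a deficit by a factor `g₀` on the support of
`χ` needs kinetic energy `≳ c(χ)N/g₀²` — shear, streams or jets alike — so the cost `→ ∞` as `g₀ → 0` uniformly in `η, r`; cold lamellae are
priced out by `r₀(η, L)`: heuristically TRUE) is PROVED below verbatim as in §7½.
-/

/-- **`RateFloorFlat`** — the crux with the floor constant moved after the confidence `δ` but BEFORE the slack `η` and the scale `r`:
`∀ profiles ∃σ₀ ∀σ Φ τ χ Ξ ∀δ ∃g₀>0 ∀η ∃r₀ ∀r<r₀ ∃N₀ ∀N: LG_N(E_N(g₀, r)) ≤ δ` (everything else verbatim).  A WEAKENING of `RateFloor`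
(`rateFloorFlat_of_rateFloor`).  The placement is forced: with `g₀` after `η` (a fortiori after `r`) the statement is JUNK-TRUE by energy
conservation + hard-core packing (`σ³∫B_r ≤ C·avg|v|` uniformly in `r`; registered records `stub_rateFloorGAfterR`, `stub_rateFloorGAfterEta`),
while `g₀` before `η` keeps the content (the limit contact law carries an a.e.-positive, possibly random and mark-class-dependent, floor —
what Disproof §6 says ParityRigidity consumes; planner to confirm against the glue). [folklore] -/
def RateFloorFlat : Prop :=
  ∀ (a₀ θ₀ : Literature.MathematicalPhysics.KineticTheory.T3 → ℝ) (u₀ : Literature.MathematicalPhysics.KineticTheory.T3 → Literature.MathematicalPhysics.KineticTheory.V3), Continuous a₀ → Continuous θ₀ → Continuous u₀ → (∀ x, 0 < a₀ x) → (∀ x, 0 < θ₀ x) → ∃ σ₀ : ℝ, 0 < σ₀ ∧ ∀ σ : ℝ, 0 < σ → σ < σ₀ → ∀ Φ : (N : ℕ) → Literature.Analysis.FluidPDE.HardSphereFlow (Literature.Analysis.FluidPDE.Torus.geometry (Fin 3)) (Literature.MathematicalPhysics.KineticTheory.hsDiameter σ N) (N + 1), ∀ τ : ℝ, 0 < τ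 → ∀ χ : ℝ × UnitAddTorus (Fin 3) → ℝ, Continuous χ → (∀ p, 0 ≤ χ p) → ∀ Ξ : EuclideanSpace ℝ (Fin 3) × EuclideanSpace ℝ (Fin 3) × EuclideanSpace ℝ (Fin 3) → ℝ, Continuous Ξ → (∀ q, 0 ≤ Ξ q) → (∃ C : ℝ, ∀ q, Ξ q ≤ C) → ∀ δ : ℝ, 0 < δ → ∃ g₀ : ℝ, 0 < g₀ ∧ ∀ η : ℝ, 0 < η → ∃ r₀ : ℝ, 0 < r₀ ∧ ∀ r : ℝ, 0 < r → r < r₀ → ∃ N₀ : ℕ, ∀ N : ℕ, N₀ ≤ N → let ε := Literature.MathematicalPhysics.KineticTheory.hsDiameter σ N; let G := Literature.Analysis.FluidPDE.Torus.geometry (Fin 3); let γ := fun z (s : ℝ) => (Φ N).flow s z; let bx : UnitAddTorus (Fin 3) → UnitAddTorus (Fin 3) → ℝ := fun x y => 3 / (Real.pi * r ^ 3) * max (1 - Literature.Analysis.FluidPDE.Torus.euclidDist x y / r) 0; let Θ := fun (Ξ : EuclideanSpace ℝ (Fin 3) × EuclideanSpace ℝ (Fin 3) × EuclideanSpace ℝ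 (Fin 3) → ℝ) (v w : EuclideanSpace ℝ (Fin 3)) => ∫ ω : Metric.sphere (0 : EuclideanSpace ℝ (Fin 3)) 1, Ξ ((ω : EuclideanSpace ℝ (Fin 3)), v, w) * Literature.MathematicalPhysics.KineticTheory.hardSphereKernel (w, v) ω ∂Literature.MathematicalPhysics.KineticTheory.sphereMeasure; let B := fun Ξ z s (x₀ : UnitAddTorus (Fin 3)) => ∫ p, bx p.1.1 x₀ * bx p.2.1 x₀ * Θ Ξ p.1.2 p.2.2 ∂((Literature.Analysis.FluidPDE.empiricalMeasure (γ z s)).prod (Literature.Analysis.FluidPDE.empiricalMeasure (γ z s))); let pv := fun z s (i j : Fin (N + 1)) => Literature.Analysis.FluidPDE.reflectVel (G.sepVec (γ z s i).1 (γ z s j).1) ((γ z s i).2, (γ z s j).2); let Kc := fun (Fn : Literature.Analysis.FluidPDE.Config (N + 1) (Fin 3) Literature.MathematicalPhysics.KineticTheory.T3 → ℝ → Fin (N + 1) → Fin (N + 1) → ℝ) z => ε / (N + 1 : ℝ) * ∑ᶠ (s : ℝ) (_ : s ∈ Literature.Analysis.FluidPDE.collisionTimes G ε (γ z) ∩ Set.Icc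 0 τ), ∑ i : Fin (N + 1), ∑ j : Fin (N + 1), (if i ≠ j ∧ ‖G.sepVec (γ z s i).1 (γ z s j).1‖ = ε then Fn z s i j else 0); Literature.MathematicalPhysics.KineticTheory.localGibbsLaw σ a₀ u₀ θ₀ N (Φ N) {z | Kc (fun z s i j => χ (s, (γ z s i).1) * Ξ (ε⁻¹ • G.sepVec (γ z s i).1 (γ z s j).1, (pv z s i j).1, (pv z s i j).2)) z < g₀ * σ ^ 3 * (∫ s in Set.Icc (0 : ℝ) τ, ∫ x : UnitAddTorus (Fin 3), χ (s, x) * B Ξ z s x) - η} ≤ ENNReal.ofReal δ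

/-- `RateFloor → RateFloorFlat` (the flat form is weaker: take the universal `g₀`). [folklore] -/
theorem rateFloorFlat_of_rateFloor (h : RateFloor) : RateFloorFlat := by
  obtain ⟨g₀, hg₀, h⟩ := h
  intro a₀ θ₀ u₀ ha hθ hu ha0 hθ0
  obtain ⟨σ₀, hσ₀, h⟩ := h a₀ θ₀ u₀ ha hθ hu ha0 hθ0
  refine ⟨σ₀, hσ₀, ?_⟩
  intro σ hσ hσlt Φ τ hτ χ hχc hχ0 Ξ hΞc hΞ0 hΞC δ hδ
  exact ⟨g₀, hg₀, fun η hη => h σ hσ hσlt Φ τ hτ χ hχc hχ0 Ξ hΞc hΞ0 hΞC η δ hη hδ⟩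

/-- **`EqSuperExpDeficitFlat`** (S11♭; the LIVE equilibrium residue of the entropy line under repair (b)): under the standard homogeneous
Gibbs law, for every `L` there is a floor constant `g₀ = g₀(L, …) > 0` such that for every slack `η` there is `r₀` with
`G_N(E_N(g₀, r)) ≤ exp(−L(N+1))` for all `r < r₀`, `N ≥ N₀(r)`.  Heuristically TRUE: the cheapest witness (r-scale laminar shear, §7¾) costs `≍ 5N/g₀²`, unbounded as `g₀ → 0` UNIFORMLY in
`r`; cold/fast/clustered witnesses cost `≍ N log(τ/r)`, `≍ N/r²`, `≍ N log N`; honest under-counting `≍ N^{4/3}`.  Why it might fail: an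
`e^{-O(N)}`-probable equilibrium fluctuation, cost bounded as `g₀ → 0`, suppressing marked collisions by an ARBITRARILY LARGE factor below the
`r`-ideal prediction on `O(1/g₀)` B-mass for a macroscopic time (none found: suppression by a factor `1/g₀` needs velocity variation
`≍ √θ/g₀` across `r`, i.e. kinetic energy `≍ θ/g₀²` per particle on the carrying set).  Not provable with tree tools (dynamical
large-deviation upper bound for the deterministic equilibrium flow). [folklore] -/
def EqSuperExpDeficitFlat : Prop :=
  ∃ σ₀ : ℝ, 0 < σ₀ ∧ ∀ σ : ℝ, 0 < σ → σ < σ₀ → ∀ Φ : (N : ℕ) → Literature.Analysis.FluidPDE.HardSphereFlow (Literature.Analysis.FluidPDE.Torus.geometry (Fin 3)) (Literature.MathematicalPhysics.KineticTheory.hsDiameter σ N) (N + 1), ∀ τ : ℝ, 0 < τ → ∀ χ : ℝ × UnitAddTorus (Fin 3) → ℝ, Continuous χ → (∀ p, 0 ≤ χ p) → ∀ Ξ : EuclideanSpace ℝ (Fin 3) × EuclideanSpace ℝ (Fin 3) × EuclideanSpace ℝ (Fin 3) → ℝ, Continuous Ξ → (∀ q, 0 ≤ Ξ q) → (∃ C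 : ℝ, ∀ q, Ξ q ≤ C) → ∀ L : ℝ, ∃ g₀ : ℝ, 0 < g₀ ∧ ∀ η : ℝ, 0 < η → ∃ r₀ : ℝ, 0 < r₀ ∧ ∀ r : ℝ, 0 < r → r < r₀ → ∃ N₀ : ℕ, ∀ N : ℕ, N₀ ≤ N → let ε := Literature.MathematicalPhysics.KineticTheory.hsDiameter σ N; let G := Literature.Analysis.FluidPDE.Torus.geometry (Fin 3); let γ := fun z (s : ℝ) => (Φ N).flow s z; let bx : UnitAddTorus (Fin 3) → UnitAddTorus (Fin 3) → ℝ := fun x y => 3 / (Real.pi * r ^ 3) * max (1 - Literature.Analysis.FluidPDE.Torus.euclidDist x y / r) 0; let Θ := fun (Ξ : EuclideanSpace ℝ (Fin 3) × EuclideanSpace ℝ (Fin 3) × EuclideanSpace ℝ (Fin 3) → ℝ) (v w : EuclideanSpace ℝ (Fin 3)) => ∫ ω : Metric.sphere (0 : EuclideanSpace ℝ (Fin 3)) 1, Ξ ((ω : EuclideanSpace ℝ (Fin 3)), v, w) * Literature.MathematicalPhysics.KineticTheory.hardSphereKernel (w, v) ω ∂Literature.MathematicalPhysics.KineticTheory.sphereMeasure;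 let B := fun Ξ z s (x₀ : UnitAddTorus (Fin 3)) => ∫ p, bx p.1.1 x₀ * bx p.2.1 x₀ * Θ Ξ p.1.2 p.2.2 ∂((Literature.Analysis.FluidPDE.empiricalMeasure (γ z s)).prod (Literature.Analysis.FluidPDE.empiricalMeasure (γ z s))); let pv := fun z s (i j : Fin (N + 1)) => Literature.Analysis.FluidPDE.reflectVel (G.sepVec (γ z s i).1 (γ z s j).1) ((γ z s i).2, (γ z s j).2); let Kc := fun (Fn : Literature.Analysis.FluidPDE.Config (N + 1) (Fin 3) Literature.MathematicalPhysics.KineticTheory.T3 → ℝ → Fin (N + 1) → Fin (N + 1) → ℝ) z => ε / (N + 1 : ℝ) * ∑ᶠ (s : ℝ) (_ : s ∈ Literature.Analysis.FluidPDE.collisionTimes G ε (γ z) ∩ Set.Icc 0 τ), ∑ i : Fin (N + 1), ∑ j : Fin (N + 1), (if i ≠ j ∧ ‖G.sepVec (γ z s i).1 (γ z s j).1‖ = ε then Fn z s i j else 0); Literature.MathematicalPhysics.KineticTheory.localGibbsLaw σ (fun _ => (1 : ℝ)) (fun _ => (0 : EuclideanSpace ℝ (Fin 3))) (fun _ =>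 (1 : ℝ)) N (Φ N) {z | Kc (fun z s i j => χ (s, (γ z s i).1) * Ξ (ε⁻¹ • G.sepVec (γ z s i).1 (γ z s j).1, (pv z s i j).1, (pv z s i j).2)) z < g₀ * σ ^ 3 * (∫ s in Set.Icc (0 : ℝ) τ, ∫ x : UnitAddTorus (Fin 3), χ (s, x) * B Ξ z s x) - η} ≤ ENNReal.ofReal (Real.exp (-(L * ((N : ℝ) + 1))))

/-- The flat entropy class (intermediate, def): the flat crux for every initial law of relative entropy `≤ K(N+1)`, `g₀ = g₀(K, δ, …)`.
[folklore] -/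
def EntropyClassRateFloorFlat : Prop :=
  ∃ σ₀ : ℝ, 0 < σ₀ ∧ ∀ σ : ℝ, 0 < σ → σ < σ₀ → ∀ Φ : (N : ℕ) → Literature.Analysis.FluidPDE.HardSphereFlow (Literature.Analysis.FluidPDE.Torus.geometry (Fin 3)) (Literature.MathematicalPhysics.KineticTheory.hsDiameter σ N) (N + 1), ∀ τ : ℝ, 0 < τ → ∀ χ : ℝ × UnitAddTorus (Fin 3) → ℝ, Continuous χ → (∀ p, 0 ≤ χ p) → ∀ Ξ : EuclideanSpace ℝ (Fin 3) × EuclideanSpace ℝ (Fin 3) × EuclideanSpace ℝ (Fin 3) → ℝ, Continuous Ξ → (∀ q, 0 ≤ Ξ q) → (∃ C : ℝ, ∀ q, Ξ q ≤ C) → ∀ K δ : ℝ, 0 < δ → ∃ g₀ : ℝ, 0 < g₀ ∧ ∀ η : ℝ, 0 < η → ∃ r₀ : ℝ, 0 < r₀ ∧ ∀ r : ℝ, 0 < r → r < r₀ → ∃ N₀ : ℕ, ∀ N : ℕ, N₀ ≤ N → ∀ μ : MeasureTheory.Measure (Literature.Analysis.FluidPDE.Config (N + 1) (Fin 3) Literature.MathematicalPhysics.KineticTheory.T3),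 MeasureTheory.IsProbabilityMeasure μ → InformationTheory.klDiv μ (Literature.MathematicalPhysics.KineticTheory.localGibbsLaw σ (fun _ => (1 : ℝ)) (fun _ => (0 : EuclideanSpace ℝ (Fin 3))) (fun _ => (1 : ℝ)) N (Φ N)) ≤ ENNReal.ofReal (K * ((N : ℝ) + 1)) → let ε := Literature.MathematicalPhysics.KineticTheory.hsDiameter σ N; let G := Literature.Analysis.FluidPDE.Torus.geometry (Fin 3); let γ := fun z (s : ℝ) => (Φ N).flow s z; let bx : UnitAddTorus (Fin 3) → UnitAddTorus (Fin 3) → ℝ := fun x y => 3 / (Real.pi * r ^ 3) * max (1 - Literature.Analysis.FluidPDE.Torus.euclidDist x y / r) 0; let Θ := fun (Ξ : EuclideanSpace ℝ (Fin 3) × EuclideanSpace ℝ (Fin 3) × EuclideanSpace ℝ (Fin 3) → ℝ) (v w : EuclideanSpace ℝ (Fin 3)) => ∫ ω : Metric.sphere (0 : EuclideanSpace ℝ (Fin 3)) 1, Ξ ((ω : EuclideanSpace ℝ (Fin 3)), v, w) * Literature.MathematicalPhysics.KineticTheory.hardSphereKernel (w, v) ω ∂Literature.MathematicalPhysics.KineticTheory.sphereMeasure;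 let B := fun Ξ z s (x₀ : UnitAddTorus (Fin 3)) => ∫ p, bx p.1.1 x₀ * bx p.2.1 x₀ * Θ Ξ p.1.2 p.2.2 ∂((Literature.Analysis.FluidPDE.empiricalMeasure (γ z s)).prod (Literature.Analysis.FluidPDE.empiricalMeasure (γ z s))); let pv := fun z s (i j : Fin (N + 1)) => Literature.Analysis.FluidPDE.reflectVel (G.sepVec (γ z s i).1 (γ z s j).1) ((γ z s i).2, (γ z s j).2); let Kc := fun (Fn : Literature.Analysis.FluidPDE.Config (N + 1) (Fin 3) Literature.MathematicalPhysics.KineticTheory.T3 → ℝ → Fin (N + 1) → Fin (N + 1) → ℝ) z => ε / (N + 1 : ℝ) * ∑ᶠ (s : ℝ) (_ : s ∈ Literature.Analysis.FluidPDE.collisionTimes G ε (γ z) ∩ Set.Icc 0 τ), ∑ i : Fin (N + 1), ∑ j : Fin (N + 1), (if i ≠ j ∧ ‖G.sepVec (γ z s i).1 (γ z s j).1‖ = ε then Fn z s i j else 0); μ {z | Kc (fun z s i j => χ (s, (γ z s i).1) * Ξ (ε⁻¹ • G.sepVec (γ z s i).1 (γ z s j).1, (pv z s i j).1, (pv z s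 i j).2)) z < g₀ * σ ^ 3 * (∫ s in Set.Icc (0 : ℝ) τ, ∫ x : UnitAddTorus (Fin 3), χ (s, x) * B Ξ z s x) - η} ≤ ENNReal.ofReal δ

/-- **Flat entropy class from the flat super-exponential bound** (PROVED; as `entropyClassRateFloor_of_eqSuperExpDeficit` with
`L := (log 2 + max K 0 + 1)/δ` feeding the choice of `g₀`). [cite: KipnisLandim1999, Appendix 1 Prop. 8.2] -/
theorem entropyClassRateFloorFlat_of_eqSuperExpDeficitFlat (h : EqSuperExpDeficitFlat) : EntropyClassRateFloorFlat := by
  obtain ⟨σ₀, hσ₀, h⟩ := h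
  refine ⟨min σ₀ 2⁻¹, lt_min hσ₀ (by norm_num), ?_⟩
  intro σ hσ hσlt' Φ τ hτ χ hχc hχ0 Ξ hΞc hΞ0 hΞC K δ hδ
  have hσlt : σ < σ₀ := hσlt'.trans_le (min_le_left _ _)
  have hσ2 : σ ≤ 1 / 2 := by
    have := hσlt'.trans_le (min_le_right σ₀ 2⁻¹)
    rw [one_div]; exact this.le
  set K' : ℝ := max K 0 with hK'
  have hK'0 : 0 ≤ K' := le_max_right _ _
  set L : ℝ := (Real.log 2 + K' + 1) / δ with hL
  have hlog : 0 < Real.log 2 := Real.log_pos (by norm_num)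
  have hLpos : 0 < L := by positivity
  obtain ⟨g₀, hg₀, h⟩ := h σ hσ hσlt Φ τ hτ χ hχc hχ0 Ξ hΞc hΞ0 hΞC L
  refine ⟨g₀, hg₀, fun η hη => ?_⟩
  obtain ⟨r₀, hr₀, h⟩ := h η hη
  refine ⟨r₀, hr₀, fun r hr hrlt => ?_⟩
  obtain ⟨N₀, hN⟩ := h r hr hrlt
  refine ⟨N₀, fun N hNN μ hμ hKL => ?_⟩
  have h1 := hN N hNN
  intro ε G γ bx Θ B pv Kc
  haveI : MeasureTheory.IsProbabilityMeasure μ := hμ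
  haveI : MeasureTheory.IsProbabilityMeasure (Literature.MathematicalPhysics.KineticTheory.localGibbsLaw σ
      (fun _ => (1 : ℝ)) (fun _ => (0 : EuclideanSpace ℝ (Fin 3))) (fun _ => (1 : ℝ)) N (Φ N)) :=
    isProbabilityMeasure_localGibbsLaw (a₀ := fun _ => (1 : ℝ)) (θ₀ := fun _ => (1 : ℝ))
      (u₀ := fun _ => (0 : EuclideanSpace ℝ (Fin 3))) continuous_const continuous_const continuous_const
      (fun _ => one_pos) (fun _ => one_pos) hσ2 N (Φ N)
  have hn1 : (1 : ℝ) ≤ (N : ℝ) + 1 := by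
    have : (0 : ℝ) ≤ (N : ℝ) := Nat.cast_nonneg N
    linarith
  have hGpos : 0 < L * ((N : ℝ) + 1) := by positivity
  have hKL' : InformationTheory.klDiv μ (Literature.MathematicalPhysics.KineticTheory.localGibbsLaw σ
      (fun _ => (1 : ℝ)) (fun _ => (0 : EuclideanSpace ℝ (Fin 3))) (fun _ => (1 : ℝ)) N (Φ N)) ≤
      ENNReal.ofReal (K' * ((N : ℝ) + 1)) :=
    hKL.trans (ENNReal.ofReal_le_ofReal (mul_le_mul_of_nonneg_right (le_max_left _ _) (by positivity)))
  have e1 : Literature.MathematicalPhysics.KineticTheory.localGibbsLaw σ (fun _ => (1 : ℝ))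
      (fun _ => (0 : EuclideanSpace ℝ (Fin 3))) (fun _ => (1 : ℝ)) N (Φ N)
      {z | Kc (fun z s i j => χ (s, (γ z s i).1) *
        Ξ (ε⁻¹ • G.sepVec (γ z s i).1 (γ z s j).1, (pv z s i j).1, (pv z s i j).2)) z <
        g₀ * σ ^ 3 * (∫ s in Set.Icc (0 : ℝ) τ, ∫ x : UnitAddTorus (Fin 3), χ (s, x) * B Ξ z s x) - η} ≤
      ENNReal.ofReal (Real.exp (-(L * ((N : ℝ) + 1)))) := h1
  have h2 := measure_le_of_klDiv_le_hull μ _ _ hGpos (by positivity : (0 : ℝ) ≤ K' * ((N : ℝ) + 1)) e1 hKL'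
  refine h2.trans (ENNReal.ofReal_le_ofReal ?_)
  rw [hL]
  exact entropy_transfer_arith hK'0 hδ hn1

/-- **The flat crux from the flat entropy class** (PROVED; as `rateFloor_of_entropyClassRateFloor`, budget `A(profiles, σ)` from
`exists_localGibbsLaw_dominated`). [cite: KipnisLandim1999, Ch. 6 §1] -/
theorem rateFloorFlat_of_entropyClassRateFloorFlat (h : EntropyClassRateFloorFlat) : RateFloorFlat := by
  obtain ⟨σ₁, hσ₁, h⟩ := h
  intro a₀ θ₀ u₀ ha hθ hu ha0 hθ0
  refine ⟨min σ₁ 2⁻¹, lt_min hσ₁ (by norm_num), ?_⟩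
  intro σ hσ hσlt Φ τ hτ χ hχc hχ0 Ξ hΞc hΞ0 hΞC δ hδ
  have hσ₁' : σ < σ₁ := hσlt.trans_le (min_le_left _ _)
  have hσ2 : σ ≤ 1 / 2 := by
    have := hσlt.trans_le (min_le_right σ₁ 2⁻¹)
    rw [one_div]; exact this.le
  obtain ⟨A, b, hA, hb, hdom⟩ :=
    Summit.AtomisticToContinuum.HydrodynamicLimit.Theorems.LambertianContactSwapSwapGapGibbsDomination.exists_localGibbsLaw_dominated
      ha hθ hu ha0 hθ0 hσ2
  obtain ⟨g₀, hg₀, h⟩ := h σ hσ hσ₁' Φ τ hτ χ hχc hχ0 Ξ hΞc hΞ0 hΞC A δ hδ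
  refine ⟨g₀, hg₀, fun η hη => ?_⟩
  obtain ⟨r₀, hr₀, h⟩ := h η hη
  refine ⟨r₀, hr₀, fun r hr hrlt => ?_⟩
  obtain ⟨N₀, hN⟩ := h r hr hrlt
  refine ⟨N₀, fun N hNN => ?_⟩
  have hP : MeasureTheory.IsProbabilityMeasure (Literature.MathematicalPhysics.KineticTheory.localGibbsLaw σ a₀ u₀ θ₀ N (Φ N)) :=
    isProbabilityMeasure_localGibbsLaw ha hθ hu ha0 hθ0 hσ2 N (Φ N)
  obtain ⟨-, -, hKL, -, -⟩ := hdom N (Φ N)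
  exact hN N hNN (Literature.MathematicalPhysics.KineticTheory.localGibbsLaw σ a₀ u₀ θ₀ N (Φ N)) hP hKL

/-- **REPAIR (b) IN ONE LINE: `EqSuperExpDeficitFlat → RateFloorFlat`** (PROVED composition; the live form of the entropy line — the planner
restates the crux as `RateFloorFlat` (if the glue tolerates an a.e.-positive floor) and files `EqSuperExpDeficitFlat` as its single
equilibrium residue). [folklore] -/
theorem rateFloorFlat_of_eqSuperExpDeficitFlat (h : EqSuperExpDeficitFlat) : RateFloorFlat :=
  rateFloorFlat_of_entropyClassRateFloorFlat (entropyClassRateFloorFlat_of_eqSuperExpDeficitFlat h)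

/-- Necessity, flat form (PROVED from S12): `EntropyClassRateFloorFlat → EqSuperExpDeficitFlat` — also under repair (b) the
super-exponential bound is exactly what the entropy method must establish. [folklore] -/
theorem eqSuperExpDeficitFlat_of_entropyClassFlat (h : EntropyClassRateFloorFlat) : EqSuperExpDeficitFlat := by
  obtain ⟨σ₀, hσ₀, h⟩ := h
  refine ⟨min σ₀ 2⁻¹, lt_min hσ₀ (by norm_num), ?_⟩
  intro σ hσ hσlt' Φ τ hτ χ hχc hχ0 Ξ hΞc hΞ0 hΞC L
  have hσlt : σ < σ₀ := hσlt'.trans_le (min_le_left _ _)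
  have hσ2 : σ ≤ 1 / 2 := by
    have := hσlt'.trans_le (min_le_right σ₀ 2⁻¹)
    rw [one_div]; exact this.le
  set K : ℝ := max L 0 with hK
  obtain ⟨g₀, hg₀, h⟩ := h σ hσ hσlt Φ τ hτ χ hχc hχ0 Ξ hΞc hΞ0 hΞC K (1 / 2) (by norm_num)
  refine ⟨g₀, hg₀, fun η hη => ?_⟩
  obtain ⟨r₀, hr₀, h⟩ := h η hη
  refine ⟨r₀, hr₀, fun r hr hrlt => ?_⟩
  obtain ⟨N₀, hN⟩ := h r hr hrlt
  refine ⟨N₀, fun N hNN => ?_⟩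
  have h1 := hN N hNN
  intro ε G γ bx Θ B pv Kc
  haveI : MeasureTheory.IsProbabilityMeasure (Literature.MathematicalPhysics.KineticTheory.localGibbsLaw σ
      (fun _ => (1 : ℝ)) (fun _ => (0 : EuclideanSpace ℝ (Fin 3))) (fun _ => (1 : ℝ)) N (Φ N)) :=
    isProbabilityMeasure_localGibbsLaw (a₀ := fun _ => (1 : ℝ)) (θ₀ := fun _ => (1 : ℝ))
      (u₀ := fun _ => (0 : EuclideanSpace ℝ (Fin 3))) continuous_const continuous_const continuous_const
      (fun _ => one_pos) (fun _ => one_pos) hσ2 N (Φ N)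
  have e1 : ∀ μ : MeasureTheory.Measure (Literature.Analysis.FluidPDE.Config (N + 1) (Fin 3)
      Literature.MathematicalPhysics.KineticTheory.T3), MeasureTheory.IsProbabilityMeasure μ →
      InformationTheory.klDiv μ (Literature.MathematicalPhysics.KineticTheory.localGibbsLaw σ (fun _ => (1 : ℝ))
        (fun _ => (0 : EuclideanSpace ℝ (Fin 3))) (fun _ => (1 : ℝ)) N (Φ N)) ≤ ENNReal.ofReal (K * ((N : ℝ) + 1)) →
      μ {z | Kc (fun z s i j => χ (s, (γ z s i).1) *
        Ξ (ε⁻¹ • G.sepVec (γ z s i).1 (γ z s j).1, (pv z s i j).1, (pv z s i j).2)) z <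
        g₀ * σ ^ 3 * (∫ s in Set.Icc (0 : ℝ) τ, ∫ x : UnitAddTorus (Fin 3), χ (s, x) * B Ξ z s x) - η} ≤
      ENNReal.ofReal (1 / 2) := h1
  have h2 := stub_measure_le_exp_of_entropyClass _ (Literature.MathematicalPhysics.KineticTheory.localGibbsLaw σ (fun _ => (1 : ℝ))
    (fun _ => (0 : EuclideanSpace ℝ (Fin 3))) (fun _ => (1 : ℝ)) N (Φ N)) _ (K * ((N : ℝ) + 1)) (1 / 2)
    (by norm_num) e1
  refine h2.trans (ENNReal.ofReal_le_ofReal (Real.exp_le_exp.2 ?_))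
  have hn : (0 : ℝ) ≤ (N : ℝ) + 1 := by positivity
  nlinarith [le_max_left L 0, mul_le_mul_of_nonneg_right (le_max_left L 0) hn]

/-! ### §7¾′ The shear witness as a Lean statement: `ShearDeficitPersistence → ¬EntropyClassRateFloor` (PROVED modulo the drift-entropy stub S13)

What refutes the entropy class is ONE hydrodynamic input, isolated here as `ShearDeficitPersistence` (H_shear): for every floor `g₀` and
`σ₀` there are admissible data `(σ, Φ, τ, χ, Ξ, η)` and a drift bound `U` such that below EVERY `r₀` some continuous drift field `u`
(the Kolmogorov shear of wavelength `2r`, `‖u‖ ≤ U`) makes the crux's deficit event MORE LIKELY THAN NOT under `localGibbsLaw σ 1 u 1`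
for infinitely many `N` (laminar persistence of an Euler-stationary shear in the inviscid limit — §7¾ heuristics).  The only other input
is STATIC and exact: `KL(localGibbsLaw σ 1 u 1 ‖ localGibbsLaw σ 1 0 1) = E[Σᵢ|u(xᵢ)|²/2] ≤ (N+1)U²/2` (same configurational partition
function; fibrewise Gaussian shift) — registered as stub S13 `stub_klDiv_localGibbsLaw_drift_le` (CLOSED p126421).
-/

/-- **H_shear · `ShearDeficitPersistence`** (the hydrodynamic input of the shear witness; believed TRUE, not provable: it is a one-sided
hydrodynamic-limit statement for a stationary shear flow). [folklore] -/
def ShearDeficitPersistence : Prop :=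
  ∀ g₀ : ℝ, 0 < g₀ → ∀ σ₀ : ℝ, 0 < σ₀ → ∃ σ : ℝ, 0 < σ ∧ σ < σ₀ ∧ ∃ Φ : (N : ℕ) → Literature.Analysis.FluidPDE.HardSphereFlow (Literature.Analysis.FluidPDE.Torus.geometry (Fin 3)) (Literature.MathematicalPhysics.KineticTheory.hsDiameter σ N) (N + 1), ∃ τ : ℝ, 0 < τ ∧ ∃ χ : ℝ × UnitAddTorus (Fin 3) → ℝ, Continuous χ ∧ (∀ p, 0 ≤ χ p) ∧ ∃ Ξ : EuclideanSpace ℝ (Fin 3) × EuclideanSpace ℝ (Fin 3) × EuclideanSpace ℝ (Fin 3) → ℝ, Continuous Ξ ∧ (∀ q, 0 ≤ Ξ q) ∧ (∃ C : ℝ, ∀ q, Ξ q ≤ C) ∧ ∃ η : ℝ, 0 < η ∧ ∃ U : ℝ, ∀ r₀ : ℝ, 0 < r₀ → ∃ r : ℝ, 0 < r ∧ r < r₀ ∧ ∃ u : UnitAddTorus (Fin 3) → EuclideanSpace ℝ (Fin 3), Continuous u ∧ (∀ x, ‖u x‖ ≤ U) ∧ ∀ N₀ : ℕ, ∃ N :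 ℕ, N₀ ≤ N ∧ let ε := Literature.MathematicalPhysics.KineticTheory.hsDiameter σ N; let G := Literature.Analysis.FluidPDE.Torus.geometry (Fin 3); let γ := fun z (s : ℝ) => (Φ N).flow s z; let bx : UnitAddTorus (Fin 3) → UnitAddTorus (Fin 3) → ℝ := fun x y => 3 / (Real.pi * r ^ 3) * max (1 - Literature.Analysis.FluidPDE.Torus.euclidDist x y / r) 0; let Θ := fun (Ξ : EuclideanSpace ℝ (Fin 3) × EuclideanSpace ℝ (Fin 3) × EuclideanSpace ℝ (Fin 3) → ℝ) (v w : EuclideanSpace ℝ (Fin 3)) => ∫ ω : Metric.sphere (0 : EuclideanSpace ℝ (Fin 3)) 1, Ξ ((ω : EuclideanSpace ℝ (Fin 3)), v, w) * Literature.MathematicalPhysics.KineticTheory.hardSphereKernel (w, v) ω ∂Literature.MathematicalPhysics.KineticTheory.sphereMeasure; let B := fun Ξ z s (x₀ : UnitAddTorus (Fin 3)) => ∫ p, bx p.1.1 x₀ * bx p.2.1 x₀ * Θ Ξ p.1.2 p.2.2 ∂((Literature.Analysis.FluidPDE.empiricalMeasure (γ z s)).prod (Literature.Analysis.FluidPDE.empiricalMeasure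 (γ z s))); let pv := fun z s (i j : Fin (N + 1)) => Literature.Analysis.FluidPDE.reflectVel (G.sepVec (γ z s i).1 (γ z s j).1) ((γ z s i).2, (γ z s j).2); let Kc := fun (Fn : Literature.Analysis.FluidPDE.Config (N + 1) (Fin 3) Literature.MathematicalPhysics.KineticTheory.T3 → ℝ → Fin (N + 1) → Fin (N + 1) → ℝ) z => ε / (N + 1 : ℝ) * ∑ᶠ (s : ℝ) (_ : s ∈ Literature.Analysis.FluidPDE.collisionTimes G ε (γ z) ∩ Set.Icc 0 τ), ∑ i : Fin (N + 1), ∑ j : Fin (N + 1), (if i ≠ j ∧ ‖G.sepVec (γ z s i).1 (γ z s j).1‖ = ε then Fn z s i j else 0); ENNReal.ofReal (1 / 2) < Literature.MathematicalPhysics.KineticTheory.localGibbsLaw σ (fun _ => (1 : ℝ)) u (fun _ => (1 : ℝ)) N (Φ N) {z | Kc (fun z s i j => χ (s, (γ z s i).1) * Ξ (ε⁻¹ • G.sepVec (γ z s i).1 (γ z s j).1, (pv z s i j).1, (pv z s i j).2)) z < g₀ * σ ^ 3 * (∫ s in Set.Icc (0 : ℝ) τ, ∫ x : UnitAddTorus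 (Fin 3), χ (s, x) * B Ξ z s x) - η}

/-- **S13 · DRIFT ENTROPY BOUND** (`stub_klDiv_localGibbsLaw_drift_le`; CLOSED p126421, c4 wave-3 worker): for unit activity and temperature and a
continuous drift field `u` with `‖u‖ ≤ U`, `KL(localGibbsLaw σ 1 u 1 ‖ localGibbsLaw σ 1 0 1) ≤ (N+1)U²/2` (the two laws have the same
configurational partition function `posPartition 1`; the log-likelihood ratio is `Σᵢ (vᵢ·u(xᵢ) − |u(xᵢ)|²/2)` on the hard-sphere domain and
`E[vᵢ | x] = u(xᵢ)`).  Leans on: `canonicalPartition_eq_posPartition`, `llr_localGibbsLaw_ae_eq` / `log_canonicalDensity_localGibbsProfile_eq`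
(`LambertianContactSwapSwapGapEntropyBudgetStatics`), `toReal_klDiv_withDensity`, fibrewise Gaussian first moments. [size M] -/
def Stubs.stub_klDiv_localGibbsLaw_drift_le : Prop :=
  ∀ σ : ℝ, 0 < σ → σ ≤ 1 / 2 → ∀ (u : Literature.MathematicalPhysics.KineticTheory.T3 → Literature.MathematicalPhysics.KineticTheory.V3), Continuous u → ∀ U : ℝ, (∀ x, ‖u x‖ ≤ U) → ∀ (N : ℕ) (Φ : Literature.Analysis.FluidPDE.HardSphereFlow (Literature.Analysis.FluidPDE.Torus.geometry (Fin 3)) (Literature.MathematicalPhysics.KineticTheory.hsDiameter σ N) (N + 1)), InformationTheory.klDiv (Literature.MathematicalPhysics.KineticTheory.localGibbsLaw σ (fun _ => (1 : ℝ)) u (fun _ => (1 : ℝ)) N Φ) (Literature.MathematicalPhysics.KineticTheory.localGibbsLaw σ (fun _ => (1 : ℝ)) (fun _ => (0 : EuclideanSpace ℝ (Fin 3))) (fun _ => (1 : ℝ)) N Φ) ≤ ENNReal.ofReal (((N : ℝ) + 1) * (U ^ 2 / 2))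

/- Registered stub S13 (`Stubs.stub_klDiv_localGibbsLaw_drift_le`): CLOSED — landed by the c4 wave-3 worker as
`Summit.AtomisticToContinuum.HydrodynamicLimit.Theorems.RateFloorDriftEntropy.stub_klDiv_localGibbsLaw_drift_le`
(file `Theorems/JParityClosureRateFloorDriftEntropy.lean`, p126421; exact Gaussian bookkeeping: llr = Σᵢ‖vᵢ‖²/2 − Σᵢ‖vᵢ−u(xᵢ)‖²/2 on the
domain).  The theorem is not re-stated in this copy because the check farm had not built the new module at publish time; the two theorems
below take it as the hypothesis `hKL : Stubs.stub_klDiv_localGibbsLaw_drift_le`, discharged by that tree theorem. -/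

/-- **THE ENTROPY CLASS IS TOO LARGE, as a theorem modulo H_shear and S13**: `ShearDeficitPersistence → ¬EntropyClassRateFloor`
(bookkeeping: feed ECRF the budget `K := U²/2` and `δ := ½`, then the shear law below ECRF's `r₀` is in the class and violates the bound).
With `entropyClassRateFloor_of_eqSuperExpDeficit` this also gives `ShearDeficitPersistence → ¬stub_eqSuperExpDeficit`. [folklore] -/
theorem not_entropyClassRateFloor_of_shear (hKL : Stubs.stub_klDiv_localGibbsLaw_drift_le) (hsh : ShearDeficitPersistence) :
    ¬ EntropyClassRateFloor := by
  rintro ⟨g₀, hg₀, σ₀, hσ₀, hE⟩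
  obtain ⟨σ, hσ, hσlt, Φ, τ, hτ, χ, hχc, hχ0, Ξ, hΞc, hΞ0, hΞC, η, hη, U, hsh⟩ := hsh g₀ hg₀ (min σ₀ 2⁻¹) (lt_min hσ₀ (by norm_num))
  have hσlt' : σ < σ₀ := hσlt.trans_le (min_le_left _ _)
  have hσ2 : σ ≤ 1 / 2 := by
    have := hσlt.trans_le (min_le_right σ₀ 2⁻¹)
    rw [one_div]; exact this.le
  obtain ⟨r₀, hr₀, hE⟩ := hE σ hσ hσlt' Φ τ hτ χ hχc hχ0 Ξ hΞc hΞ0 hΞC (U ^ 2 / 2) η (1 / 2) hη (by norm_num)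
  obtain ⟨r, hr, hrlt, u, hu, huU, hsh⟩ := hsh r₀ hr₀
  obtain ⟨N₀, hE⟩ := hE r hr hrlt
  obtain ⟨N, hNN, hsh⟩ := hsh N₀
  have h1 := hE N hNN (Literature.MathematicalPhysics.KineticTheory.localGibbsLaw σ (fun _ => (1 : ℝ)) u (fun _ => (1 : ℝ)) N (Φ N))
    (isProbabilityMeasure_localGibbsLaw (a₀ := fun _ => (1 : ℝ)) (θ₀ := fun _ => (1 : ℝ)) continuous_const continuous_const hu
      (fun _ => one_pos) (fun _ => one_pos) hσ2 N (Φ N))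
    (by
      have := hKL σ hσ hσ2 u hu U huU N (Φ N)
      simpa [mul_comm] using this)
  dsimp only at hsh h1
  exact absurd (lt_of_lt_of_le hsh h1) (lt_irrefl _)

/-- Corollary: `ShearDeficitPersistence → ¬ stub_eqSuperExpDeficit` (modulo S13). [folklore] -/
theorem not_eqSuperExpDeficit_of_shear (hKL : Stubs.stub_klDiv_localGibbsLaw_drift_le) (hsh : ShearDeficitPersistence) :
    ¬ Stubs.stub_eqSuperExpDeficit :=
  fun h => not_entropyClassRateFloor_of_shear hKL hsh (entropyClassRateFloor_of_eqSuperExpDeficit h)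

/-! ## §7⅞ (c4) REPAIR (a) WRITTEN OUT: the KINETIC-SCALE mollified crux and its entropy transfer (PROVED)

Conforming restatement (a) (c1–c3's recommendation #1, with c4's mechanism): mollify at the kinetic scale `R_N = λ(N+1)^{-1/3}`
(`= (λ/σ)·ε_N`; `λ ≫ σ` so that the hard-core hole is negligible, `λ³ ≫ 1` particles per ball) instead of the fixed macroscopic `r`;
quantifiers `∀ η δ ∃ λ₀ ∀ λ ≥ λ₀ ∃ N₀ ∀ N ≥ N₀`, the rest verbatim with `r := λ(N+1)^{-1/3}` at the head of the `let`-chain.  Its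
equilibrium residue `EqSuperExpDeficitKinetic` is heuristically a GENUINE super-exponential bound (velocity segregation at any scale
`∝ (N+1)^{-1/3}` has viscous lifetime `≍ λ²σ²(N+1)^{-1/3} → 0` and must be re-created `≍ N^{1/3}` times, cost `≍ N^{4/3}`; cold streams
`≍ N log N`; the packing bound keeps the floor non-junk).  The transfer below is §7½ verbatim.  What (a) gives up relative to the filed crux
is exactly the sub-`r` macroscopic velocity-fluctuation content (it bounds the contact law below by the KINETIC-scale product law, not by the
product of the `r`-scale Young measure) — the planner must re-dock that content (no sub-grid energy) elsewhere in the glue.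
-/

/-- **`RateFloorKinetic`** — the crux mollified at the kinetic scale `R_N = λ(N+1)^{-1/3}` (restatement (a); everything else verbatim).
[folklore] -/
def RateFloorKinetic : Prop :=
  ∃ g₀ : ℝ, 0 < g₀ ∧ ∀ (a₀ θ₀ : Literature.MathematicalPhysics.KineticTheory.T3 → ℝ) (u₀ : Literature.MathematicalPhysics.KineticTheory.T3 → Literature.MathematicalPhysics.KineticTheory.V3), Continuous a₀ → Continuous θ₀ → Continuous u₀ → (∀ x, 0 < a₀ x) → (∀ x, 0 < θ₀ x) → ∃ σ₀ : ℝ, 0 < σ₀ ∧ ∀ σ : ℝ, 0 < σ → σ < σ₀ → ∀ Φ : (N : ℕ) → Literature.Analysis.FluidPDE.HardSphereFlow (Literature.Analysis.FluidPDE.Torus.geometry (Fin 3)) (Literature.MathematicalPhysics.KineticTheory.hsDiameter σ N) (N + 1), ∀ τ : ℝ, 0 < τ → ∀ χ : ℝ × UnitAddTorus (Fin 3) → ℝ, Continuous χ → (∀ p, 0 ≤ χ p) → ∀ Ξ : EuclideanSpace ℝ (Fin 3) × EuclideanSpace ℝ (Fin 3) × EuclideanSpace ℝ (Fin 3) → ℝ,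 Continuous Ξ → (∀ q, 0 ≤ Ξ q) → (∃ C : ℝ, ∀ q, Ξ q ≤ C) → ∀ η δ : ℝ, 0 < η → 0 < δ → ∃ lam₀ : ℝ, 0 < lam₀ ∧ ∀ lam : ℝ, lam₀ ≤ lam → ∃ N₀ : ℕ, ∀ N : ℕ, N₀ ≤ N → let r : ℝ := lam * ((N + 1 : ℕ) : ℝ) ^ (-(1 / 3 : ℝ)); let ε := Literature.MathematicalPhysics.KineticTheory.hsDiameter σ N; let G := Literature.Analysis.FluidPDE.Torus.geometry (Fin 3); let γ := fun z (s : ℝ) => (Φ N).flow s z; let bx : UnitAddTorus (Fin 3) → UnitAddTorus (Fin 3) → ℝ := fun x y => 3 / (Real.pi * r ^ 3) * max (1 - Literature.Analysis.FluidPDE.Torus.euclidDist x y / r) 0; let Θ := fun (Ξ : EuclideanSpace ℝ (Fin 3) × EuclideanSpace ℝ (Fin 3) × EuclideanSpace ℝ (Fin 3) → ℝ) (v w : EuclideanSpace ℝ (Fin 3)) => ∫ ω : Metric.sphere (0 : EuclideanSpace ℝ (Fin 3)) 1, Ξ ((ω : EuclideanSpace ℝ (Fin 3)), v, w) * Literature.MathematicalPhysics.KineticTheory.hardSphereKernel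 (w, v) ω ∂Literature.MathematicalPhysics.KineticTheory.sphereMeasure; let B := fun Ξ z s (x₀ : UnitAddTorus (Fin 3)) => ∫ p, bx p.1.1 x₀ * bx p.2.1 x₀ * Θ Ξ p.1.2 p.2.2 ∂((Literature.Analysis.FluidPDE.empiricalMeasure (γ z s)).prod (Literature.Analysis.FluidPDE.empiricalMeasure (γ z s))); let pv := fun z s (i j : Fin (N + 1)) => Literature.Analysis.FluidPDE.reflectVel (G.sepVec (γ z s i).1 (γ z s j).1) ((γ z s i).2, (γ z s j).2); let Kc := fun (Fn : Literature.Analysis.FluidPDE.Config (N + 1) (Fin 3) Literature.MathematicalPhysics.KineticTheory.T3 → ℝ → Fin (N + 1) → Fin (N + 1) → ℝ) z => ε / (N + 1 : ℝ) * ∑ᶠ (s : ℝ) (_ : s ∈ Literature.Analysis.FluidPDE.collisionTimes G ε (γ z) ∩ Set.Icc 0 τ), ∑ i : Fin (N + 1), ∑ j : Fin (N + 1), (if i ≠ j ∧ ‖G.sepVec (γ z s i).1 (γ z s j).1‖ = ε then Fn z s i j else 0); Literature.MathematicalPhysics.KineticTheory.localGibbsLaw σ a₀ u₀ θ₀ N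 (Φ N) {z | Kc (fun z s i j => χ (s, (γ z s i).1) * Ξ (ε⁻¹ • G.sepVec (γ z s i).1 (γ z s j).1, (pv z s i j).1, (pv z s i j).2)) z < g₀ * σ ^ 3 * (∫ s in Set.Icc (0 : ℝ) τ, ∫ x : UnitAddTorus (Fin 3), χ (s, x) * B Ξ z s x) - η} ≤ ENNReal.ofReal δ

/-- **`EqSuperExpDeficitKinetic`** (S11_kin): the kinetic-scale deficit event under the standard homogeneous Gibbs law has probability
`≤ exp(−L(N+1))` for every `L`, `λ ≥ λ₀(L, η, …)`, `N ≥ N₀`.  Heuristically TRUE (genuinely super-exponential, see §7⅞ header); not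
provable with tree tools. [folklore] -/
def EqSuperExpDeficitKinetic : Prop :=
  ∃ g₀ : ℝ, 0 < g₀ ∧ ∃ σ₀ : ℝ, 0 < σ₀ ∧ ∀ σ : ℝ, 0 < σ → σ < σ₀ → ∀ Φ : (N : ℕ) → Literature.Analysis.FluidPDE.HardSphereFlow (Literature.Analysis.FluidPDE.Torus.geometry (Fin 3)) (Literature.MathematicalPhysics.KineticTheory.hsDiameter σ N) (N + 1), ∀ τ : ℝ, 0 < τ → ∀ χ : ℝ × UnitAddTorus (Fin 3) → ℝ, Continuous χ → (∀ p, 0 ≤ χ p) → ∀ Ξ : EuclideanSpace ℝ (Fin 3) × EuclideanSpace ℝ (Fin 3) × EuclideanSpace ℝ (Fin 3) → ℝ, Continuous Ξ → (∀ q, 0 ≤ Ξ q) → (∃ C : ℝ, ∀ q, Ξ q ≤ C) → ∀ η : ℝ, 0 < η → ∀ L : ℝ, ∃ lam₀ : ℝ, 0 < lam₀ ∧ ∀ lam : ℝ, lam₀ ≤ lam → ∃ N₀ : ℕ, ∀ N : ℕ, N₀ ≤ N → let r : ℝ := lam * ((N + 1 : ℕ) : ℝ) ^ (-(1 / 3 :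 ℝ)); let ε := Literature.MathematicalPhysics.KineticTheory.hsDiameter σ N; let G := Literature.Analysis.FluidPDE.Torus.geometry (Fin 3); let γ := fun z (s : ℝ) => (Φ N).flow s z; let bx : UnitAddTorus (Fin 3) → UnitAddTorus (Fin 3) → ℝ := fun x y => 3 / (Real.pi * r ^ 3) * max (1 - Literature.Analysis.FluidPDE.Torus.euclidDist x y / r) 0; let Θ := fun (Ξ : EuclideanSpace ℝ (Fin 3) × EuclideanSpace ℝ (Fin 3) × EuclideanSpace ℝ (Fin 3) → ℝ) (v w : EuclideanSpace ℝ (Fin 3)) => ∫ ω : Metric.sphere (0 : EuclideanSpace ℝ (Fin 3)) 1, Ξ ((ω : EuclideanSpace ℝ (Fin 3)), v, w) * Literature.MathematicalPhysics.KineticTheory.hardSphereKernel (w, v) ω ∂Literature.MathematicalPhysics.KineticTheory.sphereMeasure; let B := fun Ξ z s (x₀ : UnitAddTorus (Fin 3)) => ∫ p, bx p.1.1 x₀ * bx p.2.1 x₀ * Θ Ξ p.1.2 p.2.2 ∂((Literature.Analysis.FluidPDE.empiricalMeasure (γ z s)).prod (Literature.Analysis.FluidPDE.empiricalMeasure (γ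 z s))); let pv := fun z s (i j : Fin (N + 1)) => Literature.Analysis.FluidPDE.reflectVel (G.sepVec (γ z s i).1 (γ z s j).1) ((γ z s i).2, (γ z s j).2); let Kc := fun (Fn : Literature.Analysis.FluidPDE.Config (N + 1) (Fin 3) Literature.MathematicalPhysics.KineticTheory.T3 → ℝ → Fin (N + 1) → Fin (N + 1) → ℝ) z => ε / (N + 1 : ℝ) * ∑ᶠ (s : ℝ) (_ : s ∈ Literature.Analysis.FluidPDE.collisionTimes G ε (γ z) ∩ Set.Icc 0 τ), ∑ i : Fin (N + 1), ∑ j : Fin (N + 1), (if i ≠ j ∧ ‖G.sepVec (γ z s i).1 (γ z s j).1‖ = ε then Fn z s i j else 0); Literature.MathematicalPhysics.KineticTheory.localGibbsLaw σ (fun _ => (1 : ℝ)) (fun _ => (0 : EuclideanSpace ℝ (Fin 3))) (fun _ => (1 : ℝ)) N (Φ N) {z | Kc (fun z s i j => χ (s, (γ z s i).1) * Ξ (ε⁻¹ • G.sepVec (γ z s i).1 (γ z s j).1, (pv z s i j).1, (pv z s i j).2)) z < g₀ * σ ^ 3 * (∫ s in Set.Icc (0 : ℝ) τ, ∫ x :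 UnitAddTorus (Fin 3), χ (s, x) * B Ξ z s x) - η} ≤ ENNReal.ofReal (Real.exp (-(L * ((N : ℝ) + 1))))

/-- The kinetic-scale entropy class (intermediate def). [folklore] -/
def EntropyClassRateFloorKinetic : Prop :=
  ∃ g₀ : ℝ, 0 < g₀ ∧ ∃ σ₀ : ℝ, 0 < σ₀ ∧ ∀ σ : ℝ, 0 < σ → σ < σ₀ → ∀ Φ : (N : ℕ) → Literature.Analysis.FluidPDE.HardSphereFlow (Literature.Analysis.FluidPDE.Torus.geometry (Fin 3)) (Literature.MathematicalPhysics.KineticTheory.hsDiameter σ N) (N + 1), ∀ τ : ℝ, 0 < τ → ∀ χ : ℝ × UnitAddTorus (Fin 3) → ℝ, Continuous χ → (∀ p, 0 ≤ χ p) → ∀ Ξ : EuclideanSpace ℝ (Fin 3) × EuclideanSpace ℝ (Fin 3) × EuclideanSpace ℝ (Fin 3) → ℝ, Continuous Ξ → (∀ q, 0 ≤ Ξ q) → (∃ C : ℝ, ∀ q, Ξ q ≤ C) → ∀ K η δ : ℝ, 0 < η → 0 < δ → ∃ lam₀ : ℝ, 0 < lam₀ ∧ ∀ lam : ℝ, lam₀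 ≤ lam → ∃ N₀ : ℕ, ∀ N : ℕ, N₀ ≤ N → ∀ μ : MeasureTheory.Measure (Literature.Analysis.FluidPDE.Config (N + 1) (Fin 3) Literature.MathematicalPhysics.KineticTheory.T3), MeasureTheory.IsProbabilityMeasure μ → InformationTheory.klDiv μ (Literature.MathematicalPhysics.KineticTheory.localGibbsLaw σ (fun _ => (1 : ℝ)) (fun _ => (0 : EuclideanSpace ℝ (Fin 3))) (fun _ => (1 : ℝ)) N (Φ N)) ≤ ENNReal.ofReal (K * ((N : ℝ) + 1)) → let r : ℝ := lam * ((N + 1 : ℕ) : ℝ) ^ (-(1 / 3 : ℝ)); let ε := Literature.MathematicalPhysics.KineticTheory.hsDiameter σ N; let G := Literature.Analysis.FluidPDE.Torus.geometry (Fin 3); let γ := fun z (s : ℝ) => (Φ N).flow s z; let bx : UnitAddTorus (Fin 3) → UnitAddTorus (Fin 3) → ℝ := fun x y => 3 / (Real.pi * r ^ 3) * max (1 - Literature.Analysis.FluidPDE.Torus.euclidDist x y / r) 0; let Θ := fun (Ξ : EuclideanSpace ℝ (Fin 3) × EuclideanSpace ℝ (Fin 3) × EuclideanSpace ℝ (Fin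 3) → ℝ) (v w : EuclideanSpace ℝ (Fin 3)) => ∫ ω : Metric.sphere (0 : EuclideanSpace ℝ (Fin 3)) 1, Ξ ((ω : EuclideanSpace ℝ (Fin 3)), v, w) * Literature.MathematicalPhysics.KineticTheory.hardSphereKernel (w, v) ω ∂Literature.MathematicalPhysics.KineticTheory.sphereMeasure; let B := fun Ξ z s (x₀ : UnitAddTorus (Fin 3)) => ∫ p, bx p.1.1 x₀ * bx p.2.1 x₀ * Θ Ξ p.1.2 p.2.2 ∂((Literature.Analysis.FluidPDE.empiricalMeasure (γ z s)).prod (Literature.Analysis.FluidPDE.empiricalMeasure (γ z s))); let pv := fun z s (i j : Fin (N + 1)) => Literature.Analysis.FluidPDE.reflectVel (G.sepVec (γ z s i).1 (γ z s j).1) ((γ z s i).2, (γ z s j).2); let Kc := fun (Fn : Literature.Analysis.FluidPDE.Config (N + 1) (Fin 3) Literature.MathematicalPhysics.KineticTheory.T3 → ℝ → Fin (N + 1) → Fin (N + 1) → ℝ) z => ε / (N + 1 : ℝ) * ∑ᶠ (s : ℝ) (_ : s ∈ Literature.Analysis.FluidPDE.collisionTimes G ε (γ z) ∩ Set.Icc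 0 τ), ∑ i : Fin (N + 1), ∑ j : Fin (N + 1), (if i ≠ j ∧ ‖G.sepVec (γ z s i).1 (γ z s j).1‖ = ε then Fn z s i j else 0); μ {z | Kc (fun z s i j => χ (s, (γ z s i).1) * Ξ (ε⁻¹ • G.sepVec (γ z s i).1 (γ z s j).1, (pv z s i j).1, (pv z s i j).2)) z < g₀ * σ ^ 3 * (∫ s in Set.Icc (0 : ℝ) τ, ∫ x : UnitAddTorus (Fin 3), χ (s, x) * B Ξ z s x) - η} ≤ ENNReal.ofReal δ

/-- **Kinetic entropy class from the kinetic super-exponential bound** (PROVED; §7½ verbatim with `λ` for `r`). [cite: KipnisLandim1999, Appendix 1 Prop. 8.2] -/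
theorem entropyClassRateFloorKinetic_of_eqSuperExpDeficitKinetic (h : EqSuperExpDeficitKinetic) : EntropyClassRateFloorKinetic := by
  obtain ⟨g₀, hg₀, σ₀, hσ₀, h⟩ := h
  refine ⟨g₀, hg₀, min σ₀ 2⁻¹, lt_min hσ₀ (by norm_num), ?_⟩
  intro σ hσ hσlt' Φ τ hτ χ hχc hχ0 Ξ hΞc hΞ0 hΞC K η δ hη hδ
  have hσlt : σ < σ₀ := hσlt'.trans_le (min_le_left _ _)
  have hσ2 : σ ≤ 1 / 2 := by
    have := hσlt'.trans_le (min_le_right σ₀ 2⁻¹)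
    rw [one_div]; exact this.le
  set K' : ℝ := max K 0 with hK'
  have hK'0 : 0 ≤ K' := le_max_right _ _
  set L : ℝ := (Real.log 2 + K' + 1) / δ with hL
  have hlog : 0 < Real.log 2 := Real.log_pos (by norm_num)
  have hLpos : 0 < L := by positivity
  obtain ⟨lam₀, hlam₀, h⟩ := h σ hσ hσlt Φ τ hτ χ hχc hχ0 Ξ hΞc hΞ0 hΞC η hη L
  refine ⟨lam₀, hlam₀, fun lam hlam => ?_⟩
  obtain ⟨N₀, hN⟩ := h lam hlam
  refine ⟨N₀, fun N hNN μ hμ hKL => ?_⟩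
  have h1 := hN N hNN
  intro r ε G γ bx Θ B pv Kc
  haveI : MeasureTheory.IsProbabilityMeasure μ := hμ
  haveI : MeasureTheory.IsProbabilityMeasure (Literature.MathematicalPhysics.KineticTheory.localGibbsLaw σ
      (fun _ => (1 : ℝ)) (fun _ => (0 : EuclideanSpace ℝ (Fin 3))) (fun _ => (1 : ℝ)) N (Φ N)) :=
    isProbabilityMeasure_localGibbsLaw (a₀ := fun _ => (1 : ℝ)) (θ₀ := fun _ => (1 : ℝ))
      (u₀ := fun _ => (0 : EuclideanSpace ℝ (Fin 3))) continuous_const continuous_const continuous_const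
      (fun _ => one_pos) (fun _ => one_pos) hσ2 N (Φ N)
  have hn1 : (1 : ℝ) ≤ (N : ℝ) + 1 := by
    have : (0 : ℝ) ≤ (N : ℝ) := Nat.cast_nonneg N
    linarith
  have hGpos : 0 < L * ((N : ℝ) + 1) := by positivity
  have hKL' : InformationTheory.klDiv μ (Literature.MathematicalPhysics.KineticTheory.localGibbsLaw σ
      (fun _ => (1 : ℝ)) (fun _ => (0 : EuclideanSpace ℝ (Fin 3))) (fun _ => (1 : ℝ)) N (Φ N)) ≤
      ENNReal.ofReal (K' * ((N : ℝ) + 1)) :=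
    hKL.trans (ENNReal.ofReal_le_ofReal (mul_le_mul_of_nonneg_right (le_max_left _ _) (by positivity)))
  have e1 : Literature.MathematicalPhysics.KineticTheory.localGibbsLaw σ (fun _ => (1 : ℝ))
      (fun _ => (0 : EuclideanSpace ℝ (Fin 3))) (fun _ => (1 : ℝ)) N (Φ N)
      {z | Kc (fun z s i j => χ (s, (γ z s i).1) *
        Ξ (ε⁻¹ • G.sepVec (γ z s i).1 (γ z s j).1, (pv z s i j).1, (pv z s i j).2)) z <
        g₀ * σ ^ 3 * (∫ s in Set.Icc (0 : ℝ) τ, ∫ x : UnitAddTorus (Fin 3), χ (s, x) * B Ξ z s x) - η} ≤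
      ENNReal.ofReal (Real.exp (-(L * ((N : ℝ) + 1)))) := h1
  have h2 := measure_le_of_klDiv_le_hull μ _ _ hGpos (by positivity : (0 : ℝ) ≤ K' * ((N : ℝ) + 1)) e1 hKL'
  refine h2.trans (ENNReal.ofReal_le_ofReal ?_)
  rw [hL]
  exact entropy_transfer_arith hK'0 hδ hn1

/-- **The kinetic crux from the kinetic entropy class** (PROVED; budget from `exists_localGibbsLaw_dominated`). [cite: KipnisLandim1999, Ch. 6 §1] -/
theorem rateFloorKinetic_of_entropyClassRateFloorKinetic (h : EntropyClassRateFloorKinetic) : RateFloorKinetic := by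
  obtain ⟨g₀, hg₀, σ₁, hσ₁, h⟩ := h
  refine ⟨g₀, hg₀, fun a₀ θ₀ u₀ ha hθ hu ha0 hθ0 => ?_⟩
  refine ⟨min σ₁ 2⁻¹, lt_min hσ₁ (by norm_num), ?_⟩
  intro σ hσ hσlt Φ τ hτ χ hχc hχ0 Ξ hΞc hΞ0 hΞC η δ hη hδ
  have hσ₁' : σ < σ₁ := hσlt.trans_le (min_le_left _ _)
  have hσ2 : σ ≤ 1 / 2 := by
    have := hσlt.trans_le (min_le_right σ₁ 2⁻¹)
    rw [one_div]; exact this.le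
  obtain ⟨A, b, hA, hb, hdom⟩ :=
    Summit.AtomisticToContinuum.HydrodynamicLimit.Theorems.LambertianContactSwapSwapGapGibbsDomination.exists_localGibbsLaw_dominated
      ha hθ hu ha0 hθ0 hσ2
  obtain ⟨lam₀, hlam₀, h⟩ := h σ hσ hσ₁' Φ τ hτ χ hχc hχ0 Ξ hΞc hΞ0 hΞC A η δ hη hδ
  refine ⟨lam₀, hlam₀, fun lam hlam => ?_⟩
  obtain ⟨N₀, hN⟩ := h lam hlam
  refine ⟨N₀, fun N hNN => ?_⟩
  have hP : MeasureTheory.IsProbabilityMeasure (Literature.MathematicalPhysics.KineticTheory.localGibbsLaw σ a₀ u₀ θ₀ N (Φ N)) :=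
    isProbabilityMeasure_localGibbsLaw ha hθ hu ha0 hθ0 hσ2 N (Φ N)
  obtain ⟨-, -, hKL, -, -⟩ := hdom N (Φ N)
  exact hN N hNN (Literature.MathematicalPhysics.KineticTheory.localGibbsLaw σ a₀ u₀ θ₀ N (Φ N)) hP hKL

/-- **REPAIR (a) IN ONE LINE: `EqSuperExpDeficitKinetic → RateFloorKinetic`** (PROVED composition). [folklore] -/
theorem rateFloorKinetic_of_eqSuperExpDeficitKinetic (h : EqSuperExpDeficitKinetic) : RateFloorKinetic :=
  rateFloorKinetic_of_entropyClassRateFloorKinetic (entropyClassRateFloorKinetic_of_eqSuperExpDeficitKinetic h)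

/-! ## §8 The crux from the gen-1 stubs (the SECOND composition, gen 1; proved) -/

/-- A continuous weight is bounded on the compact slab `[0, τ] × 𝕋³`. [folklore] -/
theorem exists_bound_on_slab (χ : ℝ × UnitAddTorus (Fin 3) → ℝ) (hχ : Continuous χ) (τ : ℝ) :
    ∃ Mχ : ℝ, 0 ≤ Mχ ∧ ∀ u ∈ Set.Icc (0 : ℝ) τ, ∀ x : UnitAddTorus (Fin 3), χ (u, x) ≤ Mχ := by
  have hK : IsCompact ((Set.Icc (0 : ℝ) τ) ×ˢ (Set.univ : Set (UnitAddTorus (Fin 3)))) :=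
    isCompact_Icc.prod isCompact_univ
  obtain ⟨C, hC⟩ := hK.bddAbove_image hχ.continuousOn
  refine ⟨max C 0, le_max_right _ _, fun u hu x => (le_max_left C 0).trans' ?_⟩
  exact hC ⟨(u, x), ⟨hu, Set.mem_univ _⟩, rfl⟩

/-- The arithmetic of the three-way split of `η` (kept separate so that no tactic normalises the crux's large
subterms): `K ≥ S_R ≥ S_W − X`, `X ≤ η/3`, `S_W ≥ I − η/3` contradict `K < I − η`. [folklore] -/
theorem deficit_arith {K SR SW X I η : ℝ} (hη : 0 < η) (hz : K < I - η) (hKR : SR ≤ K) (hWR : SW ≤ SR + X)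
    (hX : X ≤ η / 3) (hcb : ¬ SW < I - η / 3) : False := by
  push Not at hcb
  linarith

/-- `M·(ε/n·Bu) ≤ η/3` from `ε/n·Bu ≤ η/(3(M+1))`. [folklore] -/
theorem burst_term_le {M c Bu η : ℝ} (hM : 0 ≤ M) (hη : 0 < η)
    (hca : ¬ η / (3 * (M + 1)) < c * Bu) : c * M * Bu ≤ η / 3 := by
  have h1 : c * M * Bu = M * (c * Bu) := by ring
  have h2 : M * (c * Bu) ≤ M * (η / (3 * (M + 1))) := mul_le_mul_of_nonneg_left (not_lt.1 hca) hM
  have h3 : M * (η / (3 * (M + 1))) = η / 3 * (M / (M + 1)) := by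
    field_simp
  have h4 : M / (M + 1) ≤ 1 := (div_le_one (by linarith)).2 (by linarith)
  have h5 : η / 3 * (M / (M + 1)) ≤ η / 3 := mul_le_of_le_one_right (by linarith) h4
  linarith

/-- The body of S7a `NoBursts` AT GIVEN PROFILES (the registered text after its profile prefix). [folklore] -/
def NoBurstsAt (a₀ θ₀ : Literature.MathematicalPhysics.KineticTheory.T3 → ℝ)
    (u₀ : Literature.MathematicalPhysics.KineticTheory.T3 → Literature.MathematicalPhysics.KineticTheory.V3) : Prop :=
  ∃ σ₀ : ℝ, 0 < σ₀ ∧ ∀ σ : ℝ, 0 < σ → σ < σ₀ → ∀ Φ : (N : ℕ) → Literature.Analysis.FluidPDE.HardSphereFlow (Literature.Analysis.FluidPDE.Torus.geometry (Fin 3)) (Literature.MathematicalPhysics.KineticTheory.hsDiameter σ N) (N + 1), ∀ τ : ℝ, 0 < τ → ∀ η δ : ℝ, 0 < η → 0 < δ → ∃ A : ℝ, 0 < A ∧ ∃ b : ℝ, 1 / 3 ≤ b ∧ b ≤ 1 ∧ ∃ N₀ : ℕ, ∀ N : ℕ, N₀ ≤ N → let ε := Literature.MathematicalPhysics.KineticTheory.hsDiameter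 σ N; let γ := fun z (s : ℝ) => (Φ N).flow s z; Literature.MathematicalPhysics.KineticTheory.localGibbsLaw σ a₀ u₀ θ₀ N (Φ N) {z | η < ε / (N + 1 : ℝ) * lineBursts ε (windowLenB A b N) τ (γ z)} ≤ ENNReal.ofReal δ

/-- The body of S7b `StaticOpacityFloor` AT GIVEN PROFILES and floor constant `g₃`. [folklore] -/
def StaticOpacityFloorAt (g₃ : ℝ) (a₀ θ₀ : Literature.MathematicalPhysics.KineticTheory.T3 → ℝ)
    (u₀ : Literature.MathematicalPhysics.KineticTheory.T3 → Literature.MathematicalPhysics.KineticTheory.V3) : Prop :=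
  ∃ σ₀ : ℝ, 0 < σ₀ ∧ ∀ σ : ℝ, 0 < σ → σ < σ₀ → ∀ Φ : (N : ℕ) → Literature.Analysis.FluidPDE.HardSphereFlow (Literature.Analysis.FluidPDE.Torus.geometry (Fin 3)) (Literature.MathematicalPhysics.KineticTheory.hsDiameter σ N) (N + 1), ∀ τ : ℝ, 0 < τ → ∀ χ : ℝ × UnitAddTorus (Fin 3) → ℝ, Continuous χ → (∀ p, 0 ≤ χ p) → ∀ Ξ : EuclideanSpace ℝ (Fin 3) × EuclideanSpace ℝ (Fin 3) × EuclideanSpace ℝ (Fin 3) → ℝ, Continuous Ξ → (∀ q, 0 ≤ Ξ q) → (∃ C : ℝ, ∀ q, Ξ q ≤ C) → ∀ η δ : ℝ, 0 < η → 0 < δ → ∃ r₀ : ℝ, 0 < r₀ ∧ ∀ r : ℝ, 0 < r → r < r₀ → ∀ A : ℝ, 0 < A → ∀ b : ℝ, 1 / 3 ≤ b → b ≤ 1 → ∃ N₀ : ℕ, ∀ N : ℕ, N₀ ≤ N → let ε := Literature.MathematicalPhysics.KineticTheory.hsDiameter σ N; let G := Literature.Analysis.FluidPDE.Torus.geometry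 (Fin 3); let γ := fun z (s : ℝ) => (Φ N).flow s z; let bx : UnitAddTorus (Fin 3) → UnitAddTorus (Fin 3) → ℝ := fun x y => 3 / (Real.pi * r ^ 3) * max (1 - Literature.Analysis.FluidPDE.Torus.euclidDist x y / r) 0; let Θ := fun (Ξ : EuclideanSpace ℝ (Fin 3) × EuclideanSpace ℝ (Fin 3) × EuclideanSpace ℝ (Fin 3) → ℝ) (v w : EuclideanSpace ℝ (Fin 3)) => ∫ ω : Metric.sphere (0 : EuclideanSpace ℝ (Fin 3)) 1, Ξ ((ω : EuclideanSpace ℝ (Fin 3)), v, w) * Literature.MathematicalPhysics.KineticTheory.hardSphereKernel (w, v) ω ∂Literature.MathematicalPhysics.KineticTheory.sphereMeasure; let B := fun Ξ z s (x₀ : UnitAddTorus (Fin 3)) => ∫ p, bx p.1.1 x₀ * bx p.2.1 x₀ * Θ Ξ p.1.2 p.2.2 ∂((Literature.Analysis.FluidPDE.empiricalMeasure (γ z s)).prod (Literature.Analysis.FluidPDE.empiricalMeasure (γ z s))); let SW := fun (z : Literature.Analysis.FluidPDE.Config (N + 1) (Fin 3) Literature.MathematicalPhysics.KineticTheory.T3)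 => lineSW ε (windowLenB A b N) τ (γ z) (fun u x y v w => χ (u, x) * Ξ (ε⁻¹ • G.sepVec x y, v, w)); Literature.MathematicalPhysics.KineticTheory.localGibbsLaw σ a₀ u₀ θ₀ N (Φ N) {z | SW z < g₃ * σ ^ 3 * (∫ s in Set.Icc (0 : ℝ) τ, ∫ x : UnitAddTorus (Fin 3), χ (s, x) * B Ξ z s x) - η} ≤ ENNReal.ofReal δ

/-- The body of the crux `RateFloor` AT GIVEN PROFILES and floor constant `g₀` (verbatim from the route file). [folklore] -/
def RateFloorAt (g₀ : ℝ) (a₀ θ₀ : Literature.MathematicalPhysics.KineticTheory.T3 → ℝ)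
    (u₀ : Literature.MathematicalPhysics.KineticTheory.T3 → Literature.MathematicalPhysics.KineticTheory.V3) : Prop :=
  ∃ σ₀ : ℝ, 0 < σ₀ ∧ ∀ σ : ℝ, 0 < σ → σ < σ₀ → ∀ Φ : (N : ℕ) → Literature.Analysis.FluidPDE.HardSphereFlow (Literature.Analysis.FluidPDE.Torus.geometry (Fin 3)) (Literature.MathematicalPhysics.KineticTheory.hsDiameter σ N) (N + 1), ∀ τ : ℝ, 0 < τ → ∀ χ : ℝ × UnitAddTorus (Fin 3) → ℝ, Continuous χ → (∀ p, 0 ≤ χ p) → ∀ Ξ : EuclideanSpace ℝ (Fin 3) × EuclideanSpace ℝ (Fin 3) × EuclideanSpace ℝ (Fin 3) → ℝ, Continuous Ξ → (∀ q, 0 ≤ Ξ q) → (∃ C : ℝ, ∀ q, Ξ q ≤ C) → ∀ η δ : ℝ, 0 < η → 0 < δ → ∃ r₀ : ℝ, 0 < r₀ ∧ ∀ r : ℝ, 0 < r → r < r₀ → ∃ N₀ : ℕ, ∀ N : ℕ, N₀ ≤ N → let ε := Literature.MathematicalPhysics.KineticTheory.hsDiameter σ N; let G := Literature.Analysis.FluidPDE.Torus.geometry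 (Fin 3); let γ := fun z (s : ℝ) => (Φ N).flow s z; let bx : UnitAddTorus (Fin 3) → UnitAddTorus (Fin 3) → ℝ := fun x y => 3 / (Real.pi * r ^ 3) * max (1 - Literature.Analysis.FluidPDE.Torus.euclidDist x y / r) 0; let Θ := fun (Ξ : EuclideanSpace ℝ (Fin 3) × EuclideanSpace ℝ (Fin 3) × EuclideanSpace ℝ (Fin 3) → ℝ) (v w : EuclideanSpace ℝ (Fin 3)) => ∫ ω : Metric.sphere (0 : EuclideanSpace ℝ (Fin 3)) 1, Ξ ((ω : EuclideanSpace ℝ (Fin 3)), v, w) * Literature.MathematicalPhysics.KineticTheory.hardSphereKernel (w, v) ω ∂Literature.MathematicalPhysics.KineticTheory.sphereMeasure; let B := fun Ξ z s (x₀ : UnitAddTorus (Fin 3)) => ∫ p, bx p.1.1 x₀ * bx p.2.1 x₀ * Θ Ξ p.1.2 p.2.2 ∂((Literature.Analysis.FluidPDE.empiricalMeasure (γ z s)).prod (Literature.Analysis.FluidPDE.empiricalMeasure (γ z s))); let pv := fun z s (i j : Fin (N + 1)) => Literature.Analysis.FluidPDE.reflectVel (G.sepVec (γ z s i).1 (γ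 z s j).1) ((γ z s i).2, (γ z s j).2); let Kc := fun (Fn : Literature.Analysis.FluidPDE.Config (N + 1) (Fin 3) Literature.MathematicalPhysics.KineticTheory.T3 → ℝ → Fin (N + 1) → Fin (N + 1) → ℝ) z => ε / (N + 1 : ℝ) * ∑ᶠ (s : ℝ) (_ : s ∈ Literature.Analysis.FluidPDE.collisionTimes G ε (γ z) ∩ Set.Icc 0 τ), ∑ i : Fin (N + 1), ∑ j : Fin (N + 1), (if i ≠ j ∧ ‖G.sepVec (γ z s i).1 (γ z s j).1‖ = ε then Fn z s i j else 0); Literature.MathematicalPhysics.KineticTheory.localGibbsLaw σ a₀ u₀ θ₀ N (Φ N) {z | Kc (fun z s i j => χ (s, (γ z s i).1) * Ξ (ε⁻¹ • G.sepVec (γ z s i).1 (γ z s j).1, (pv z s i j).1, (pv z s i j).2)) z < g₀ * σ ^ 3 * (∫ s in Set.Icc (0 : ℝ) τ, ∫ x : UnitAddTorus (Fin 3), χ (s, x) * B Ξ z s x) - η} ≤ ENNReal.ofReal δ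

/-- `RateFloor` is its body quantified over continuous positive profiles (definitional). [folklore] -/
theorem rateFloor_iff_forall_rateFloorAt :
    RateFloor ↔ ∃ g₀ : ℝ, 0 < g₀ ∧ ∀ (a₀ θ₀ : Literature.MathematicalPhysics.KineticTheory.T3 → ℝ)
      (u₀ : Literature.MathematicalPhysics.KineticTheory.T3 → Literature.MathematicalPhysics.KineticTheory.V3),
      Continuous a₀ → Continuous θ₀ → Continuous u₀ → (∀ x, 0 < a₀ x) → (∀ x, 0 < θ₀ x) → RateFloorAt g₀ a₀ θ₀ u₀ :=
  Iff.rfl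

/-- **The composition AT GIVEN PROFILES** (the one proof behind both the general and the rung-0 compositions): the sure
transfer `K ≥ S_R ≥ S_W − (ε/n)·M·Bursts` on good points (S6a, S6d, S8 — landed, used as theorems; S10 — hypothesis), the
burst event from `NoBurstsAt` and the static floor from `StaticOpacityFloorAt g₃`, by a union bound: `σ₀ := min σa σb ½`,
`η ↦ (η/(3(M+1)), η/3)`, `δ ↦ (δ/2, δ/2)`, `(A, b)` from the burst statement, `r₀` from the floor, `N₀ := max`; the floor
constant passes through unchanged (`g₀ = g₃`). [folklore] -/
theorem rateFloorAt_of (hS10 : Stubs.stub_preemptionCharge)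
    {a₀ θ₀ : Literature.MathematicalPhysics.KineticTheory.T3 → ℝ}
    {u₀ : Literature.MathematicalPhysics.KineticTheory.T3 → Literature.MathematicalPhysics.KineticTheory.V3} {g₃ : ℝ}
    (hA : NoBurstsAt a₀ θ₀ u₀) (hB : StaticOpacityFloorAt g₃ a₀ θ₀ u₀) : RateFloorAt g₃ a₀ θ₀ u₀ := by
  -- the landed gen-0 stubs S6a, S6d, S8 are used as THEOREMS (imported above), not as hypotheses
  have hS6d : MarkedRealisedTransfer := stub_markedTransfer stub_realisedDatum
  have hS8 : Stubs.stub_pathwiseTransfer := stub_pathwiseTransfer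
  unfold NoBurstsAt at hA
  unfold StaticOpacityFloorAt at hB
  unfold RateFloorAt
  obtain ⟨σa, hσa, hA⟩ := hA
  obtain ⟨σb, hσb, hB⟩ := hB
  refine ⟨min (min σa σb) 2⁻¹, lt_min (lt_min hσa hσb) (by norm_num), ?_⟩
  intro σ hσ hσlt Φ τ hτ χ hχc hχ0 Ξ hΞc hΞ0 hΞC η δ hη hδ
  have hσa' : σ < σa := hσlt.trans_le ((min_le_left _ _).trans (min_le_left _ _))
  have hσb' : σ < σb := hσlt.trans_le ((min_le_left _ _).trans (min_le_right _ _))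
  have hσ2 : σ < 2⁻¹ := hσlt.trans_le (min_le_right _ _)
  -- a bound `M` on the mark `χ·Ξ` over `[0, τ]`
  obtain ⟨C, hC⟩ := hΞC
  obtain ⟨Mχ, hMχ0, hMχ⟩ := exists_bound_on_slab χ hχc τ
  obtain ⟨M, hM0, hMb⟩ : ∃ M : ℝ, 0 ≤ M ∧ ∀ u ∈ Set.Icc (0 : ℝ) τ, ∀ (x : UnitAddTorus (Fin 3))
      (q : EuclideanSpace ℝ (Fin 3) × EuclideanSpace ℝ (Fin 3) × EuclideanSpace ℝ (Fin 3)), χ (u, x) * Ξ q ≤ M :=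
    ⟨Mχ * max C 0, mul_nonneg hMχ0 (le_max_right _ _), fun u hu x q =>
      mul_le_mul (hMχ u hu x) ((hC q).trans (le_max_left _ _)) (hΞ0 q) hMχ0⟩
  -- S7a with `η/(3(M+1))`, `δ/2`
  have hηa : 0 < η / (3 * (M + 1)) := div_pos hη (by positivity)
  obtain ⟨A, hApos, b, hb1, hb2, Na, hA⟩ := hA σ hσ hσa' Φ τ hτ (η / (3 * (M + 1))) (δ / 2) hηa (half_pos hδ)
  -- S7b with `η/3`, `δ/2`
  obtain ⟨r₀, hr₀, hB⟩ := hB σ hσ hσb' Φ τ hτ χ hχc hχ0 Ξ hΞc hΞ0 ⟨C, hC⟩ (η / 3) (δ / 2) (by positivity)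
    (half_pos hδ)
  refine ⟨r₀, hr₀, ?_⟩
  intro r hr hrlt
  obtain ⟨Nb, hB⟩ := hB r hr hrlt A hApos b hb1 hb2
  refine ⟨max Na Nb, ?_⟩
  intro N hN
  have h1 := hA N ((le_max_left _ _).trans hN)
  have h2 := hB N ((le_max_right _ _).trans hN)
  intro ε G γ bx Θ B pv Kc
  have e1 : Literature.MathematicalPhysics.KineticTheory.localGibbsLaw σ a₀ u₀ θ₀ N (Φ N)
      {z | η / (3 * (M + 1)) < ε / (N + 1 : ℝ) * lineBursts ε (windowLenB A b N) τ (γ z)} ≤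
      ENNReal.ofReal (δ / 2) := h1
  have e2 : Literature.MathematicalPhysics.KineticTheory.localGibbsLaw σ a₀ u₀ θ₀ N (Φ N)
      {z | lineSW ε (windowLenB A b N) τ (γ z) (fun u x y v w => χ (u, x) * Ξ (ε⁻¹ • G.sepVec x y, v, w)) <
        g₃ * σ ^ 3 * (∫ s in Set.Icc (0 : ℝ) τ, ∫ x : UnitAddTorus (Fin 3), χ (s, x) * B Ξ z s x) - η / 3} ≤
      ENNReal.ofReal (δ / 2) := h2
  -- facts along good trajectories
  have hε : 0 < ε := hsDiameter_pos hσ N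
  have hεlt : ε < 2⁻¹ := (hsDiameter_le hσ.le N).trans_lt hσ2
  have hΔ : 0 < windowLenB A b N := mul_pos hApos (Real.rpow_pos_of_pos (by positivity) _)
  have hF0 : ∀ (u : ℝ) (x y : T3) (v w : V3), 0 ≤ χ (u, x) * Ξ (ε⁻¹ • G.sepVec x y, v, w) :=
    fun u x y v w => mul_nonneg (hχ0 _) (hΞ0 _)
  have hFM : ∀ u ∈ Set.Icc (0 : ℝ) τ, ∀ (x y : T3) (v w : V3), χ (u, x) * Ξ (ε⁻¹ • G.sepVec x y, v, w) ≤ M :=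
    fun u hu x y v w => hMb u hu x _
  have hgood : Literature.MathematicalPhysics.KineticTheory.localGibbsLaw σ a₀ u₀ θ₀ N (Φ N) (Φ N).goodᶜ = 0 := by
    rw [Literature.MathematicalPhysics.KineticTheory.localGibbsLaw, particleLaw_eq]
    exact withDensity_absolutelyContinuous _ _ (Φ N).measure_compl_good
  have hsub : {z | Kc (fun z s i j => χ (s, (γ z s i).1) *
        Ξ (ε⁻¹ • G.sepVec (γ z s i).1 (γ z s j).1, (pv z s i j).1, (pv z s i j).2)) z <
        g₃ * σ ^ 3 * (∫ s in Set.Icc (0 : ℝ) τ, ∫ x : UnitAddTorus (Fin 3), χ (s, x) * B Ξ z s x) - η} ⊆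
      {z | η / (3 * (M + 1)) < ε / (N + 1 : ℝ) * lineBursts ε (windowLenB A b N) τ (γ z)} ∪
      {z | lineSW ε (windowLenB A b N) τ (γ z) (fun u x y v w => χ (u, x) * Ξ (ε⁻¹ • G.sepVec x y, v, w)) <
        g₃ * σ ^ 3 * (∫ s in Set.Icc (0 : ℝ) τ, ∫ x : UnitAddTorus (Fin 3), χ (s, x) * B Ξ z s x) - η / 3} ∪
      (Φ N).goodᶜ := by
    intro z hz
    by_contra hcon
    have hca : ¬ (η / (3 * (M + 1)) < ε / (N + 1 : ℝ) * lineBursts ε (windowLenB A b N) τ (γ z)) :=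
      fun h => hcon (Or.inl (Or.inl h))
    have hcb : ¬ (lineSW ε (windowLenB A b N) τ (γ z) (fun u x y v w => χ (u, x) * Ξ (ε⁻¹ • G.sepVec x y, v, w)) <
        g₃ * σ ^ 3 * (∫ s in Set.Icc (0 : ℝ) τ, ∫ x : UnitAddTorus (Fin 3), χ (s, x) * B Ξ z s x) - η / 3) :=
      fun h => hcon (Or.inl (Or.inr h))
    have hzg : z ∈ (Φ N).good := by
      by_contra h
      exact hcon (Or.inr h)
    have htraj : IsHardSphereTrajectory G ε (N + 1) (γ z) := (Φ N).isTrajectory z hzg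
    -- sure transfer: K ≥ S_R ≥ S_W - (ε/n) M Bursts
    have hKR := lineSR_le_collisionFunctional hS6d hS8 htraj hε hεlt hΔ hτ.le
      (fun u x y v w => χ (u, x) * Ξ (ε⁻¹ • G.sepVec x y, v, w)) hF0
    have hWR := lineSW_le_lineSR_add hS10 htraj hε hεlt hΔ hτ.le
      (fun u x y v w => χ (u, x) * Ξ (ε⁻¹ • G.sepVec x y, v, w)) hM0 hFM
    -- the burst term is at most η/3
    have hB3 := burst_term_le hM0 hη hca
    have hz' : Kc (fun z s i j => χ (s, (γ z s i).1) *
        Ξ (ε⁻¹ • G.sepVec (γ z s i).1 (γ z s j).1, (pv z s i j).1, (pv z s i j).2)) z <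
        g₃ * σ ^ 3 * (∫ s in Set.Icc (0 : ℝ) τ, ∫ x : UnitAddTorus (Fin 3), χ (s, x) * B Ξ z s x) - η := hz
    exact deficit_arith hη hz' hKR hWR hB3 hcb
  calc Literature.MathematicalPhysics.KineticTheory.localGibbsLaw σ a₀ u₀ θ₀ N (Φ N) _
      ≤ Literature.MathematicalPhysics.KineticTheory.localGibbsLaw σ a₀ u₀ θ₀ N (Φ N) (_ ∪ _ ∪ (Φ N).goodᶜ) :=
        measure_mono hsub
    _ ≤ Literature.MathematicalPhysics.KineticTheory.localGibbsLaw σ a₀ u₀ θ₀ N (Φ N) _ +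
          Literature.MathematicalPhysics.KineticTheory.localGibbsLaw σ a₀ u₀ θ₀ N (Φ N) _ +
          Literature.MathematicalPhysics.KineticTheory.localGibbsLaw σ a₀ u₀ θ₀ N (Φ N) (Φ N).goodᶜ :=
        (measure_union_le _ _).trans (add_le_add (measure_union_le _ _) le_rfl)
    _ ≤ ENNReal.ofReal (δ / 2) + ENNReal.ofReal (δ / 2) + 0 := add_le_add (add_le_add e1 e2) hgood.le
    _ = ENNReal.ofReal δ := by
        rw [add_zero, ← ENNReal.ofReal_add (half_pos hδ).le (half_pos hδ).le, add_halves]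

/-- **`RateFloor` from the gen-1 stubs** — THE SECOND COMPOSITION (hypotheses = the two OPEN registered stubs S7a, S7b by name;
since c4 no longer the first theorem of the file concluding the crux — that is `rateFloor_of_eqSuperExpDeficit`, §7½): `rateFloorAt_of` profile by profile, `g₀ := g₃`; S10 is the landed theorem `stub_preemptionCharge`
(c3: discharged inside, no longer a hypothesis). [folklore] -/
theorem rateFloor_of_noBursts_staticFloor (hS7a : Stubs.stub_noBursts)
    (hS7b : Stubs.stub_staticOpacityFloor) : RateFloor := by
  obtain ⟨g₃, hg₃, hB⟩ := hS7b
  exact ⟨g₃, hg₃, fun a₀ θ₀ u₀ ha hθ hu ha0 hθ0 =>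
    rateFloorAt_of stub_preemptionCharge (hS7a a₀ θ₀ u₀ ha hθ hu ha0 hθ0) (hB a₀ θ₀ u₀ ha hθ hu ha0 hθ0)⟩

/-- **A provable anchor for S7b (not a registered stub): the static opacity floor AT TIME ZERO.**  The `k = 0` window of
S7b in isolation, weighted back by `τ/Δ`: under the local Gibbs law itself (no dynamics), the would-be marked sum of
the initial configuration for the window `(0, Δ_N]` is at least `g₃ σ³ Δ_N ∫ χ(0,·) B^Ξ_r(z, 0, ·) − ηΔ_N`-worth in
probability — precisely: `P( (ε/(N+1)) · wouldBeSum ε Δ z 0 F < Δ · (g₃σ³∫χ(0,x)B^Ξ_r(z,0,x)dx − η) ) ≤ δ` eventually.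
An equilibrium-statistical law of large numbers for a kinetic-scale pair functional under the canonical hard-sphere
measure with continuous profiles (cluster expansion at small `σ`); the recommended first support item if S7b is
promoted. [folklore] -/
def StaticOpacityFloorAtZero : Prop :=
  ∃ g₃ : ℝ, 0 < g₃ ∧ ∀ (a₀ θ₀ : Literature.MathematicalPhysics.KineticTheory.T3 → ℝ) (u₀ : Literature.MathematicalPhysics.KineticTheory.T3 → Literature.MathematicalPhysics.KineticTheory.V3), Continuous a₀ → Continuous θ₀ → Continuous u₀ → (∀ x, 0 < a₀ x) → (∀ x, 0 < θ₀ x) → ∃ σ₀ : ℝ, 0 < σ₀ ∧ ∀ σ : ℝ, 0 < σ → σ < σ₀ → ∀ Φ : (N : ℕ) → Literature.Analysis.FluidPDE.HardSphereFlow (Literature.Analysis.FluidPDE.Torus.geometry (Fin 3)) (Literature.MathematicalPhysics.KineticTheory.hsDiameter σ N) (N + 1), ∀ χ : UnitAddTorus (Fin 3) → ℝ, Continuous χ → (∀ p, 0 ≤ χ p) → ∀ Ξ : EuclideanSpace ℝ (Fin 3) × EuclideanSpace ℝ (Fin 3) × EuclideanSpace ℝ (Fin 3) → ℝ, Continuous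 Ξ → (∀ q, 0 ≤ Ξ q) → (∃ C : ℝ, ∀ q, Ξ q ≤ C) → ∀ η δ : ℝ, 0 < η → 0 < δ → ∃ r₀ : ℝ, 0 < r₀ ∧ ∀ r : ℝ, 0 < r → r < r₀ → ∀ A : ℝ, 0 < A → ∀ b : ℝ, 1 / 3 ≤ b → b ≤ 1 → ∃ N₀ : ℕ, ∀ N : ℕ, N₀ ≤ N → let ε := Literature.MathematicalPhysics.KineticTheory.hsDiameter σ N; let G := Literature.Analysis.FluidPDE.Torus.geometry (Fin 3); let bx : UnitAddTorus (Fin 3) → UnitAddTorus (Fin 3) → ℝ := fun x y => 3 / (Real.pi * r ^ 3) * max (1 - Literature.Analysis.FluidPDE.Torus.euclidDist x y / r) 0; let Θ := fun (Ξ : EuclideanSpace ℝ (Fin 3) × EuclideanSpace ℝ (Fin 3) × EuclideanSpace ℝ (Fin 3) → ℝ) (v w : EuclideanSpace ℝ (Fin 3)) => ∫ ω : Metric.sphere (0 : EuclideanSpace ℝ (Fin 3)) 1, Ξ ((ω : EuclideanSpace ℝ (Fin 3)), v, w) * Literature.MathematicalPhysics.KineticTheory.hardSphereKernel (w, v) ω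 ∂Literature.MathematicalPhysics.KineticTheory.sphereMeasure; let B₀ := fun Ξ (z : Literature.Analysis.FluidPDE.Config (N + 1) (Fin 3) Literature.MathematicalPhysics.KineticTheory.T3) (x₀ : UnitAddTorus (Fin 3)) => ∫ p, bx p.1.1 x₀ * bx p.2.1 x₀ * Θ Ξ p.1.2 p.2.2 ∂((Literature.Analysis.FluidPDE.empiricalMeasure z).prod (Literature.Analysis.FluidPDE.empiricalMeasure z)); let Δ := windowLenB A b N; Literature.MathematicalPhysics.KineticTheory.localGibbsLaw σ a₀ u₀ θ₀ N (Φ N) {z | ε / (N + 1 : ℝ) * wouldBeSum ε Δ z 0 (fun _ x y v w => χ x * Ξ (ε⁻¹ • G.sepVec x y, v, w)) < Δ * (g₃ * σ ^ 3 * (∫ x : UnitAddTorus (Fin 3), χ x * B₀ Ξ z x) - η)} ≤ ENNReal.ofReal δ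

/-! ## §9 Rung 0 (GLOBAL EQUILIBRIUM: constant profiles) — the two leaves and the crux restricted, composition proved

For constant profiles `(a, u, θ)` the local Gibbs law is the flow-INVARIANT canonical Gibbs law (tree:
`Theorems.measurePreserving_flow_localGibbsLaw_const`, `map_flow_localGibbsLaw_const`), every window-start marginal is the
canonical law itself, and both leaves become STATICS of the dilute canonical hard-sphere gas plus a one-window Palm bound — for
which the tree now holds the inputs built for the sibling crux 13079's line `even-rung-mean-variance`: the one-sided contact-scale
pair bound `Literature.…KineticTheory.posGibbs_pairEvent_ge` / `exists_posGibbs_pairEvent_ge` (written for THIS floor: the Gibbs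
mean of the collision-cylinder count is ≥ half the ideal one — NO contact theorem needed for a floor), the pair/triple upper bounds
`posGibbs_pairEvent_le`, `posGibbs_tripleEvent_le`, the short-flight window bound `localGibbsLaw_shortFlightCount_ge_le`
(`ShortFlightCount.lean`: collision-flux + three-label Palm bounds, LINEAR in the window), swept tubes `exists_sweptTube`, the
lift inequality `volume_setOf_exists_reprSym_add_latticeVec_mem_le`, Gaussian moments.  Assessment:
* `stub_noBurstsRung0` (S7a at rung 0) is PROVABLE NOW (size M–L): secondary incidences of window `Δ` are short flights of
  length `ℓ = Δ` (`Σ_k secondaryCount ≤ #short(Δ)` pathwise), `#multiPairs ≤ 2·#{(i,j,k) : j, k would-be partners of i}` is a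
  three-label tube event; both bounds are `O(τσ⁵m₂·A(N+1)^{1/3−b}) + o(1)`, so `b = 1/3`, `A ∝ ηδ` closes it by Markov.
* `stub_staticOpacityFloorRung0` (S7b at rung 0) reduces to: mean of the one-window would-be functional ≥ ½·ideal
  (`posGibbs_pairEvent_ge` + Gaussian velocity integrals + an inner collision cylinder), its fixed-time VARIANCE (four-label
  decorrelation = the hypothesis Plateau′ of 13079's rung-0 closure `EvenStressEnskog_rung0_of_plateau_contact`, stated there for
  exactly the products `h(xᵢ)1_T(xⱼ−xᵢ)·h′(x_k)1_{T′}(x_l−x_k)` a would-be indicator needs), the r-scale concentration of the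
  B-side (macroscopic LLN, cf. `stub_enskogRateVarianceRung0`), and a union bound over the `⌊τ/Δ⌋` windows (Chebyshev per window
  needs `b < 2/3`).  So `RateFloorRung0 ⇐ Plateau′` — at global equilibrium the crux is EASIER than 13079 (no contact theorem)
  and rests on the same single cluster-expansion input. -/

/-- **`RateFloor` AT GLOBAL EQUILIBRIUM** (constant profiles `a, u, θ`; everything else verbatim). [folklore] -/
def RateFloorRung0 : Prop :=
  ∃ g₀ : ℝ, 0 < g₀ ∧ ∀ (a θ : ℝ) (u : Literature.MathematicalPhysics.KineticTheory.V3), 0 < a → 0 < θ → ∃ σ₀ : ℝ, 0 < σ₀ ∧ ∀ σ : ℝ, 0 < σ → σ < σ₀ → ∀ Φ : (N : ℕ) → Literature.Analysis.FluidPDE.HardSphereFlow (Literature.Analysis.FluidPDE.Torus.geometry (Fin 3)) (Literature.MathematicalPhysics.KineticTheory.hsDiameter σ N) (N + 1), ∀ τ : ℝ, 0 < τ → ∀ χ : ℝ × UnitAddTorus (Fin 3) → ℝ, Continuous χ → (∀ p, 0 ≤ χ p) → ∀ Ξ : EuclideanSpace ℝ (Fin 3) × EuclideanSpace ℝ (Fin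 3) × EuclideanSpace ℝ (Fin 3) → ℝ, Continuous Ξ → (∀ q, 0 ≤ Ξ q) → (∃ C : ℝ, ∀ q, Ξ q ≤ C) → ∀ η δ : ℝ, 0 < η → 0 < δ → ∃ r₀ : ℝ, 0 < r₀ ∧ ∀ r : ℝ, 0 < r → r < r₀ → ∃ N₀ : ℕ, ∀ N : ℕ, N₀ ≤ N → let ε := Literature.MathematicalPhysics.KineticTheory.hsDiameter σ N; let G := Literature.Analysis.FluidPDE.Torus.geometry (Fin 3); let γ := fun z (s : ℝ) => (Φ N).flow s z; let bx : UnitAddTorus (Fin 3) → UnitAddTorus (Fin 3) → ℝ := fun x y => 3 / (Real.pi * r ^ 3) * max (1 - Literature.Analysis.FluidPDE.Torus.euclidDist x y / r) 0; let Θ := fun (Ξ : EuclideanSpace ℝ (Fin 3) × EuclideanSpace ℝ (Fin 3) × EuclideanSpace ℝ (Fin 3) → ℝ) (v w : EuclideanSpace ℝ (Fin 3)) => ∫ ω : Metric.sphere (0 : EuclideanSpace ℝ (Fin 3)) 1, Ξ ((ω : EuclideanSpace ℝ (Fin 3)), v, w) * Literature.MathematicalPhysics.KineticTheory.hardSphereKernel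 (w, v) ω ∂Literature.MathematicalPhysics.KineticTheory.sphereMeasure; let B := fun Ξ z s (x₀ : UnitAddTorus (Fin 3)) => ∫ p, bx p.1.1 x₀ * bx p.2.1 x₀ * Θ Ξ p.1.2 p.2.2 ∂((Literature.Analysis.FluidPDE.empiricalMeasure (γ z s)).prod (Literature.Analysis.FluidPDE.empiricalMeasure (γ z s))); let pv := fun z s (i j : Fin (N + 1)) => Literature.Analysis.FluidPDE.reflectVel (G.sepVec (γ z s i).1 (γ z s j).1) ((γ z s i).2, (γ z s j).2); let Kc := fun (Fn : Literature.Analysis.FluidPDE.Config (N + 1) (Fin 3) Literature.MathematicalPhysics.KineticTheory.T3 → ℝ → Fin (N + 1) → Fin (N + 1) → ℝ) z => ε / (N + 1 : ℝ) * ∑ᶠ (s : ℝ) (_ : s ∈ Literature.Analysis.FluidPDE.collisionTimes G ε (γ z) ∩ Set.Icc 0 τ), ∑ i : Fin (N + 1), ∑ j : Fin (N + 1), (if i ≠ j ∧ ‖G.sepVec (γ z s i).1 (γ z s j).1‖ = ε then Fn z s i j else 0); Literature.MathematicalPhysics.KineticTheory.localGibbsLaw σ (fun _ => a) (fun _ =>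 u) (fun _ => θ) N (Φ N) {z | Kc (fun z s i j => χ (s, (γ z s i).1) * Ξ (ε⁻¹ • G.sepVec (γ z s i).1 (γ z s j).1, (pv z s i j).1, (pv z s i j).2)) z < g₀ * σ ^ 3 * (∫ s in Set.Icc (0 : ℝ) τ, ∫ x : UnitAddTorus (Fin 3), χ (s, x) * B Ξ z s x) - η} ≤ ENNReal.ofReal δ

/-- The crux implies its rung-0 restriction (constant profiles are continuous and positive). [folklore] -/
theorem rateFloorRung0_of_rateFloor (h : RateFloor) : RateFloorRung0 := by
  obtain ⟨g₀, hg₀, h⟩ := h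
  exact ⟨g₀, hg₀, fun a θ u ha hθ => h (fun _ => a) (fun _ => θ) (fun _ => u) continuous_const continuous_const
    continuous_const (fun _ => ha) (fun _ => hθ)⟩

/-- **S7a₀ · NO BURSTS AT RUNG 0** (`stub_noBurstsRung0`; S7a restricted to constant profiles — PROVABLE NOW from tree statics, see
the §9 header: `Σ_k secondaryCount ≤ #short(Δ)` + `localGibbsLaw_shortFlightCount_ge_le`; `#multiPairs` by the three-label tube
bound `posGibbs_tripleEvent_le` with `exists_sweptTube` and the lift inequality; Gibbs invariance
`measurePreserving_flow_localGibbsLaw_const`; Markov; choose `b = 1/3`, `A ∝ ηδ/(τσ⁵m₂)`).  Why it might fail: no.  Leans on: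
the `Literature/MathematicalPhysics/KineticTheory/{ShortFlightCount, ShortFlightCharging, CollisionFluxUpperBound,
HardSphereCanonicalPairBound, HardSphereCanonicalClusterBound, SweptTube…}` toolkit and `Theorems/JParityClosureEvenStressEnskog
ShortFlightDeficitRung0.lean` as the pattern (it discharges the same hypotheses `hstat/hpair/htriple/htube/hlift`). [size M–L] -/
def Stubs.stub_noBurstsRung0 : Prop :=
  ∀ (a θ : ℝ) (u : Literature.MathematicalPhysics.KineticTheory.V3), 0 < a → 0 < θ → ∃ σ₀ : ℝ, 0 < σ₀ ∧ ∀ σ : ℝ, 0 < σ → σ < σ₀ → ∀ Φ : (N : ℕ) → Literature.Analysis.FluidPDE.HardSphereFlow (Literature.Analysis.FluidPDE.Torus.geometry (Fin 3)) (Literature.MathematicalPhysics.KineticTheory.hsDiameter σ N) (N + 1), ∀ τ : ℝ, 0 < τ → ∀ η δ : ℝ, 0 < η → 0 < δ → ∃ A : ℝ, 0 < A ∧ ∃ b : ℝ, 1 / 3 ≤ b ∧ b ≤ 1 ∧ ∃ N₀ : ℕ, ∀ N : ℕ, N₀ ≤ N → let ε := Literature.MathematicalPhysics.KineticTheory.hsDiameter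 σ N; let γ := fun z (s : ℝ) => (Φ N).flow s z; Literature.MathematicalPhysics.KineticTheory.localGibbsLaw σ (fun _ => a) (fun _ => u) (fun _ => θ) N (Φ N) {z | η < ε / (N + 1 : ℝ) * lineBursts ε (windowLenB A b N) τ (γ z)} ≤ ENNReal.ofReal δ

/-- Registered stub S7a₀ (`Stubs.stub_noBurstsRung0`, verbatim): CLOSED — landed as `Theorems/JParityClosureRateFloorNoBurstsRung0.lean`
(p122968, c3 wave-1 worker: `A := 1`, `b := 1/2`; assembly of `RateFloorNoBursts.stub_burstsRung0Bound` with
`EvenStressEnskog.shortFlightCountRung0_le`). -/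
theorem stub_noBurstsRung0 :
    ∀ (a θ : ℝ) (u : Literature.MathematicalPhysics.KineticTheory.V3), 0 < a → 0 < θ → ∃ σ₀ : ℝ, 0 < σ₀ ∧ ∀ σ : ℝ, 0 < σ → σ < σ₀ → ∀ Φ : (N : ℕ) → Literature.Analysis.FluidPDE.HardSphereFlow (Literature.Analysis.FluidPDE.Torus.geometry (Fin 3)) (Literature.MathematicalPhysics.KineticTheory.hsDiameter σ N) (N + 1), ∀ τ : ℝ, 0 < τ → ∀ η δ : ℝ, 0 < η → 0 < δ → ∃ A : ℝ, 0 < A ∧ ∃ b : ℝ, 1 / 3 ≤ b ∧ b ≤ 1 ∧ ∃ N₀ : ℕ, ∀ N : ℕ, N₀ ≤ N → let ε := Literature.MathematicalPhysics.KineticTheory.hsDiameter σ N; let γ := fun z (s : ℝ) => (Φ N).flow s z; Literature.MathematicalPhysics.KineticTheory.localGibbsLaw σ (fun _ => a) (fun _ => u) (fun _ => θ) N (Φ N) {z | η < ε / (N + 1 : ℝ) * lineBursts ε (windowLenB A b N) τ (γ z)} ≤ ENNReal.ofReal δ :=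
  Summit.AtomisticToContinuum.HydrodynamicLimit.Theorems.RateFloorNoBursts.stub_noBurstsRung0

/-- S7a implies S7a₀. [folklore] -/
theorem stub_noBurstsRung0_of (h : Stubs.stub_noBursts) : Stubs.stub_noBurstsRung0 :=
  fun a θ u ha hθ => h (fun _ => a) (fun _ => θ) (fun _ => u) continuous_const continuous_const continuous_const
    (fun _ => ha) (fun _ => hθ)

/-- **S7b₀ · STATIC OPACITY FLOOR AT RUNG 0** (`stub_staticOpacityFloorRung0`; S7b restricted to constant profiles — reduces to the
four-label decorrelation Plateau′ of 13079's rung-0 closure plus landed/elementary statics, see the §9 header; size L–XL).  Why it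
might fail: no (equilibrium statistical mechanics of the dilute hard-sphere gas); Plateau′ is a cluster-expansion statement true at
small `σ`.  Leans on: `posGibbs_pairEvent_ge` (mean), Plateau′ (variance), `HardSphereEulerLLN`-type r-scale LLN for the B-side,
`measurePreserving_flow_localGibbsLaw_const`, `integral_prod_empiricalMeasure_eq_sum`. [size L–XL] -/
def Stubs.stub_staticOpacityFloorRung0 : Prop :=
  ∃ g₃ : ℝ, 0 < g₃ ∧ ∀ (a θ : ℝ) (u : Literature.MathematicalPhysics.KineticTheory.V3), 0 < a → 0 < θ → ∃ σ₀ : ℝ, 0 < σ₀ ∧ ∀ σ : ℝ, 0 < σ → σ < σ₀ → ∀ Φ : (N : ℕ) → Literature.Analysis.FluidPDE.HardSphereFlow (Literature.Analysis.FluidPDE.Torus.geometry (Fin 3)) (Literature.MathematicalPhysics.KineticTheory.hsDiameter σ N) (N + 1), ∀ τ : ℝ, 0 < τ → ∀ χ : ℝ × UnitAddTorus (Fin 3) → ℝ, Continuous χ → (∀ p, 0 ≤ χ p) → ∀ Ξ : EuclideanSpace ℝ (Fin 3) × EuclideanSpace ℝ (Fin 3) × EuclideanSpace ℝ (Fin 3)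 → ℝ, Continuous Ξ → (∀ q, 0 ≤ Ξ q) → (∃ C : ℝ, ∀ q, Ξ q ≤ C) → ∀ η δ : ℝ, 0 < η → 0 < δ → ∃ r₀ : ℝ, 0 < r₀ ∧ ∀ r : ℝ, 0 < r → r < r₀ → ∀ A : ℝ, 0 < A → ∀ b : ℝ, 1 / 3 ≤ b → b ≤ 1 → ∃ N₀ : ℕ, ∀ N : ℕ, N₀ ≤ N → let ε := Literature.MathematicalPhysics.KineticTheory.hsDiameter σ N; let G := Literature.Analysis.FluidPDE.Torus.geometry (Fin 3); let γ := fun z (s : ℝ) => (Φ N).flow s z; let bx : UnitAddTorus (Fin 3) → UnitAddTorus (Fin 3) → ℝ := fun x y => 3 / (Real.pi * r ^ 3) * max (1 - Literature.Analysis.FluidPDE.Torus.euclidDist x y / r) 0; let Θ := fun (Ξ : EuclideanSpace ℝ (Fin 3) × EuclideanSpace ℝ (Fin 3) × EuclideanSpace ℝ (Fin 3) → ℝ) (v w : EuclideanSpace ℝ (Fin 3)) => ∫ ω : Metric.sphere (0 : EuclideanSpace ℝ (Fin 3)) 1, Ξ ((ω : EuclideanSpace ℝ (Fin 3)), v, w)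 * Literature.MathematicalPhysics.KineticTheory.hardSphereKernel (w, v) ω ∂Literature.MathematicalPhysics.KineticTheory.sphereMeasure; let B := fun Ξ z s (x₀ : UnitAddTorus (Fin 3)) => ∫ p, bx p.1.1 x₀ * bx p.2.1 x₀ * Θ Ξ p.1.2 p.2.2 ∂((Literature.Analysis.FluidPDE.empiricalMeasure (γ z s)).prod (Literature.Analysis.FluidPDE.empiricalMeasure (γ z s))); let SW := fun (z : Literature.Analysis.FluidPDE.Config (N + 1) (Fin 3) Literature.MathematicalPhysics.KineticTheory.T3) => lineSW ε (windowLenB A b N) τ (γ z) (fun u x y v w => χ (u, x) * Ξ (ε⁻¹ • G.sepVec x y, v, w)); Literature.MathematicalPhysics.KineticTheory.localGibbsLaw σ (fun _ => a) (fun _ => u) (fun _ => θ) N (Φ N) {z | SW z < g₃ * σ ^ 3 * (∫ s in Set.Icc (0 : ℝ) τ, ∫ x : UnitAddTorus (Fin 3), χ (s, x) * B Ξ z s x) - η} ≤ ENNReal.ofReal δ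

/-- Registered stub S7b₀ (`Stubs.stub_staticOpacityFloorRung0`, verbatim): CLOSED — landed as
`Theorems/JParityClosureRateFloorStaticFloorRung0Closed.lean` (p123314, c3 wave-1 worker: `staticOpacityFloorRung0_of_plateauWindow`
(c2, p121629) fed with `EvenStressEnskog.plateauWindow_of_twoCluster_labelLaw vcan_append_sub_mul_le integral_labelLaw_eq_integral_mul_vcan`
(13079 c1, p120767), `g₃ = 1/8`). -/
theorem stub_staticOpacityFloorRung0 :
    ∃ g₃ : ℝ, 0 < g₃ ∧ ∀ (a θ : ℝ) (u : Literature.MathematicalPhysics.KineticTheory.V3), 0 < a → 0 < θ → ∃ σ₀ : ℝ, 0 < σ₀ ∧ ∀ σ : ℝ, 0 < σ → σ < σ₀ → ∀ Φ : (N : ℕ) → Literature.Analysis.FluidPDE.HardSphereFlow (Literature.Analysis.FluidPDE.Torus.geometry (Fin 3)) (Literature.MathematicalPhysics.KineticTheory.hsDiameter σ N) (N + 1), ∀ τ : ℝ, 0 < τ → ∀ χ : ℝ × UnitAddTorus (Fin 3) → ℝ, Continuous χ → (∀ p, 0 ≤ χ p) → ∀ Ξ : EuclideanSpace ℝ (Fin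 3) × EuclideanSpace ℝ (Fin 3) × EuclideanSpace ℝ (Fin 3) → ℝ, Continuous Ξ → (∀ q, 0 ≤ Ξ q) → (∃ C : ℝ, ∀ q, Ξ q ≤ C) → ∀ η δ : ℝ, 0 < η → 0 < δ → ∃ r₀ : ℝ, 0 < r₀ ∧ ∀ r : ℝ, 0 < r → r < r₀ → ∀ A : ℝ, 0 < A → ∀ b : ℝ, 1 / 3 ≤ b → b ≤ 1 → ∃ N₀ : ℕ, ∀ N : ℕ, N₀ ≤ N → let ε := Literature.MathematicalPhysics.KineticTheory.hsDiameter σ N; let G := Literature.Analysis.FluidPDE.Torus.geometry (Fin 3); let γ := fun z (s : ℝ) => (Φ N).flow s z; let bx : UnitAddTorus (Fin 3) → UnitAddTorus (Fin 3) → ℝ := fun x y => 3 / (Real.pi * r ^ 3) * max (1 - Literature.Analysis.FluidPDE.Torus.euclidDist x y / r) 0; let Θ := fun (Ξ : EuclideanSpace ℝ (Fin 3) × EuclideanSpace ℝ (Fin 3) × EuclideanSpace ℝ (Fin 3) → ℝ) (v w : EuclideanSpace ℝ (Fin 3)) => ∫ ω : Metric.sphere (0 : EuclideanSpace ℝ (Fin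 3)) 1, Ξ ((ω : EuclideanSpace ℝ (Fin 3)), v, w) * Literature.MathematicalPhysics.KineticTheory.hardSphereKernel (w, v) ω ∂Literature.MathematicalPhysics.KineticTheory.sphereMeasure; let B := fun Ξ z s (x₀ : UnitAddTorus (Fin 3)) => ∫ p, bx p.1.1 x₀ * bx p.2.1 x₀ * Θ Ξ p.1.2 p.2.2 ∂((Literature.Analysis.FluidPDE.empiricalMeasure (γ z s)).prod (Literature.Analysis.FluidPDE.empiricalMeasure (γ z s))); let SW := fun (z : Literature.Analysis.FluidPDE.Config (N + 1) (Fin 3) Literature.MathematicalPhysics.KineticTheory.T3) => lineSW ε (windowLenB A b N) τ (γ z) (fun u x y v w => χ (u, x) * Ξ (ε⁻¹ • G.sepVec x y, v, w)); Literature.MathematicalPhysics.KineticTheory.localGibbsLaw σ (fun _ => a) (fun _ => u) (fun _ => θ) N (Φ N) {z | SW z < g₃ * σ ^ 3 * (∫ s in Set.Icc (0 : ℝ) τ, ∫ x : UnitAddTorus (Fin 3), χ (s, x) * B Ξ z s x) - η} ≤ ENNReal.ofReal δ :=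
  Summit.AtomisticToContinuum.HydrodynamicLimit.Theorems.RateFloorStaticFloor.stub_staticOpacityFloorRung0

/-- S7b implies S7b₀. [folklore] -/
theorem stub_staticOpacityFloorRung0_of (h : Stubs.stub_staticOpacityFloor) : Stubs.stub_staticOpacityFloorRung0 := by
  obtain ⟨g₃, hg₃, h⟩ := h
  exact ⟨g₃, hg₃, fun a θ u ha hθ => h (fun _ => a) (fun _ => θ) (fun _ => u) continuous_const continuous_const
    continuous_const (fun _ => ha) (fun _ => hθ)⟩

/-- **`RateFloor` AT GLOBAL EQUILIBRIUM from S10 and the two rung-0 leaves** (composition proved: `rateFloorAt_of` at constant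
profiles).  With S7a₀ provable now, `RateFloorRung0 ⇐ stub_staticOpacityFloorRung0 ⇐ Plateau′`. [folklore] -/
theorem rateFloorRung0_of (hA : Stubs.stub_noBurstsRung0)
    (hB : Stubs.stub_staticOpacityFloorRung0) : RateFloorRung0 := by
  obtain ⟨g₃, hg₃, hB⟩ := hB
  exact ⟨g₃, hg₃, fun a θ u ha hθ => rateFloorAt_of stub_preemptionCharge (hA a θ u ha hθ) (hB a θ u ha hθ)⟩

/-- **`RateFloor` AT GLOBAL EQUILIBRIUM — UNCONDITIONAL** (c3: both rung-0 leaves are landed theorems, p122968 and p123314; the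
def-free tree copy of this composition is `Theorems.RateFloorRung0.stub_rateFloorRung0`, file
`Theorems/JParityClosureRateFloorRung0.lean`). [folklore] -/
theorem rateFloorRung0_holds : RateFloorRung0 :=
  rateFloorRung0_of stub_noBurstsRung0 stub_staticOpacityFloorRung0

/-- **`RateFloor` from the OPEN stubs** (gen-1 composition, alias of `rateFloor_of_noBursts_staticFloor`): the landed S8 fed
with the landed S6d (fed with S6a) gives `K ≥ S_R` surely; S10 gives `S_R ≥ S_W − (ε/n)M·Bursts` surely; S7a and S7b
control the two residual events in probability.  S1–S3, S6c, S9 are landed kinematic by-products (S9 is what retired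
ex-S7); S4, S5 the landed engines intended for S7b.  Sorry-free; the statement `Prop`s `Stubs.stub_*` are named like the
registered stubs. [folklore] -/
theorem RateFloor_of (hS7a : Stubs.stub_noBursts) (hS7b : Stubs.stub_staticOpacityFloor) : RateFloor :=
  rateFloor_of_noBursts_staticFloor hS7a hS7b

/-- **The skeleton IS the crux proof modulo the registered stubs**: sorry-free itself; its gaps are the two in-probability
leaves S7a `stub_noBursts`, S7b `stub_staticOpacityFloor` for GENERAL profiles (c4's entropy stub S11 is a second, recorded route, believed
false for the filed crux — §7¾) — every kinematic stub (S1–S6, S8, S9, S10) and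
both rung-0 leaves S7a₀, S7b₀ (§9, c3) are landed and imported; `rateFloorRung0_holds : RateFloorRung0` is unconditional. [folklore] -/
theorem RateFloor_proof : RateFloor :=
  RateFloor_of stub_noBursts stub_staticOpacityFloor

/-- The c4 entropy route to the same conclusion (modulo S11 — believed FALSE for the filed crux, §7¾; kept as the record of the reduction;
its live forms are `rateFloorKinetic_of_eqSuperExpDeficitKinetic`, `rateFloorFlat_of_eqSuperExpDeficitFlat`). [folklore] -/
theorem RateFloor_proof' : RateFloor :=
  rateFloor_of_eqSuperExpDeficit stub_eqSuperExpDeficit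

end Summit.AtomisticToContinuum.HydrodynamicLimit.Cruxes.RateFloor.SketchLine

end
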